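import Summits.HodgeConjecture.HodgeConjecture.Cruxes.H413.Lines.F0_T1InnerFormTraceIdentity
import Summits.HodgeConjecture.HodgeConjecture.Theorems.F0P3KitOfRecord
import Summits.HodgeConjecture.HodgeConjecture.Theorems.F0P3ClassificationLawsV6
import Summits.HodgeConjecture.HodgeConjecture.Theorems.F0P3LettersRouting
import Summits.HodgeConjecture.HodgeConjecture.Theorems.F0P3LettersXiLocalPacketUnitary
import Literature.NumberTheory.Rogawski1990.SemilocalCharactersLinIndep
import Literature.NumberTheory.Rogawski1990.XiPinSphericalCofinite
import Summits.HodgeConjecture.HodgeConjecture.Theorems.F0P3LettersTraceFactorisationS0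
import Literature.NumberTheory.Automorphic.AnisotropicSmoothTraceExpansion
import Literature.NumberTheory.Rogawski1990.U3PrincipalSeriesReducibility
import Summits.HodgeConjecture.HodgeConjecture.Theorems.F0P3XiSideOfRecord
import Summits.HodgeConjecture.HodgeConjecture.Theorems.F0P3XiPacketFamilyOfRecordGlue
import Summits.HodgeConjecture.HodgeConjecture.Theorems.F0P3KitOfRecordLawsV8
import Summits.HodgeConjecture.HodgeConjecture.Theorems.F0P3RamClsOfRecord
import Summits.HodgeConjecture.HodgeConjecture.Theorems.F0P3UnitaryLocOfRecord
import Summits.HodgeConjecture.HodgeConjecture.Theorems.F0P3LettersTraceFactorisation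
import Literature.NumberTheory.Automorphic.UnitaryGroupArchCharacter
import Literature.NumberTheory.Rogawski1990.CMCharIdentityClauses
import Literature.NumberTheory.Rogawski1990.TransferFactsStabilisation
import Literature.NumberTheory.Rogawski1990.TransferFactsCanonical
import Summits.HodgeConjecture.HodgeConjecture.Cruxes.H413.Lines.F0_T1InnerFormTraceIdentityAPI
import Summits.HodgeConjecture.HodgeConjecture.Theorems.F0P3LettersSpectralSideGp
import Summits.HodgeConjecture.HodgeConjecture.Theorems.F0P3LettersLinIndepS
import Summits.HodgeConjecture.HodgeConjecture.Theorems.F0P3ClassificationBridgeV8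
import Summits.HodgeConjecture.HodgeConjecture.Theorems.F0P3bUnitaryPacketAtKitOfRecord
import Summits.HodgeConjecture.HodgeConjecture.Theorems.F0P3ClassTokensOfRecord
import Literature.NumberTheory.Rogawski1990.SemilocalQuadraticCharExtension
import Summits.HodgeConjecture.HodgeConjecture.Theorems.F0P3N3ConeClosed
import Summits.HodgeConjecture.HodgeConjecture.Theorems.F0P3HatLawsKitK9
import Summits.HodgeConjecture.HodgeConjecture.Theorems.F0P3RoutingOfCot
import Summits.HodgeConjecture.HodgeConjecture.Theorems.F0P3KitOfRecordLettersV8Cot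
import Summits.HodgeConjecture.HodgeConjecture.Theorems.F0P3CohClassRoutingCot
import Summits.HodgeConjecture.HodgeConjecture.Theorems.F0T1bSemilocalCharactersLinIndepOfStubs
import Summits.HodgeConjecture.HodgeConjecture.Theorems.F0P3CohClassRoutingCotOfS2Sharp
import Summits.HodgeConjecture.HodgeConjecture.Theorems.F0P3OverrideWitnessOfLetters
import Summits.HodgeConjecture.HodgeConjecture.Theorems.F0P3TraceFactorisationOfStubs
import Summits.HodgeConjecture.HodgeConjecture.Theorems.F0P3LettersArchBlockStructure
import Literature.NumberTheory.Rogawski1990.LocalTransferExplicitSplit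
import Literature.NumberTheory.Rogawski1990.UnitFundamentalLemmaExplicitSplit
import Summits.HodgeConjecture.HodgeConjecture.Theorems.F0P3XiPinSphericalCofiniteHolds
import Summits.HodgeConjecture.HodgeConjecture.Theorems.F0P3AnisotropicSmoothTraceExpansionHolds
import Summits.HodgeConjecture.HodgeConjecture.Cruxes.H413.Lines.F0_T1InnerFormTraceIdentityNonreg
import Summits.HodgeConjecture.HodgeConjecture.Theorems.F0P3Rung0OfLetters
import Literature.NumberTheory.Rogawski1990.ArchTransfersSingularOfCanonical
import Literature.NumberTheory.Rogawski1990.ArchCentralValueTransferExists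
import Literature.NumberTheory.Rogawski1990.LocalTransferUnitExplicitFactor
import Literature.NumberTheory.Rogawski1990.TamagawaSingularMembersLetter
import Literature.NumberTheory.Rogawski1990.SingularEllipticTransferCanonicalPinned          -- ED. 4 «#175 PINNED»: `SingularEllipticTransferCanonicalAtDelta` (★ #88's text with `Δ` hoisted) — the re-typed `Rung0WitnessS.hSET`, `Δ` PINNED to print՚s `Δ‴(μω)`
import HarnessLib
import Summits.HodgeConjecture.HodgeConjecture.Theorems.F0P3HJ3aOfFiveLetters
import Summits.HodgeConjecture.HodgeConjecture.Theorems.F0P2dSocketD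
import Summits.HodgeConjecture.HodgeConjecture.Theorems.F0P3ArchIsotypyConj
import Summits.HodgeConjecture.HodgeConjecture.Theorems.F0P3StubF1aHolHalf
import Summits.HodgeConjecture.HodgeConjecture.Theorems.F0P3StubF1bCM
import Summits.HodgeConjecture.HodgeConjecture.Theorems.F0P3StubBetaOppFold
import Summits.HodgeConjecture.HodgeConjecture.Theorems.F0P3StubBetaOppAdmFold
import Summits.HodgeConjecture.HodgeConjecture.Theorems.F0P3StubE1hFold
import Summits.HodgeConjecture.HodgeConjecture.Theorems.F0P3StubE2pFold
import Summits.HodgeConjecture.HodgeConjecture.Theorems.F0P3HJ3aOfLettersCoh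
import Summits.HodgeConjecture.HodgeConjecture.Cruxes.H413.Lines.a3_liu413
import Summits.HodgeConjecture.HodgeConjecture.Theorems.F0P2aCohIsotypicLineHolds
import Summits.HodgeConjecture.HodgeConjecture.Theorems.F0FloorSockets
import Literature.NumberTheory.Automorphic.DiscreteAutomorphicRepArchIsotypy
import Literature.NumberTheory.Automorphic.DiscreteAutomorphicRepSmoothRepresentative
import Literature.NumberTheory.Automorphic.UnitaryGroupDiscreteRepComponents
import Literature.NumberTheory.Automorphic.DiscreteAutomorphicRepArchModuleCM
import Summits.HodgeConjecture.HodgeConjecture.Theorems.F0P3HolProjectionOfF2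
import Summits.HodgeConjecture.HodgeConjecture.Theorems.F0P3SLayerFoldShapesAdm
import Summits.HodgeConjecture.HodgeConjecture.Theorems.F0P3MemXiFamilyTransfer
import Literature.NumberTheory.Rogawski1990.GlobalAPacketLetters
import Summits.HodgeConjecture.HodgeConjecture.Theorems.F0P3XiSideOfRecordSCD
import Summits.HodgeConjecture.HodgeConjecture.Theorems.F0P3RoutingOfCotSCD
import Summits.HodgeConjecture.HodgeConjecture.Theorems.F0P3XiEvpOfRecordSCDSigned
import Summits.HodgeConjecture.HodgeConjecture.Theorems.F0P3KitOfRecordW                      -- ED. 3 (closer ED. 38 «PK-ε»): ★1 K0-W p847005 `kitOfRecordW … μω wXi c …` (`N := N₀ + [wXi ξ = −1]`, `sgnG := wXi ξ · c`)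
import Summits.HodgeConjecture.HodgeConjecture.Theorems.F0P3bLocalExpansionAtKitOfRecordW        -- ED. 3: ★2 P3b «W» p847030 `GTraceProductFormW … μω wXi jInf dsInf …` ((P3′)-G with the root number), `localExpansion_kitOfRecordW`
import Summits.HodgeConjecture.HodgeConjecture.Theorems.F0P3OverrideWitnessOfLettersW             -- ED. 3: ★5-W (F0P3-p01 (g18)) `specPkg_kitOfRecordW_ghOfFibres_of_productFormW` (the `k9_of_stfS` witness at the W kit)

/-!
# `F0_U3LettersRung1Defs` — SORRY-FREE COMPANION MODULE OF THE CLOSER `F0_U3LettersRung1` (ED. 20 «SPLIT ONLY»; desk F0P3-plan (g8) RULING D22, 2026-09-01; pen F0P3-p04 (g10)) — EDITION 4 «#175 PINNED» (ONE field re-typed: `Rung0WitnessS.hSET` ↦ ★ `SingularEllipticTransferCanonicalAtDelta L H Tinf Δ‴(μω) …`, `Δ` no longer universally bound; + ONE import; every other byte of ED. 3 unchanged) — EDITION 2 «QCMT SIGNED» (desk F0P3-plan (g9) RULING D29: + the SIGNED twins `…S`∕`K9SpectralLetterSigned`, appended) — EDITION 3 «PK-ε» (desk F0P3-plan (g12)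 RULING D53-pre: the signed §K9S∕§Rung0S blocks carry the per-ξ global ROOT NUMBER `wXi` [Rogawski1992 Thm. 1.2], in place)

EDITION 4 (2026-09-03, «#175 PINNED» — the Defs side of closer ED. 44; director g36 s1830 ORDER «re-letter #175 at AGG ED. 44»; heir LEAD F0P3a-plan (g19) T18-10 «#175-R SCOPE» (1)(c) T4;
desk F0P3-plan (g22) D-O7 ∕ D-O7b (C); K2E4-r01 (g0) O7 VERDICT 9d20d85d782e07ce (+ U1-FALSIFIER ad7420429788ac50): letter #175 `stub_S1finTFCovol` is MISSTATED AS TYPED on the weak frame —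
its text binds the finite transfer-factor collection `Δ` UNIVERSALLY while its κ-clauses read singular classes; pen registrar A-plan1 (g34) m18 «PIN Δ, KEEP `W.Tinf`»).  WHAT CHANGES
(base ED. 3 af5b824eed5e58b2): (i) + `import Literature.NumberTheory.Rogawski1990.SingularEllipticTransferCanonicalPinned`; (ii) the LAST LINE of the field `Rung0WitnessS.hSET`:
`…SingularEllipticTransferCanonical L H Tinf νH νG νGi νqi νHi ν` ↦ `…SingularEllipticTransferCanonicalAtDelta L H Tinf (finExplicitCollection L H μω (finExplicitDelta_conj_left_all L H μω)
(finExplicitDelta_conj_right_all L H μω)) νH νG νGi νqi νHi ν` — the §14.5 singular-elliptic transfer package AT PRINT՚S finite factors `Δ‴(μω)` [Rogawski1990 §4.9 p. 55] and at the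
witness՚s OWN archimedean factor `Tinf` (a FIELD of the record, set to `archCanonicalTransferFactor L H μω` = `Δ‴_∞` by the only constructors, KitRung0 `Kit.rung0_of_letters_pinned`);
its Haar ∕ Borel preamble (26 lines) byte-identical.  Nothing is universally quantified over `Tinf` or `Δ` any more in the rung-0 witness, so the O7 phase twist has nothing to
instantiate; the constructor receives T1՚s ★ `hSET : SingularEllipticTransferCanonicalPinned L H μω …` AS IS (δ-equal at `Tinf := archCanonicalTransferFactor L H μω`), and the
consumers (KitD ED. 7 → the T1-API pinned export) need no `W.Tinf = Δ‴_∞` equation — the rider՚s `hq.1 : Δ = Δ‴` is the whole pin.  `StubRung0S` (now without producer) and every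
other declaration: byte-identical to ED. 3.

EDITION 3 (2026-09-01, «PK-ε» — the Defs side of closer ED. 38; desk F0P3-plan (g12) RULING D53-pre A(2)–(4) + (10)(11), LEAD F0P3a-plan (g12) T11-64∕T11-66 VARIANT 2 (objection of record ref1 (g12) OBJ-3 «root number»: Rogawski՚s own erratum [Rogawski1992 Thm. 1.2] puts the global root number `ε(½, φ_ξ)` on the `Tr Π(ξ)(f)` term of (14.6.3)), census B1–B5 9c22b97a2bccd400 (F0P3a-p02 (g15)); pen of record F0P3-p04 (g13), generator `work/ed38/mk_ed38_defs.py` over the tree ED. 2 bytes 5e09b4177253cae5; IN-PLACE RE-TYPE of the SIGNED blocks ONLY — lines 1–992 of ED. 2 (the §A kit, the UNSIGNED §K9∕§Rung0 twins = dead text off the `hJ3a` path) are BYTE-IDENTICAL except the three new imports and this paragraph): §K9S variable `(c : ℚ) (wXi : OneDimAutRepH L → ℤ) (jInf dsInf …)` (CONVENTION of record, desk (11): `wXi` IMMEDIATELY AFTER `c` letter-side, `… μω wXi c …` kit-side (★1), `hw` IMMEDIATELY BEFORE `hc`, G-side `μω wXi`); `kitK9S` := ★1 `F0P3KitOfRecordW.kitOfRecordW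 … μω wXi c …` (so `OverrideWitnessS.specPkg : SpecPkg (kitK9S … c wXi …) S₀` — the sign-BEARING package — sits at the W kit; every sign-BLIND law transports by ★1b `…_kitOfRecordW_iff := Iff.rfl`, F0P3-p03 (g14) probe 5ada654d0190fa95: 24∕26, the two sign-bearing ones are exactly `LocalExpansion`∕`UnitaryPacket`); `Q_K9S`∕`OverrideWitnessS` thread `wXi`; `Rung0WitnessS` gains the field `wXi` (after `c`) and the fact `hw : ∀ ξ, wXi ξ = 1 ∨ wXi ξ = -1` (before `hc`) and feeds `Q_K9S … Tinf c wXi jInf dsInf …`; `StubRung0S` TEXT UNCHANGED (VALUE moves); `K9SpectralLetterSigned … (c : ℚ) (wXi : OneDimAutRepH L → ℤ) (jInf dsInf …)` with (P3′)-G at ★2 `F0P3bLocalExpansionAtKitOfRecordW.GTraceProductFormW … μω wXi jInf dsInf …` and (P1)∕(P2)∕(P3′)-H∕(T)∕(P4)∕(P5) BYTE-IDENTICAL at `kitOfRecord … c` (sign-blind, desk (10) (n4)); `k9_of_stfS`: hypothesis∕conclusion ∃ `(c) (wXi) (jInf dsInf)` + `(∀ ξ, wXi ξ = 1 ∨ wXi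 ξ = -1)`, witness by ★5-W `F0P3OverrideWitnessOfLettersW.specPkg_kitOfRecordW_ghOfFibres_of_productFormW … μω wXi c jInf dsInf … S₀ hw hc hP1 hP2 hPG hPH`.  GOVERNANCE: `K9SpectralLetterSigned`՚s text is consumed by the DERIVED rows `stub_K9STFSv`∕`stub_K9v` only (registered since closer ED. 33: `stub_PKtuple : PKtupleLetter`, T-A) — no registered string lives in this module.  Still NO `sorry`, NO stub, NO registry row, no `instance`, no notation.  HC_CM is proved only modulo the printed citations until rung 0 closes; this module discharges nothing.

EDITION 2 (2026-09-01, «QCMT SIGNED» — the Defs side of closer ED. 26; desk F0P3-plan (g9) RULING D29; ADDITIVE SUPERSEDE-NOT-EDIT): lines 1–977 of ED. 1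
(6057541c0df32068) are BYTE-IDENTICAL below this paragraph except the ONE new import ★ `Theorems.F0P3XiEvpOfRecordSCDSigned` (p843355; it carries ★ p843297
`CharIdentityOnTestFunctionsSignedLemmas` → ★ p842701 `CharIdentityOnTestFunctionsSigned`); APPENDED after `end Rung0`: `section K9S` (`kitK9S`, `OverrideWitnessS`, `Q_K9S`) and
`section Rung0S` (`Rung0WitnessS`, `StubRung0S`, `K9SpectralLetterSigned`, `k9_of_stfS`) = the seven §K9∕§Rung0 blocks VERBATIM under the token map τ of RULING D29
(`CMCharIdentityPackageTest` ↦ `CMCharIdentityPackageTestSigned`, `hSCD_of_cmCharIdentityPackageTest` ↦ `…Signed`, the six plumbing names ↦ `…S`, `K9SpectralLetter` ↦ `K9SpectralLetterSigned`).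
WHY TWINS AND NOT AN IN-PLACE RE-TYPE (REF1 (g9) R-46): `K9SpectralLetter` binds the UNSIGNED package `hQ : CMCharIdentityPackageTest` in NEGATIVE position, so the unsigned and the
signed letters are INCOMPARABLE — re-typing `hQ` in place would restate the registered letter `stub_K9STF` under an unchanged string; and the served closer ED. 25 names the
unsigned chain, so an in-place re-type would break it between the Defs write and the closer write.  GOVERNANCE: `K9SpectralLetterSigned`՚s def-text is part of the NEW registered
letter `stub_K9STFS` of closer ED. 26 (any edit of its body = a re-registration event); `K9SpectralLetter` (def-text a578fcc13aa38151) is the text of the WITHDRAWN letter `stub_K9STF`.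
Still NO `sorry`, NO stub, NO registry row here.  HC_CM is proved only modulo the printed citations until rung 0 closes; this module discharges nothing.

NOT a line, NO stubs, NO registry row, NO `sorry`: the K9β DEFINITION BLOCKS moved VERBATIM out of `Cruxes/H413/Lines/F0_U3LettersRung1.lean` (which stood at 194 675 ∕ 200 000 B
after ED. 19b) so that (i) the closer regains ≈ 60 KB of byte head-room for the junction editions to come and (ii) a K9-STF pay-down line can NAME
`K9SpectralLetter` ∕ `Q_K9` ∕ `kitK9` ∕ `OverrideWitness` by importing THIS module instead of the sorried closer (import topology of the #115 road).
SAME namespaces as in the closer (every fully-qualified name, hence every registered statement string and T1՚s `{Q := Q_K9 …}` instantiation, is unchanged);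
imports = the closer՚s 71 ★ modules.  CONTENTS (all ★-era texts, token-identical to tree ED. 19b 048f4376faa29035):
* §A T1-override kit (namespace `…F0T1InnerFormTraceIdentity`: `SpecOverride`, `ComparisonKit.override`, `SpecPkgT1`, `override_*_iff`, `lawsT1_override`,
  `innerFormStableTraceIdentity_override`; namespace `…F0P3KitOfRecord`: `isAutomorphicMeasure_cmDatum_of_gp` (the one historical instance, moved not added), `socketsOfT1`,
  `traceIdentity_kitOfRecord_ofT1`, `traceIdentity_kitOfRecord_override`);
* §K9 (namespace `…F0U3LettersRung1`, `section K9`: variable block, `kitK9`, `OverrideWitness`, `Q_K9`); `section Rung0`: variable block, `Rung0Witness`, `StubRung0`,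
  `K9SpectralLetter` (GOVERNANCE RULE OF RECORD: its text is part of the registered letter `stub_K9STF`; def-text sha16 a578fcc13aa38151 must reproduce on this file՚s slice;
  any edit of the def body = a re-registration event), and NEW `theorem k9_of_stf : ‹stub_K9STF՚s statement› → ‹stub_K9՚s statement›` = block (W)՚s junction body of ED. 17–19b
  re-headed over a hypothesis (the closer՚s `stub_K9` becomes `:= k9_of_stf stub_K9STF`).
HONEST LABEL: HC_CM is proved only modulo the printed citations until rung 0 closes; this module discharges nothing.
-/

/-!
# K9β §A (draft, F0P3-p04 (g7)) — `SpecOverride`, `ComparisonKit.override`, `SpecPkgT1`, `Sockets.ofT1`, and T1's head ⇒ law #1 `TraceIdentity` AT 𝔠₀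

ED. 4 material for `Cruxes/H413/Lines/F0_U3LettersRung1.lean` (PLAN ERRATUM 6 (3)(4), RULING (V42), K8-LETTERS §10): T1's anchor kit `w.kit` has PLACEHOLDER
spectral sockets (`SθG … SJMH := 0`, `PacketG PacketH := PUnit`, `nG nH trG trH := 0`), so the witnessed package quantifies `∃ ov : SpecOverride L`, and
asserts T1c–T1f for `𝔨.override ov` (structure `SpecPkgT1`); T1a ∕ T1b ∕ T1g and the transfer data `Δ mH mG` are UNTOUCHED by the override (`Iff.rfl` ∕ `rfl`
below), so T1's head `InnerFormStableTraceIdentity` holds for the overridden kit from (T1a, T1b, T1g at `𝔨`) + `SpecPkgT1 (𝔨.override ov)`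
(`innerFormStableTraceIdentity_override`), and IS law #1 `TraceIdentity` of ★ V6-B at `𝔠₀ := kitOfRecord (Sockets.ofT1 (𝔨.override ov)) …` by `rfl`
(`traceIdentity_kitOfRecord_ofT1`).  HC_CM is proved only modulo the printed citations until rung 0 closes.
-/

set_option autoImplicit false
set_option linter.dupNamespace false

noncomputable section

open MeasureTheory NumberField IsDedekindDomain
open scoped Matrix

/-! ## §A.1 The spectral override of a comparison kit -/

namespace Summit.HodgeConjecture.HodgeConjecture.Cruxes.H413.F0T1InnerFormTraceIdentity

open Literature.NumberTheory.Automorphic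

variable (L : Type) [Field L] [NumberField L] [IsCMField L]

/-- **`SpecOverride L`** — replacement values for the twelve SPECTRAL sockets of a `ComparisonKit` that T1's anchor kit leaves as placeholders:
the stable ∕ `M`-distributions `SθG SθH SθM SJM SθMH SJMH` [Rogawski1990, Thm. 10.3.1; Prop. 11.2.1; pp. 240–241] and the packet data
`PacketG PacketH nG nH trG trH` [§13.3; Thm. 14.6.1].  DATA ONLY. -/
structure SpecOverride : Type 1 where
  /-- `Sθ_G` -/
  SθG : TestG L → ℂ
  /-- `Sθ_H` -/
  SθH : TestH L → ℂ
  /-- `Sθ_M` -/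
  SθM : TestG L → ℂ
  /-- `SJ_M` -/
  SJM : TestG L → ℂ
  /-- `Sθ_{M_H}` -/
  SθMH : TestH L → ℂ
  /-- `SJ_{M_H}` -/
  SJMH : TestH L → ℂ
  /-- `Π(G)` -/
  PacketG : Type
  /-- `Π(H)` -/
  PacketH : Type
  /-- `n(Π)` -/
  nG : PacketG → ℂ
  /-- `n(ρ)` -/
  nH : PacketH → ℂ
  /-- `Tr Π(f)` -/
  trG : PacketG → TestG L → ℂ
  /-- `Tr ρ(f^H)` -/
  trH : PacketH → TestH L → ℂ

namespace ComparisonKit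

variable {L} {H : Matrix (Fin 3) (Fin 3) L}
  {μ : Measure (UnitaryGroup.cmDatum L 3 H).automorphicQuotient} [(UnitaryGroup.cmDatum L 3 H).IsAutomorphicMeasure μ]
  (𝔨 : ComparisonKit L H μ) (ov : SpecOverride L)

/-- **`𝔨.override ov`** — the kit `𝔨` with its twelve spectral sockets replaced by `ov`; every other field (trace functional, multiplicities, `ψ_v`,
`Smooth`, `Transfer(H)`, the transfer data `Δ mH mG …`, the `J`∕`SJ` sockets) is `𝔨`'s. [Rogawski1990, §14.6 p. 241] -/
def override : ComparisonKit L H μ :=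
  { 𝔨 with
    SθG := ov.SθG, SθH := ov.SθH, SθM := ov.SθM, SJM := ov.SJM, SθMH := ov.SθMH, SJMH := ov.SJMH
    PacketG := ov.PacketG, PacketH := ov.PacketH, nG := ov.nG, nH := ov.nH, trG := ov.trG, trH := ov.trH }

/-- **`SpecPkgT1 𝔨`** — T1's `S`-class laws T1c–T1f [Rogawski1990, Thm. 14.6.1 p. 241 ll. 1–8; §14.6 p. 242; Thm. 13.3.7, (14.6.2); Thm. 13.3.8] as ONE
`Prop`-structure (the fields are the ★ T1 law NAMES — no re-spelling); asserted in `Q_K9` for the OVERRIDDEN kit on T1's own witness (RULING (V42)). -/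
structure SpecPkgT1 : Prop where
  /-- T1c -/
  t1c : 𝔨.QuasiSplitStableTraceFormulas
  /-- T1d -/
  t1d : 𝔨.MTermCancellation
  /-- T1e -/
  t1e : 𝔨.StableSpectralExpansionG
  /-- T1f -/
  t1f : 𝔨.StableSpectralExpansionH

@[simp] theorem override_Δ : (𝔨.override ov).Δ = 𝔨.Δ := rfl
@[simp] theorem override_mH : (𝔨.override ov).mH = 𝔨.mH := rfl
@[simp] theorem override_mG : (𝔨.override ov).mG = 𝔨.mG := rfl
@[simp] theorem override_traceGp : (𝔨.override ov).traceGp = 𝔨.traceGp := rfl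
@[simp] theorem override_Smooth : (𝔨.override ov).Smooth = 𝔨.Smooth := rfl
@[simp] theorem override_Transfer : (𝔨.override ov).Transfer = 𝔨.Transfer := rfl
@[simp] theorem override_TransferH : (𝔨.override ov).TransferH = 𝔨.TransferH := rfl
@[simp] theorem override_PacketG : (𝔨.override ov).PacketG = ov.PacketG := rfl
@[simp] theorem override_PacketH : (𝔨.override ov).PacketH = ov.PacketH := rfl

/-- The override touches none of T1a's sockets. -/
theorem override_simpleTraceFormula_iff : (𝔨.override ov).SimpleTraceFormula ↔ 𝔨.SimpleTraceFormula := Iff.rfl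

/-- The override touches none of T1b's sockets. -/
theorem override_ellipticStabilisation_iff : (𝔨.override ov).EllipticStabilisation ↔ 𝔨.EllipticStabilisation := Iff.rfl

/-- The override touches none of T1g's sockets. -/
theorem override_transferExistence_iff : (𝔨.override ov).TransferExistence ↔ 𝔨.TransferExistence := Iff.rfl

/-- `LawsT1` for the overridden kit from T1a, T1b, T1g at `𝔨` and `SpecPkgT1` at the override. [Rogawski1990, §§14.2–14.6] -/
theorem lawsT1_override (ha : 𝔨.SimpleTraceFormula) (hb : 𝔨.EllipticStabilisation) (hg : 𝔨.TransferExistence)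
    (hs : (𝔨.override ov).SpecPkgT1) : (𝔨.override ov).LawsT1 :=
  ⟨(𝔨.override_simpleTraceFormula_iff ov).2 ha, (𝔨.override_ellipticStabilisation_iff ov).2 hb, hs.t1c, hs.t1d, hs.t1e, hs.t1f,
    (𝔨.override_transferExistence_iff ov).2 hg⟩

/-- **T1's head (14.6.1) for the overridden kit** from T1a, T1b, T1g at `𝔨` and T1c–T1f at the override (★ `innerFormStableTraceIdentity_of_laws`).
[Rogawski1990, Thm. 14.6.1 p. 241] -/
theorem innerFormStableTraceIdentity_override (ha : 𝔨.SimpleTraceFormula) (hb : 𝔨.EllipticStabilisation) (hg : 𝔨.TransferExistence)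
    (hs : (𝔨.override ov).SpecPkgT1) : (𝔨.override ov).InnerFormStableTraceIdentity :=
  (𝔨.override ov).innerFormStableTraceIdentity_of_laws (𝔨.lawsT1_override ov ha hb hg hs)

end ComparisonKit

end Summit.HodgeConjecture.HodgeConjecture.Cruxes.H413.F0T1InnerFormTraceIdentity

/-! ## §A.2 T1's sockets feed the kit of record; law #1 at 𝔠₀ -/

namespace Summit.HodgeConjecture.HodgeConjecture.Cruxes.H413.F0P3KitOfRecord

open Summit.HodgeConjecture.HodgeConjecture.Cruxes.H413.F0P3InnerFormClassificationV6
open Summit.HodgeConjecture.HodgeConjecture.Cruxes.H413.F0T1InnerFormTraceIdentity (ComparisonKit SpecOverride)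
open Literature.NumberTheory.Rogawski1990 Literature.NumberTheory.GaloisRepresentations
open Literature.NumberTheory.Automorphic Literature.NumberTheory.Automorphic.UnitaryGroup

/-- (instance plumbing) ★ V6-A's `Gp L H = adelicGroupData L⁺ L c̄ 3 H` IS T1's `cmDatum L 3 H` (★ `adelicGroupData_eq_cmDatum`, `rfl`), but instance
synthesis does not unfold `adelicGroupData`: hand the automorphic-measure instance across. -/
instance (priority := 100) isAutomorphicMeasure_cmDatum_of_gp {L : Type} [Field L] [NumberField L] [IsCMField L] {H : Matrix (Fin 3) (Fin 3) L}
    (μ : Measure (Gp L H).automorphicQuotient) [h : (Gp L H).IsAutomorphicMeasure μ] : (cmDatum L 3 H).IsAutomorphicMeasure μ := h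

variable (L : Type) [Field L] [NumberField L] [IsCMField L] (H : Matrix (Fin 3) (Fin 3) L) (ι : L →+* ℂ) (T : GL (Fin 3) ℂ)
  (hT : (T : Matrix (Fin 3) (Fin 3) ℂ)ᴴ * H.map ι * (T : Matrix (Fin 3) (Fin 3) ℂ) = Literature.Geometry.ComplexHyperbolic.BallModel.J)
  (μ : Measure (Gp L H).automorphicQuotient) [(Gp L H).IsAutomorphicMeasure μ]

/-- **`Sockets.ofT1 𝔨`** — T1's nine sockets of (14.6.1) read off a comparison kit: `traceGp Smooth PacketG PacketH nG nH trG trH` and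
`Matches f′ f f^H := 𝔨.Transfer f′ f ∧ 𝔨.TransferH f′ f^H` (= T1's `ComparisonKit.Matches`). [Rogawski1990, Thm. 14.6.1 p. 241] -/
def socketsOfT1 (𝔨 : ComparisonKit L H μ) : Sockets L H μ :=
  ⟨𝔨.traceGp, 𝔨.Smooth, 𝔨.PacketG, 𝔨.PacketH, 𝔨.nG, 𝔨.nH, 𝔨.trG, 𝔨.trH, 𝔨.Matches⟩

variable {L H μ} in
@[simp] theorem socketsOfT1_PacketG (𝔨 : ComparisonKit L H μ) : (socketsOfT1 L H μ 𝔨).PacketG = 𝔨.PacketG := rfl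
variable {L H μ} in
@[simp] theorem socketsOfT1_PacketH (𝔨 : ComparisonKit L H μ) : (socketsOfT1 L H μ 𝔨).PacketH = 𝔨.PacketH := rfl

variable [MeasurableSpace (Gp L H).Adelic] [BorelSpace (Gp L H).Adelic]

/-- **LAW #1 `TraceIdentity` AT THE KIT OF RECORD over T1's sockets** is T1's head `InnerFormStableTraceIdentity` of the kit, token for token
(`specG f = ∑' Q, nG Q * trG Q f`, `specH` likewise; `rfl`). [Rogawski1990, Thm. 14.6.1 p. 241, (14.6.1)] -/
theorem traceIdentity_kitOfRecord_ofT1 (𝔨 : ComparisonKit L H μ)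
    (gh : GHSide L H ι T hT 𝔨.PacketG 𝔨.PacketH) (ξd : XiSide L H 𝔨.PacketG 𝔨.PacketH) (μω : HeckeCharacter L) (c : ℚ)
    (jInf dsInf : ℤ → ℤ → ℤ → Cinf)
    (archTr : Cinf → (UnitaryGroup.arch (↥(maximalRealSubfield L)) L (IsCMField.complexConj L) 3 H → ℂ) → ℂ)
    (ν : Measure (Gp L H).Adelic) [IsFiniteMeasureOnCompacts ν]
    (μv : ∀ v : Places L, @Measure ((cmDatum L 3 H).Local v) (borel _))
    (ramCls₀ : DiscreteAutomorphicRep (Gp L H) μ → Set (Places L))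
    (h : 𝔨.InnerFormStableTraceIdentity) :
    (kitOfRecord L H ι T hT μ (socketsOfT1 L H μ 𝔨) gh ξd μω c jInf dsInf archTr ν μv ramCls₀).TraceIdentity :=
  fun f' f fH hs hm => h f' f fH hs hm

/-- The same for an OVERRIDDEN kit, from T1a, T1b, T1g at `𝔨` and `SpecPkgT1` at the override. [Rogawski1990, Thm. 14.6.1 p. 241] -/
theorem traceIdentity_kitOfRecord_override (𝔨 : ComparisonKit L H μ) (ov : SpecOverride L)
    (gh : GHSide L H ι T hT ov.PacketG ov.PacketH) (ξd : XiSide L H ov.PacketG ov.PacketH) (μω : HeckeCharacter L) (c : ℚ)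
    (jInf dsInf : ℤ → ℤ → ℤ → Cinf)
    (archTr : Cinf → (UnitaryGroup.arch (↥(maximalRealSubfield L)) L (IsCMField.complexConj L) 3 H → ℂ) → ℂ)
    (ν : Measure (Gp L H).Adelic) [IsFiniteMeasureOnCompacts ν]
    (μv : ∀ v : Places L, @Measure ((cmDatum L 3 H).Local v) (borel _))
    (ramCls₀ : DiscreteAutomorphicRep (Gp L H) μ → Set (Places L))
    (ha : 𝔨.SimpleTraceFormula) (hb : 𝔨.EllipticStabilisation) (hg : 𝔨.TransferExistence) (hs : (𝔨.override ov).SpecPkgT1) :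
    (kitOfRecord L H ι T hT μ (socketsOfT1 L H μ (𝔨.override ov)) gh ξd μω c jInf dsInf archTr ν μv ramCls₀).TraceIdentity :=
  traceIdentity_kitOfRecord_ofT1 L H ι T hT μ (𝔨.override ov) gh ξd μω c jInf dsInf archTr ν μv ramCls₀
    (𝔨.innerFormStableTraceIdentity_override ov ha hb hg hs)

end Summit.HodgeConjecture.HodgeConjecture.Cruxes.H413.F0P3KitOfRecord

end

/-! ## §K9 ∕ §Rung0 DEFINITIONS (moved verbatim from the closer՚s §B part) + `k9_of_stf` -/

noncomputable section

namespace Summit.HodgeConjecture.HodgeConjecture.Cruxes.H413.F0U3LettersRung1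

open MeasureTheory NumberField IsDedekindDomain
open Literature.NumberTheory.Automorphic Literature.NumberTheory.Automorphic.UnitaryGroup
open Literature.NumberTheory.Rogawski1990 Literature.NumberTheory.GaloisRepresentations
open Summit.HodgeConjecture.HodgeConjecture.Cruxes.H413
open Summit.HodgeConjecture.HodgeConjecture.Cruxes.H413.F0T1InnerFormTraceIdentity (ComparisonKit SpecOverride GpAdelic GpLocal HLocal GpInf GInf HInf IsAnisotropic)
open Summit.HodgeConjecture.HodgeConjecture.Cruxes.H413.F0P3InnerFormClassificationV6 (Gp Places Cinf EvpData)
open Summit.HodgeConjecture.HodgeConjecture.Cruxes.H413.F0P3KitOfRecord (kitOfRecord GHSide socketsOfT1)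
open Summit.HodgeConjecture.HodgeConjecture.Cruxes.H413.F0P3XiSideOfRecord (xiSideOfRecord)
open Summit.HodgeConjecture.HodgeConjecture.Cruxes.H413.F0P3XiPacketFamilyOfRecord (keysOfKeysCaseTwo hCM_of_cmCharIdentityPackage hexc_of_xiPinSphericalCofinite)
open Summit.HodgeConjecture.HodgeConjecture.Cruxes.H413.F0P3XiArchPacketOfRecord (JInfNoDegOne DsInfNoDegOne)
open Summit.HodgeConjecture.HodgeConjecture.Cruxes.H413.F0P3UnitaryLocOfRecord (IsCohUnitaryClass)
open Summit.HodgeConjecture.HodgeConjecture.Cruxes.H413.F0P3LettersTraceFactorisation (IsProductHaar)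
open scoped Matrix ComplexOrder

section K9

variable (L : Type) [Field L] [NumberField L] [IsCMField L] (ι : L →+* ℂ) (H : Matrix (Fin 3) (Fin 3) L) (T : GL (Fin 3) ℂ)
  (hT : (T : Matrix (Fin 3) (Fin 3) ℂ)ᴴ * H.map ι * (T : Matrix (Fin 3) (Fin 3) ℂ) = Literature.Geometry.ComplexHyperbolic.BallModel.J)
  (μ : Measure (Gp L H).automorphicQuotient) [(Gp L H).IsAutomorphicMeasure μ] (μω : HeckeCharacter L) (hμu : μω.IsUnitary)
  -- the ∃-bound rung-0 data read by `Q_K9` (fields of `Rung0Witness` below; Borel σ-algebras throughout)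
  (ν : @Measure (GpAdelic L H) (borel _))
  (νH : ∀ v : Places L, @Measure (HLocal L v) (borel _)) (νG : ∀ v : Places L, @Measure (GpLocal L H v) (borel _))
  (νGi : @Measure (GpInf L H) (borel _)) (νqi : @Measure (GInf L) (borel _)) (νHi : @Measure (HInf L) (borel _))
  (μZ : ∀ v : Places L, @Measure (Gqs L v ⧸ Subgroup.center (Gqs L v)) (borel _))
  (Tinf : Literature.NumberTheory.Rogawski1990.ArchTransferFactor L H) (c : ℚ) (jInf dsInf : ℤ → ℤ → ℤ → Cinf)
  (isHaar_ν : letI : MeasurableSpace (GpAdelic L H) := borel _; ν.IsHaarMeasure)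
  (isInvInv_ν : letI : MeasurableSpace (GpAdelic L H) := borel _; ν.IsInvInvariant)
  (isHaar_νH : ∀ v : Places L, letI : MeasurableSpace (HLocal L v) := borel _; (νH v).IsHaarMeasure)
  (isRightInv_νH : ∀ v : Places L, letI : MeasurableSpace (HLocal L v) := borel _; (νH v).IsMulRightInvariant)
  (isHaar_νG : ∀ v : Places L, letI : MeasurableSpace (GpLocal L H v) := borel _; (νG v).IsHaarMeasure)
  (isRightInv_νG : ∀ v : Places L, letI : MeasurableSpace (GpLocal L H v) := borel _; (νG v).IsMulRightInvariant)
  (finCpt_νGi : letI : MeasurableSpace (GpInf L H) := borel _; IsFiniteMeasureOnCompacts νGi)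
  (rightInv_νGi : letI : MeasurableSpace (GpInf L H) := borel _; νGi.IsMulRightInvariant)
  (finCpt_νqi : letI : MeasurableSpace (GInf L) := borel _; IsFiniteMeasureOnCompacts νqi)
  (rightInv_νqi : letI : MeasurableSpace (GInf L) := borel _; νqi.IsMulRightInvariant)
  (finCpt_νHi : letI : MeasurableSpace (HInf L) := borel _; IsFiniteMeasureOnCompacts νHi)
  (rightInv_νHi : letI : MeasurableSpace (HInf L) := borel _; νHi.IsMulRightInvariant)
  (isHaar_μZ : ∀ v : Places L, letI : MeasurableSpace (Gqs L v ⧸ Subgroup.center (Gqs L v)) := borel _; (μZ v).IsHaarMeasure)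
  (hquad : ∀ v : Places L, (∀ w : PlacesOver L v, IsCMField.complexConj L • w.1 = w.1) →
    IsQuadraticCharExtension (conjLocal L (IsCMField.complexConj L) v) (μω.semilocalComponent L v))

/-- **`kitK9 … Δ mH mG hQ hK hLi 𝔨 ov gh evpG evpH ramG ramH PiXi ρXi`** — THE KIT OF RECORD AT RUNG 0 (a reducible abbreviation of ★ K0 `kitOfRecord`, no new data): sockets :=
`socketsOfT1 (𝔨.override ov)` (T1's pinned kit `𝔨` with its twelve spectral placeholders overridden by `ov`, §A — law #1 `TraceIdentity` is about `𝔨` ALONE), `gh` the G∕H-side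
`S`-carriers, ξ-side := ★ `xiSideOfRecord` AT THE Q-ARGUMENTS `(Δ, mH, mG)` of the rider (RULING (V48) R2: the T1 export hands `Q` at `(𝔨.Δ, 𝔨.mH, mG₀)` where `mG₀` agrees with
`𝔨.mG` on the REGULAR classes only, so the ξ-side and `hQ` are typed at the package's own `(Δ, mH, mG)`, not at the kit's), with `hCM := hCM_of_cmCharIdentityPackage … hQ`,
`keys := keysOfKeysCaseTwo … hK …`, `hexc := hexc_of_xiPinSphericalCofinite … hLi` (★ (J2)∕(J3) glue), `μv := νG`, `archTr := archTr₀ … νGi`, the sign `c`, the arch classes `jInf dsInf`,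
`ramCls := ★ ramCls₀`. [cite: Rogawski1990, §14.6 Thm. 14.6.1 p. 241; §13.1 p. 199] -/
abbrev kitK9
    (Δ : ∀ v : Places L, Literature.NumberTheory.Rogawski1990.LocalTransferFactor L H v)
    (mH : letI : ∀ (v : Places L) (a : HLocal L v), MeasurableSpace (HLocal L v ⧸ Subgroup.centralizer ({a} : Set (HLocal L v))) := fun _ _ => borel _
      ∀ v : Places L, OrbitalMeasureFamily (HLocal L v))
    (mG : letI : ∀ (v : Places L) (γ : (cmDatum L 3 H).Local v),
        MeasurableSpace ((cmDatum L 3 H).Local v ⧸ Subgroup.centralizer ({γ} : Set ((cmDatum L 3 H).Local v))) := fun _ _ => borel _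
      ∀ v : Places L, OrbitalMeasureFamily ((cmDatum L 3 H).Local v))
    (hQ : letI : ∀ v : Places L, MeasurableSpace (GpLocal L H v) := fun _ => borel _
      letI : ∀ v : Places L, MeasurableSpace (HLocal L v) := fun _ => borel _
      letI : ∀ (v : Places L) (a : HLocal L v), MeasurableSpace (HLocal L v ⧸ Subgroup.centralizer ({a} : Set (HLocal L v))) := fun _ _ => borel _
      letI : ∀ (v : Places L) (γ : GpLocal L H v), MeasurableSpace (GpLocal L H v ⧸ Subgroup.centralizer ({γ} : Set (GpLocal L H v))) := fun _ _ => borel _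
      CMCharIdentityPackageTest L H (transpose_map_cmConjRingHom_eq_of_frame L ι H T hT) (isUnit_det_of_frame L ι H T hT) νH νG μω hμu Δ mH mG)
    (hK : KeysCaseTwo L) (hLi : XiPinSphericalCofinite L) (𝔨 : ComparisonKit L H μ)
    (ov : SpecOverride L) (gh : GHSide L H ι T hT ov.PacketG ov.PacketH) (evpG : ov.PacketG → EvpData L H) (evpH : ov.PacketH → EvpData L H)
    (ramG : ov.PacketG → Finset (Places L)) (ramH : ov.PacketH → Finset (Places L)) (PiXi : OneDimAutRepH L → ov.PacketG) (ρXi : OneDimAutRepH L → ov.PacketH) :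
    F0P3InnerFormClassificationV8.ClassificationKit L H ι T hT μ :=
  letI : MeasurableSpace (Gp L H).Adelic := borel _
  haveI : BorelSpace (Gp L H).Adelic := ⟨rfl⟩
  haveI : IsFiniteMeasureOnCompacts (show Measure (Gp L H).Adelic from ν) :=
    (show @Measure.IsHaarMeasure (Gp L H).Adelic _ _ (borel _) ν from isHaar_ν).toIsFiniteMeasureOnCompacts
  letI : ∀ v : Places L, MeasurableSpace (GpLocal L H v) := fun _ => borel _
  letI : ∀ v : Places L, MeasurableSpace (HLocal L v) := fun _ => borel _
  letI : ∀ (v : Places L) (a : HLocal L v), MeasurableSpace (HLocal L v ⧸ Subgroup.centralizer ({a} : Set (HLocal L v))) := fun _ _ => borel _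
  letI : ∀ (v : Places L) (γ : GpLocal L H v), MeasurableSpace (GpLocal L H v ⧸ Subgroup.centralizer ({γ} : Set (GpLocal L H v))) := fun _ _ => borel _
  letI : ∀ v : Places L, MeasurableSpace (Gqs L v ⧸ Subgroup.center (Gqs L v)) := fun _ => borel _
  haveI : ∀ v : Places L, BorelSpace (Gqs L v ⧸ Subgroup.center (Gqs L v)) := fun _ => ⟨rfl⟩
  haveI : ∀ v : Places L, (μZ v).IsHaarMeasure := isHaar_μZ
  kitOfRecord L H ι T hT μ (socketsOfT1 L H μ (𝔨.override ov)) gh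
    (F0P3XiSideOfRecordSCD.xiSideOfRecordSCD L H (transpose_map_cmConjRingHom_eq_of_frame L ι H T hT) (isUnit_det_of_frame L ι H T hT) μω hμu μZ (keysOfKeysCaseTwo L μω hK μZ hquad)
       (F0P3XiPacketFamilyOfRecordSCD.hSCD_of_cmCharIdentityPackageTest L H (transpose_map_cmConjRingHom_eq_of_frame L ι H T hT) (isUnit_det_of_frame L ι H T hT) μω hμu
        Δ mH mG νG νH μZ hQ)
       (fun ξ => hexc_of_xiPinSphericalCofinite L μω hμu μZ (keysOfKeysCaseTwo L μω hK μZ hquad) hquad hLi ξ)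
       νG evpG evpH ramG ramH PiXi ρXi)
    μω c jInf dsInf (archTr₀ L ι H T hT νGi) ν νG F0P3RamClsOfRecord.ramCls₀

/-- **`OverrideWitness … Δ mH mG hQ hK hLi 𝔨`** — the ∃-bound content of `Q_K9` AT A PINNED KIT `𝔨` WITH PARTNERS (RULINGS (V45)(d)(f), (V48) R2, (V50), (V51)(b); REF1 R-28 (i)(ii),
R-29, R-31): override values `ov` for T1's twelve spectral placeholders, the G∕H-side `S`-carriers `gh`, the (J2) packet-side data `evpG evpH ramG ramH PiXi ρXi`, ONE level `S₀`,
and the facts: T1c–T1f for the overridden kit (`SpecPkgT1`), the witnessed package `SpecPkg S₀` of the kit of record `kitK9 …` [Rogawski1990 Thm. 14.6.1 p. 241 ll. 1–8; §14.6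
p. 242; Thm. 13.3.7, (14.6.2), (14.6.3); Flath1979 Thm. 3], the PACKET ANCHORS `anchorG`∕`anchorH` (ED. 6, replacing ED. 4–5's row fields `hatBounded`∕`unrStarAlgebra`, RULING (V51)(b) ∕ R-31 PAID DOWN: at the genuine witness the packet
e.v.p.s `evpG Q`∕`evpH ρ` off `S₀ ∪ ram` are eigencharacters of UNITARY SPHERICAL members of the global A-packets [Rogawski1990 §13.7 p. 206; §13.1 p. 199] — stated in the pin
currency `∃ π, IsAdmissible ∧ IsUnitarizable ∧ IsSphericalWith K_v (νG v) (evpG Q v)`; rows #6∕#7 at BOTH summands then follow IN-HOUSE by ★ `F0P3HatLawsKitK9` ∕ ★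
`F0P3HatLawsOfAnchoredPackets` — Langlands' bound [Langlands1980 p. 209] and the `*`-character property [CartierCorvallis1979 §IV.1 Cor. 4.1–4.2]), and the two e.v.p. conventions `hG hH′` (junk values off
`C_c(K_v\G′_v/K_v)`, ★ `evpConvention_kitOfRecord`).  THE OVERRIDE `ov`, THE PACKET-SIDE DATA `gh` AND THE LEVEL `S₀` MAY DEPEND ON THE KIT `𝔨` (R-29, RULING (V50)): `gh` is built
from `𝔨`'s own fibres (`TestSG S = TestSH S := TestS₀ S`, `tensG ∕ tensH` := the partners law T1g `TransferExistence` chooses, `MatchesS S fS fSG fSH := fSG = fS ∧ fSH = fS`), so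
`matchingS` ∕ `transferS` hold by construction and `factorisationPk` ∕ `aPacketSpectral` ∕ `localExpansion` at those partners are the printed statements [Rogawski1990 Prop. 13.2.2,
Props. 14.4.1–14.4.2, §12.7, Thm. 14.6.1] because the packet distributions are stable, hence independent of which transfer T1g picked.
[cite: Rogawski1990, §14.6 Thm. 14.6.1 p. 241; Thm. 14.6.4 p. 244; §13.7 p. 206] [cite: CartierCorvallis1979, §IV.1 Cor. 4.1–4.2] -/
structure OverrideWitness
    (Δ : ∀ v : Places L, Literature.NumberTheory.Rogawski1990.LocalTransferFactor L H v)
    (mH : letI : ∀ (v : Places L) (a : HLocal L v), MeasurableSpace (HLocal L v ⧸ Subgroup.centralizer ({a} : Set (HLocal L v))) := fun _ _ => borel _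
      ∀ v : Places L, OrbitalMeasureFamily (HLocal L v))
    (mG : letI : ∀ (v : Places L) (γ : (cmDatum L 3 H).Local v),
        MeasurableSpace ((cmDatum L 3 H).Local v ⧸ Subgroup.centralizer ({γ} : Set ((cmDatum L 3 H).Local v))) := fun _ _ => borel _
      ∀ v : Places L, OrbitalMeasureFamily ((cmDatum L 3 H).Local v))
    (hQ : letI : ∀ v : Places L, MeasurableSpace (GpLocal L H v) := fun _ => borel _
      letI : ∀ v : Places L, MeasurableSpace (HLocal L v) := fun _ => borel _
      letI : ∀ (v : Places L) (a : HLocal L v), MeasurableSpace (HLocal L v ⧸ Subgroup.centralizer ({a} : Set (HLocal L v))) := fun _ _ => borel _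
      letI : ∀ (v : Places L) (γ : GpLocal L H v), MeasurableSpace (GpLocal L H v ⧸ Subgroup.centralizer ({γ} : Set (GpLocal L H v))) := fun _ _ => borel _
      CMCharIdentityPackageTest L H (transpose_map_cmConjRingHom_eq_of_frame L ι H T hT) (isUnit_det_of_frame L ι H T hT) νH νG μω hμu Δ mH mG)
    (hK : KeysCaseTwo L) (hLi : XiPinSphericalCofinite L) (𝔨 : ComparisonKit L H μ) : Type 2 where
  /-- values for T1's twelve spectral placeholder sockets (§A); may depend on `𝔨` -/
  ov : SpecOverride L
  /-- the G∕H-side `S`-carriers; built from `𝔨`'s own fibres and T1g's partners -/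
  gh : GHSide L H ι T hT ov.PacketG ov.PacketH
  /-- e.v.p. of the global packets of `G` -/
  evpG : ov.PacketG → EvpData L H
  /-- e.v.p. of the global packets of `H` -/
  evpH : ov.PacketH → EvpData L H
  /-- ramification of the global packets of `G` -/
  ramG : ov.PacketG → Finset (Places L)
  /-- ramification of the global packets of `H` -/
  ramH : ov.PacketH → Finset (Places L)
  /-- `ξ ↦ Π(ξ)` -/
  PiXi : OneDimAutRepH L → ov.PacketG
  /-- `ξ ↦ ρ(ξ)` -/
  ρXi : OneDimAutRepH L → ov.PacketH
  /-- the ONE finite level `S₀` of the frame (RULING (V44), R-28) -/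
  S₀ : Finset (Places L)
  /-- T1c–T1f for the overridden kit [Rogawski1990, Thm. 14.6.1 p. 241; §14.6 p. 242] -/
  specPkgT1 : (𝔨.override ov).SpecPkgT1
  /-- the witnessed package at level `S₀` for the kit of record [Rogawski1990, Thm. 14.6.1, Thm. 14.6.4, (14.6.2)–(14.6.3); Flath1979 Thm. 3] -/
  specPkg : F0P3InnerFormClassificationV8.ClassificationKit.SpecPkg
    (kitK9 L ι H T hT μ μω hμu ν νH νG νGi μZ c jInf dsInf isHaar_ν isHaar_μZ hquad Δ mH mG hQ hK hLi 𝔨 ov gh evpG evpH ramG ramH PiXi ρXi) S₀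
  /-- PACKET ANCHORS, `G`-side (ED. 6, T1-RES ∕ R-31 pay-down, pin currency of ★ `F0P3HatLawsOfAnchoredPackets`): off `S₀ ∪ ram Π`, the packet e.v.p. `t(Π)_v` IS the eigencharacter of
  an admissible UNITARIZABLE `K_v`-SPHERICAL class of `G′_v` — print: the members of a global A-packet are unitary and unramified almost everywhere, with Satake parameter
  `t(Π)_v` [Rogawski1990, §13.7 p. 206; §12.2 (1)(2) pp. 173–174; §13.1 p. 199]; rows #6∕#7 (`HatBounded`∕`UnrStarAlgebra` at BOTH summands) FOLLOW in-house
  (★ `hatLaws_kitOfRecord_of_anchored`, B-p12 p829087∕p829345). -/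
  anchorG : ∀ (Q : ov.PacketG) (v : Places L), v ∉ S₀ → v ∉ ramG Q →
    letI : MeasurableSpace ((cmDatum L 3 H).Local v) := borel _
    ∃ π : IrrClass ((cmDatum L 3 H).Local v), π.IsAdmissible ∧ π.IsUnitarizable ∧
      π.IsSphericalWith (cmLocalIntegralLevel L 3 H v) (νG v) (evpG Q v)
  /-- PACKET ANCHORS, `H`-side (ED. 6): off `S₀ ∪ ram ρ`, the transported packet e.v.p. `t(ρ)_v` is the eigencharacter of an admissible unitarizable `K_v`-spherical class of
  `G′_v` [Rogawski1990, §13.7 p. 206; §13.1 Prop. 13.1.3 p. 199; §4.13 Lemma 4.13.1]. -/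
  anchorH : ∀ (ρ : ov.PacketH) (v : Places L), v ∉ S₀ → v ∉ ramH ρ →
    letI : MeasurableSpace ((cmDatum L 3 H).Local v) := borel _
    ∃ π : IrrClass ((cmDatum L 3 H).Local v), π.IsAdmissible ∧ π.IsUnitarizable ∧
      π.IsSphericalWith (cmLocalIntegralLevel L 3 H v) (νG v) (evpH ρ v)
  /-- e.v.p. convention on `Π(G)`: junk value `0` off `C_c(K_v\G′_v/K_v)` [Rogawski1990, §13.7 p. 206] -/
  hG : ∀ (Q : ov.PacketG) (v : Places L) (f : (cmDatum L 3 H).Local v → ℂ),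
    ¬ (HasCompactSupport f ∧ IsLevel (cmLocalIntegralLevel L 3 H v) f) → evpG Q v f = 0
  /-- e.v.p. convention on `Π(H)` [Rogawski1990, §13.7 p. 206] -/
  hH' : ∀ (ρ : ov.PacketH) (v : Places L) (f : (cmDatum L 3 H).Local v → ℂ),
    ¬ (HasCompactSupport f ∧ IsLevel (cmLocalIntegralLevel L 3 H v) f) → evpH ρ v f = 0

/-- **`Q_K9 … Δ mH mG` — THE RIDER of rung 0** (p04 (g7) plan §1; RULINGS (V29) `Q_CM`, (V42), (V45)(c)(d)(f), (V48) R2, (V50), (V51)(b); REF1 R-21 (iii), R-24, R-28, R-29, R-31):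
for the global transfer data `(Δ_v, m_{H,v}, m_{G,v})_v` of the SAME witness as ★ `GlobalTransferWithStabilisationPackage`, (1) the CM character-identity package ★ `CMCharIdentityPackage`
[§13.1 Prop. 13.1.4; Lemma 4.13.1 (b)], AND (2) for every PINNED comparison kit `𝔨` WITH PARTNERS AND THE SIMPLE TRACE FORMULA (laws T1g `TransferExistence`, T1a `SimpleTraceFormula`
— the antecedents the T1 export ★ `anchoredKit_nonempty_of_stubsQ` hands for its anchor; POLARITY (R-29): without T1g the kit `{𝔨₀ with Transfer := fun _ _ => False}` would be
pinned and empty `OverrideWitness` through `matchingS`∕`transferS` at the zero datum) carrying these transfer factors and `H`-side measures ON THE NOSE and `G`-side orbital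
measures agreeing with `mG` on the REGULAR classes ((V48) R2: the export's `mG₀`), every proof of (1) and every proof of the letters Keys ∕ #79 (proof-irrelevant parameters of the
ξ-side of record), an `OverrideWitness` exists.  THE OVERRIDE `ov`, THE PACKET-SIDE DATA `gh` AND THE LEVEL `S₀` MAY DEPEND ON THE KIT `𝔨`: `gh` is built from `𝔨`'s own fibres
(`TestSG S = TestSH S := TestS₀ S`, `tensG∕tensH` := the partners T1g chooses, `MatchesS S fS fSG fSH := fSG = fS ∧ fSH = fS`), so `matchingS`∕`transferS` hold by construction and
`factorisationPk`∕`aPacketSpectral`∕`localExpansion` at those partners are the printed statements [Rogawski1990 Prop. 13.2.2, Props. 14.4.1–14.4.2, §12.7, Thm. 14.6.1] because the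
packet distributions are stable, hence independent of which transfer T1g picked.  Typed exactly as the T1 API's `{Q : …}` binder (Borel orbit quotients by `letI`).
[cite: Rogawski1990, §14.6 Thm. 14.6.1 p. 241; §13.1 Prop. 13.1.4 p. 199; §4.9 Prop. 4.9.1 p. 55] -/
def Q_K9 :
    letI : ∀ (v : Places L) (a : HLocal L v), MeasurableSpace (HLocal L v ⧸ Subgroup.centralizer ({a} : Set (HLocal L v))) := fun _ _ => borel _
    letI : ∀ (v : Places L) (γ : (cmDatum L 3 H).Local v),
        MeasurableSpace ((cmDatum L 3 H).Local v ⧸ Subgroup.centralizer ({γ} : Set ((cmDatum L 3 H).Local v))) := fun _ _ => borel _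
    (∀ v : Places L, Literature.NumberTheory.Rogawski1990.LocalTransferFactor L H v) →
    (∀ v : Places L, OrbitalMeasureFamily (HLocal L v)) →
    (∀ v : Places L, OrbitalMeasureFamily ((cmDatum L 3 H).Local v)) → Prop :=
  fun Δ mH mG =>
    letI : MeasurableSpace (GpAdelic L H) := borel _
    haveI : BorelSpace (GpAdelic L H) := ⟨rfl⟩
    haveI : ν.IsHaarMeasure := isHaar_ν
    haveI : ν.IsInvInvariant := isInvInv_ν
    letI : ∀ v : Places L, MeasurableSpace (GpLocal L H v) := fun _ => borel _
    haveI : ∀ v : Places L, BorelSpace (GpLocal L H v) := fun _ => ⟨rfl⟩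
    letI : ∀ v : Places L, MeasurableSpace (HLocal L v) := fun _ => borel _
    haveI : ∀ v : Places L, BorelSpace (HLocal L v) := fun _ => ⟨rfl⟩
    letI : ∀ (v : Places L) (a : HLocal L v), MeasurableSpace (HLocal L v ⧸ Subgroup.centralizer ({a} : Set (HLocal L v))) := fun _ _ => borel _
    letI : ∀ (v : Places L) (γ : GpLocal L H v), MeasurableSpace (GpLocal L H v ⧸ Subgroup.centralizer ({γ} : Set (GpLocal L H v))) := fun _ _ => borel _
    letI : MeasurableSpace (GpInf L H) := borel _
    haveI : BorelSpace (GpInf L H) := ⟨rfl⟩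
    letI : MeasurableSpace (GInf L) := borel _
    haveI : BorelSpace (GInf L) := ⟨rfl⟩
    letI : MeasurableSpace (HInf L) := borel _
    haveI : BorelSpace (HInf L) := ⟨rfl⟩
    haveI : ∀ v : Places L, (νH v).IsHaarMeasure := isHaar_νH
    haveI : ∀ v : Places L, (νH v).IsMulRightInvariant := isRightInv_νH
    haveI : ∀ v : Places L, (νG v).IsHaarMeasure := isHaar_νG
    haveI : ∀ v : Places L, (νG v).IsMulRightInvariant := isRightInv_νG
    haveI : IsFiniteMeasureOnCompacts νGi := finCpt_νGi
    haveI : νGi.IsMulRightInvariant := rightInv_νGi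
    haveI : IsFiniteMeasureOnCompacts νqi := finCpt_νqi
    haveI : νqi.IsMulRightInvariant := rightInv_νqi
    haveI : IsFiniteMeasureOnCompacts νHi := finCpt_νHi
    haveI : νHi.IsMulRightInvariant := rightInv_νHi
    CMCharIdentityPackageTest L H (transpose_map_cmConjRingHom_eq_of_frame L ι H T hT) (isUnit_det_of_frame L ι H T hT) νH νG μω hμu Δ mH mG ∧
    ∀ (𝔨 : ComparisonKit L H μ), 𝔨.IsPinned ν Tinf νH νG νGi νqi νHi → 𝔨.TransferExistence → 𝔨.SimpleTraceFormula → 𝔨.Δ = Δ → 𝔨.mH = mH →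
      (∀ (v : Places L) (c' : ConjClasses ((cmDatum L 3 H).Local v)),
        Literature.NumberTheory.Rogawski1990.IsRegularElt ((Quotient.out c').val : GL (Fin 3) (UnitaryGroup.LocalRing L v)) → 𝔨.mG v c' = mG v c') →
      ∀ (hQ : CMCharIdentityPackageTest L H (transpose_map_cmConjRingHom_eq_of_frame L ι H T hT) (isUnit_det_of_frame L ι H T hT) νH νG μω hμu Δ mH mG)
        (hK : KeysCaseTwo L) (hLi : XiPinSphericalCofinite L),
        Nonempty (OverrideWitness L ι H T hT μ μω hμu ν νH νG νGi μZ c jInf dsInf isHaar_ν isHaar_μZ hquad Δ mH mG hQ hK hLi 𝔨)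

end K9

section Rung0

variable (L : Type) [Field L] [NumberField L] [IsCMField L] (ι : L →+* ℂ) (H : Matrix (Fin 3) (Fin 3) L) (T : GL (Fin 3) ℂ)
  (hT : (T : Matrix (Fin 3) (Fin 3) ℂ)ᴴ * H.map ι * (T : Matrix (Fin 3) (Fin 3) ℂ) = Literature.Geometry.ComplexHyperbolic.BallModel.J)
  (μ : Measure (Gp L H).automorphicQuotient) [(Gp L H).IsAutomorphicMeasure μ] (μω : HeckeCharacter L) (hμu : μω.IsUnitary)
  (hμω : ∀ x : Literature.NumberTheory.GaloisRepresentations.ideleGroup ↥(maximalRealSubfield L), μω (AdeleRing.ideleBaseChange (↥(maximalRealSubfield L)) L x) = quadraticHeckeCharCM L x)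

/-- **`Rung0Witness L ι H T hT μ μω hμu` — THE ∃-BOUND CONTENT OF `stub_rung0` AT ONE FRAME** (RULING (V45)(c)(g); REF1 R-21 (iii), riders (r1)–(r4) 14:15:30Z).
DATA (each print-inhabited): the Haar measures `ν` (on `G′(𝔸)`), `νH_v`, `νG_v` (level-normalised), `νGi = νinf`, `νqi`, `νHi` (archimedean), `μZ_v` (on `U(Φ₃)_v` mod centre), the
archimedean transfer factor `Tinf`, the ONE global sign `c` (R-21), the posited archimedean classes `jInf dsInf` (R-22′).  FACTS (the booked clauses of K8 §13 row `stub_rung0`, nothing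
else): the measure normalisations (Haar ∕ invariance ∕ finiteness ∕ `vol K_v = 1`) (ED. 6: the former field `hquad` — «`μω_v` extends `ω_{L_v/L⁺_v}`» [§12.2 p. 174] — is
now the ★ lemma `isQuadraticCharExtension_semilocalComponent_of_baseChange_eq μω hμω` of the frame's `hμω`, p826316, no longer posited), T1's two antecedents ★ `ArchTransfersExistCanonical` [§14.2–14.3; Shelstad] and ★ `GlobalTransferWithStabilisationPackageAnd … (Q_K9 …)` [Prop. 4.9.1;
(4.3.1)–(4.3.3); §13.1] with the rider `Q_K9`, the sign clause `c = 1 ∨ c = -1` [LanglandsShelstad1987 §1.3–1.4], the arch-packet clauses `JInfNoDegOne`∕`DsInfNoDegOne`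
[§12.3 pp. 178–179] and their coh-unitarity [BorelWallach2000 VI 4.11], and PH `IsProductHaar ν νGi νG` [§4.3 p. 44; Tate XV §3.3] (R-26, `νGi := νinf`).
NO kit law, NO `ClassificationKit` predicate, NO `SpecPkg`∕`SpecPkgT1` outside `Q_K9`, NO Theses decl (r1). [cite: Rogawski1990, §4.9 Prop. 4.9.1 p. 55; §14.2 (14.2.1) pp. 232–233;
§14.6 Thm. 14.6.1 p. 241; §12.3 pp. 178–179; §13.1 p. 199] [cite: LanglandsShelstad1987, §1.3–1.4] [cite: BorelWallach2000, VI Thm. 4.11] -/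
structure Rung0Witness : Type 2 where
  /-- Haar measure on `G′(𝔸_{L⁺})` (two-sided, inversion invariant) -/
  ν : @Measure (GpAdelic L H) (borel _)
  /-- Haar measures on `H(L⁺_v)`, `vol K_{H,v} = 1` -/
  νH : ∀ v : Places L, @Measure (HLocal L v) (borel _)
  /-- Haar measures on `G′(L⁺_v)`, `vol K_v = 1` (= the kit's `μv`) -/
  νG : ∀ v : Places L, @Measure (GpLocal L H v) (borel _)
  /-- Haar measure on `G′_∞` (= PH's `νinf`) -/
  νGi : @Measure (GpInf L H) (borel _)
  /-- Haar measure on `G_∞` -/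
  νqi : @Measure (GInf L) (borel _)
  /-- Haar measure on `H_∞` -/
  νHi : @Measure (HInf L) (borel _)
  /-- Haar measures on `U(Φ₃)(L⁺_v)` modulo the centre (square-integrability currency of the Keys labels) -/
  μZ : ∀ v : Places L, @Measure (Gqs L v ⧸ Subgroup.center (Gqs L v)) (borel _)
  /-- the archimedean transfer factor `Δ_∞` -/
  Tinf : Literature.NumberTheory.Rogawski1990.ArchTransferFactor L H
  /-- the ONE global transfer-factor sign (R-21) -/
  c : ℚ
  /-- the posited archimedean classes `J^±_φ` (R-22′) -/
  jInf : ℤ → ℤ → ℤ → Cinf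
  /-- the posited archimedean classes `D^∓_φ ∕ π²_φ` (R-22′) -/
  dsInf : ℤ → ℤ → ℤ → Cinf
  /-- `ν` is a Haar measure -/
  isHaar_ν : letI : MeasurableSpace (GpAdelic L H) := borel _; ν.IsHaarMeasure
  /-- `ν` is inversion invariant -/
  isInvInv_ν : letI : MeasurableSpace (GpAdelic L H) := borel _; ν.IsInvInvariant
  /-- `νH_v` Haar -/
  isHaar_νH : ∀ v : Places L, letI : MeasurableSpace (HLocal L v) := borel _; (νH v).IsHaarMeasure
  /-- `νH_v` right invariant -/
  isRightInv_νH : ∀ v : Places L, letI : MeasurableSpace (HLocal L v) := borel _; (νH v).IsMulRightInvariant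
  /-- `νG_v` Haar -/
  isHaar_νG : ∀ v : Places L, letI : MeasurableSpace (GpLocal L H v) := borel _; (νG v).IsHaarMeasure
  /-- `νG_v` right invariant -/
  isRightInv_νG : ∀ v : Places L, letI : MeasurableSpace (GpLocal L H v) := borel _; (νG v).IsMulRightInvariant
  /-- `vol_{νG_v} K_v = 1` [Rogawski1990, §4.3 p. 44] -/
  hK : ∀ v : Places L, νG v (cmLocalIntegralLevel L 3 H v : Set (GpLocal L H v)) = 1
  /-- `vol_{νH_v} K_{H,v} = 1` -/
  hKH : ∀ v : Places L,
    νH v (((cmLocalIntegralLevel L 2 (Matrix.of fun i j : Fin 2 => if i.val + j.val + 1 = 2 then (1 : L) else 0) v).prod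
        (cmLocalIntegralLevel L 1 (Matrix.of fun i j : Fin 1 => if i.val + j.val + 1 = 1 then (1 : L) else 0) v) :
          Subgroup (HLocal L v)) : Set (HLocal L v)) = 1
  /-- `νGi` finite on compacta -/
  finCpt_νGi : letI : MeasurableSpace (GpInf L H) := borel _; IsFiniteMeasureOnCompacts νGi
  /-- `νGi` right invariant -/
  rightInv_νGi : letI : MeasurableSpace (GpInf L H) := borel _; νGi.IsMulRightInvariant
  /-- `νqi` finite on compacta -/
  finCpt_νqi : letI : MeasurableSpace (GInf L) := borel _; IsFiniteMeasureOnCompacts νqi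
  /-- `νqi` right invariant -/
  rightInv_νqi : letI : MeasurableSpace (GInf L) := borel _; νqi.IsMulRightInvariant
  /-- `νHi` finite on compacta -/
  finCpt_νHi : letI : MeasurableSpace (HInf L) := borel _; IsFiniteMeasureOnCompacts νHi
  /-- `νHi` right invariant -/
  rightInv_νHi : letI : MeasurableSpace (HInf L) := borel _; νHi.IsMulRightInvariant
  /-- `μZ_v` Haar -/
  isHaar_μZ : ∀ v : Places L, letI : MeasurableSpace (Gqs L v ⧸ Subgroup.center (Gqs L v)) := borel _; (μZ v).IsHaarMeasure
  /-- T1 antecedent #77 (ED. 2 name, RULING (V48) R1): BOTH archimedean transfers exist for Weil-form, transport-compatible families, canonical measures, AND the singular-class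
  behaviour of §14.5 [Rogawski1990, §14.2–14.3 pp. 232–234; Lemma 14.5.2 (c) p. 238; §8.4] (★ `ArchTransfersExistCanonicalSingular`; `.canonical` projects to the ED. 3 fact) -/
  hAT₄ : letI : MeasurableSpace (GpInf L H) := borel _
    haveI : BorelSpace (GpInf L H) := ⟨rfl⟩
    letI : MeasurableSpace (GInf L) := borel _
    haveI : BorelSpace (GInf L) := ⟨rfl⟩
    letI : MeasurableSpace (HInf L) := borel _
    haveI : BorelSpace (HInf L) := ⟨rfl⟩
    haveI : IsFiniteMeasureOnCompacts νGi := finCpt_νGi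
    haveI : νGi.IsMulRightInvariant := rightInv_νGi
    haveI : IsFiniteMeasureOnCompacts νqi := finCpt_νqi
    haveI : νqi.IsMulRightInvariant := rightInv_νqi
    haveI : IsFiniteMeasureOnCompacts νHi := finCpt_νHi
    haveI : νHi.IsMulRightInvariant := rightInv_νHi
    ArchTransfersExistCanonicalSingular L H Tinf νGi νqi νHi
  /-- T1 antecedent K7-s (RULING (V48) R1): the SINGULAR ELLIPTIC TRANSFER PACKAGE of §14.5 for the frame's measures [Rogawski1990, §14.5 Lemma 14.5.2 (b) pp. 238–239; §8.2
  Prop. 8.2.1; §8.3 Prop. 8.3.1; Kottwitz1986 §9] (★ `SingularEllipticTransferCanonical`; typed under EXACTLY the instance preamble of the T1 API's `hSET` binder) -/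
  hSET : letI : MeasurableSpace (GpAdelic L H) := borel _
    haveI : BorelSpace (GpAdelic L H) := ⟨rfl⟩
    haveI : ν.IsHaarMeasure := isHaar_ν
    haveI : ν.IsInvInvariant := isInvInv_ν
    letI : ∀ v : Places L, MeasurableSpace (HLocal L v) := fun _ => borel _
    haveI : ∀ v : Places L, BorelSpace (HLocal L v) := fun _ => ⟨rfl⟩
    letI : ∀ v : Places L, MeasurableSpace (GpLocal L H v) := fun _ => borel _
    haveI : ∀ v : Places L, BorelSpace (GpLocal L H v) := fun _ => ⟨rfl⟩
    letI : MeasurableSpace (GpInf L H) := borel _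
    haveI : BorelSpace (GpInf L H) := ⟨rfl⟩
    letI : MeasurableSpace (GInf L) := borel _
    haveI : BorelSpace (GInf L) := ⟨rfl⟩
    letI : MeasurableSpace (HInf L) := borel _
    haveI : BorelSpace (HInf L) := ⟨rfl⟩
    haveI : ∀ v : Places L, IsFiniteMeasureOnCompacts (νH v) := fun v => (isHaar_νH v).toIsFiniteMeasureOnCompacts
    haveI : ∀ v : Places L, (νH v).IsMulRightInvariant := isRightInv_νH
    haveI : ∀ v : Places L, (νG v).IsHaarMeasure := isHaar_νG
    haveI : ∀ v : Places L, (νG v).IsMulRightInvariant := isRightInv_νG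
    haveI : IsFiniteMeasureOnCompacts νGi := finCpt_νGi
    haveI : νGi.IsMulRightInvariant := rightInv_νGi
    haveI : IsFiniteMeasureOnCompacts νqi := finCpt_νqi
    haveI : νqi.IsMulRightInvariant := rightInv_νqi
    haveI : IsFiniteMeasureOnCompacts νHi := finCpt_νHi
    haveI : νHi.IsMulRightInvariant := rightInv_νHi
    letI : ∀ (v : Places L) (γ : (UnitaryGroup.cmDatum L 3 H).Local v),
      MeasurableSpace ((UnitaryGroup.cmDatum L 3 H).Local v ⧸
        Subgroup.centralizer ({γ} : Set ((UnitaryGroup.cmDatum L 3 H).Local v))) := fun _ _ => borel _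
    haveI : ∀ (v : Places L) (γ : (UnitaryGroup.cmDatum L 3 H).Local v),
      BorelSpace ((UnitaryGroup.cmDatum L 3 H).Local v ⧸
        Subgroup.centralizer ({γ} : Set ((UnitaryGroup.cmDatum L 3 H).Local v))) := fun _ _ => ⟨rfl⟩
    letI : ∀ g : GpAdelic L H, MeasurableSpace (GpAdelic L H ⧸ Subgroup.centralizer ({g} : Set (GpAdelic L H))) := fun _ => borel _
    haveI : ∀ g : GpAdelic L H, BorelSpace (GpAdelic L H ⧸ Subgroup.centralizer ({g} : Set (GpAdelic L H))) := fun _ => ⟨rfl⟩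
    letI : ∀ γ : GpInf L H, MeasurableSpace (GpInf L H ⧸ Subgroup.centralizer ({γ} : Set (GpInf L H))) := fun _ => borel _
    haveI : ∀ γ : GpInf L H, BorelSpace (GpInf L H ⧸ Subgroup.centralizer ({γ} : Set (GpInf L H))) := fun _ => ⟨rfl⟩
    letI : ∀ γ : GInf L, MeasurableSpace (GInf L ⧸ Subgroup.centralizer ({γ} : Set (GInf L))) := fun _ => borel _
    haveI : ∀ γ : GInf L, BorelSpace (GInf L ⧸ Subgroup.centralizer ({γ} : Set (GInf L))) := fun _ => ⟨rfl⟩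
    letI : ∀ (v : Places L) (a : HLocal L v),
      MeasurableSpace (HLocal L v ⧸ Subgroup.centralizer ({a} : Set (HLocal L v))) := fun _ _ => borel _
    haveI : ∀ (v : Places L) (a : HLocal L v),
      BorelSpace (HLocal L v ⧸ Subgroup.centralizer ({a} : Set (HLocal L v))) := fun _ _ => ⟨rfl⟩
    letI : ∀ a : HInf L, MeasurableSpace (HInf L ⧸ Subgroup.centralizer ({a} : Set (HInf L))) := fun _ => borel _
    haveI : ∀ a : HInf L, BorelSpace (HInf L ⧸ Subgroup.centralizer ({a} : Set (HInf L))) := fun _ => ⟨rfl⟩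
    letI : ∀ γ : GpAdelic L H, MeasurableSpace (↥(Subgroup.centralizer ({γ} : Set (GpAdelic L H))) ⧸
      ((UnitaryGroup.cmDatum L 3 H).quotientSubgroup ⊓ Subgroup.centralizer ({γ} : Set (GpAdelic L H))).subgroupOf
        (Subgroup.centralizer ({γ} : Set (GpAdelic L H)))) := fun _ => borel _
    haveI : ∀ γ : GpAdelic L H, BorelSpace (↥(Subgroup.centralizer ({γ} : Set (GpAdelic L H))) ⧸
      ((UnitaryGroup.cmDatum L 3 H).quotientSubgroup ⊓ Subgroup.centralizer ({γ} : Set (GpAdelic L H))).subgroupOf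
        (Subgroup.centralizer ({γ} : Set (GpAdelic L H)))) := fun _ => ⟨rfl⟩
    haveI hCcl : ∀ γ : GpAdelic L H, IsClosed ((Subgroup.centralizer ({γ} : Set (GpAdelic L H)) : Subgroup (GpAdelic L H)) : Set (GpAdelic L H)) :=
      fun γ => UnitaryGroup.isClosed_centralizer_cmDatum L 3 H γ
    haveI : ∀ γ : GpAdelic L H, (Measure.count : Measure ↥(((UnitaryGroup.cmDatum L 3 H).quotientSubgroup ⊓
      Subgroup.centralizer ({γ} : Set (GpAdelic L H))).subgroupOf (Subgroup.centralizer ({γ} : Set (GpAdelic L H))))).IsHaarMeasure :=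
      fun γ => UnitaryGroup.isHaarMeasure_count_quotientSubgroup_inf_centralizer_subgroupOf L 3 H γ
    haveI : ν.IsMulRightInvariant := by
      have h : ν.inv.IsMulRightInvariant := inferInstance
      rwa [Measure.inv_eq_self] at h
    Literature.NumberTheory.Rogawski1990.SingularEllipticTransferCanonical L H Tinf νH νG νGi νqi νHi ν
  /-- T1 antecedent with the rung-0 rider: the global transfer ∕ stabilisation package AND `Q_K9` on the same witness [Rogawski1990, Prop. 4.9.1 p. 55; §13.1 p. 199] -/
  hGTQ : letI : ∀ v : Places L, MeasurableSpace (GpLocal L H v) := fun _ => borel _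
    haveI : ∀ v : Places L, BorelSpace (GpLocal L H v) := fun _ => ⟨rfl⟩
    letI : ∀ v : Places L, MeasurableSpace (HLocal L v) := fun _ => borel _
    haveI : ∀ v : Places L, BorelSpace (HLocal L v) := fun _ => ⟨rfl⟩
    haveI : ∀ v : Places L, (νH v).IsHaarMeasure := isHaar_νH
    haveI : ∀ v : Places L, (νH v).IsMulRightInvariant := isRightInv_νH
    haveI : ∀ v : Places L, (νG v).IsHaarMeasure := isHaar_νG
    haveI : ∀ v : Places L, (νG v).IsMulRightInvariant := isRightInv_νG
    GlobalTransferWithStabilisationPackageAnd L H Tinf.Δ νH νG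
      (Q_K9 L ι H T hT μ μω hμu ν νH νG νGi νqi νHi μZ Tinf c jInf dsInf isHaar_ν isInvInv_ν isHaar_νH isRightInv_νH isHaar_νG isRightInv_νG
        finCpt_νGi rightInv_νGi finCpt_νqi rightInv_νqi finCpt_νHi rightInv_νHi isHaar_μZ
        (fun v _ => isQuadraticCharExtension_semilocalComponent_of_baseChange_eq μω hμω v))
  /-- the global transfer-factor sign is `±1` (R-21) [LanglandsShelstad1987, §1.3–1.4] -/
  hc : c = 1 ∨ c = -1
  /-- no degree-one class among the `J^±_φ` [Rogawski1990, §12.3 pp. 178–179] -/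
  hJ : JInfNoDegOne jInf
  /-- no degree-one class among the `D^∓_φ ∕ π²_φ` -/
  hD : DsInfNoDegOne dsInf
  /-- the `J^±_φ` are coh-unitary classes [BorelWallach2000, VI Thm. 4.11] -/
  hJU : ∀ p q t, IsCohUnitaryClass (jInf p q t)
  /-- the `D^∓_φ ∕ π²_φ` are coh-unitary classes -/
  hDU : ∀ p q t, IsCohUnitaryClass (dsInf p q t)
  /-- PH: `ν = νGi ⊗ ⊗′_v νG_v` [Rogawski1990, §4.3 p. 44; §5.4 p. 72] (R-26) -/
  hPH : letI : MeasurableSpace (Gp L H).Adelic := borel _; IsProductHaar L H ν νGi νG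

/-- **Stub statement `stub_rung0`**: at every letters' frame (`H` definite off `ι`, `[L⁺:ℚ] ≥ 2`, `μω` unitary extending `ω_{L/L⁺}`), a `Rung0Witness` exists. -/
def StubRung0 : Prop :=
  ∀ (L : Type) [Field L] [NumberField L] [IsCMField L] (ι : L →+* ℂ) (H : Matrix (Fin 3) (Fin 3) L) (T : GL (Fin 3) ℂ)
    (hT : (T : Matrix (Fin 3) (Fin 3) ℂ)ᴴ * H.map ι * (T : Matrix (Fin 3) (Fin 3) ℂ) = Literature.Geometry.ComplexHyperbolic.BallModel.J),
    (∀ τ' : L →+* ℂ, InfinitePlace.mk τ' ≠ InfinitePlace.mk ι → (H.map τ').PosDef) →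
    2 ≤ Module.finrank ℚ ↥(maximalRealSubfield L) →
    ∀ (μ : Measure (Gp L H).automorphicQuotient) [(Gp L H).IsAutomorphicMeasure μ] (μω : HeckeCharacter L) (hμu : μω.IsUnitary)
      (hμω : ∀ x : Literature.NumberTheory.GaloisRepresentations.ideleGroup ↥(maximalRealSubfield L),
        μω (AdeleRing.ideleBaseChange (↥(maximalRealSubfield L)) L x) = quadraticHeckeCharCM L x),
      Nonempty (Rung0Witness L ι H T hT μ μω hμu hμω)

/-- **`K9SpectralLetter` — THE BODY OF LETTER K9-STF AS A NAMED `Prop`** (char-cap packaging, LEAD F0P3a-plan (g9) T8-19 (B): the registered one-line signature of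
`stub_K9STF` must stay under the 12 000-char statement cap; `stub_K9STF` δ-unfolds to ED. 17՚s letter ∘ the ED. 19b (w-b) token map (`hQ : CMCharIdentityPackageTest`; ξ-side of record `xiSideOfRecordSCD … (hSCD_of_cmCharIdentityPackageTest … hQ) …`, whose supercuspidal member IS the package՚s `πs` — ★ `hSCD_of_cmCharIdentityPackageTest_fst`)): for the frame, the pinned measures and
the ∃-delivered `(c, jInf, dsInf)`, the text «∀ canonical `(mH, mG)`, ∀ pinned kit `𝔨` with transfer + STF at print՚s `Δ‴`, ∀ `(hQ, hK, hLi)`, ∀ proof-irrelevant `(hg, hsm)`,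
∃ Rogawski spectral tuple `(PG, PH, nG, nH, trG, trH, evpG, evpH, ramG, ramH, PiXi, ρXi, trGS, trHS, S₀)` with (T) (P1) (P2) (P3′) (P4) (P5)» — clauses and citations as in
the docstring of `stub_K9STF` below. -/
def K9SpectralLetter
  (L : Type) [Field L] [NumberField L] [IsCMField L] (ι : L →+* ℂ) (H : Matrix (Fin 3) (Fin 3) L) (T : GL (Fin 3) ℂ)
  (hT : (T : Matrix (Fin 3) (Fin 3) ℂ)ᴴ * H.map ι * (T : Matrix (Fin 3) (Fin 3) ℂ) = Literature.Geometry.ComplexHyperbolic.BallModel.J)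
  (μ : Measure (Gp L H).automorphicQuotient) [(Gp L H).IsAutomorphicMeasure μ] (μω : HeckeCharacter L) (hμu : μω.IsUnitary)
  (ν : @Measure (GpAdelic L H) (borel _))
  (νH : ∀ v : Places L, @Measure (HLocal L v) (borel _)) (νG : ∀ v : Places L, @Measure (GpLocal L H v) (borel _))
  (νGi : @Measure (GpInf L H) (borel _)) (νqi : @Measure (GInf L) (borel _)) (νHi : @Measure (HInf L) (borel _))
  (μZ : ∀ v : Places L, @Measure (Gqs L v ⧸ Subgroup.center (Gqs L v)) (borel _))
  (isHaar_ν : letI : MeasurableSpace (GpAdelic L H) := borel _; ν.IsHaarMeasure)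
  (isInvInv_ν : letI : MeasurableSpace (GpAdelic L H) := borel _; ν.IsInvInvariant)
  (isHaar_νH : ∀ v : Places L, letI : MeasurableSpace (HLocal L v) := borel _; (νH v).IsHaarMeasure)
  (isRightInv_νH : ∀ v : Places L, letI : MeasurableSpace (HLocal L v) := borel _; (νH v).IsMulRightInvariant)
  (isHaar_νG : ∀ v : Places L, letI : MeasurableSpace (GpLocal L H v) := borel _; (νG v).IsHaarMeasure)
  (isRightInv_νG : ∀ v : Places L, letI : MeasurableSpace (GpLocal L H v) := borel _; (νG v).IsMulRightInvariant)
  (finCpt_νGi : letI : MeasurableSpace (GpInf L H) := borel _; IsFiniteMeasureOnCompacts νGi)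
  (rightInv_νGi : letI : MeasurableSpace (GpInf L H) := borel _; νGi.IsMulRightInvariant)
  (finCpt_νqi : letI : MeasurableSpace (GInf L) := borel _; IsFiniteMeasureOnCompacts νqi)
  (rightInv_νqi : letI : MeasurableSpace (GInf L) := borel _; νqi.IsMulRightInvariant)
  (finCpt_νHi : letI : MeasurableSpace (HInf L) := borel _; IsFiniteMeasureOnCompacts νHi)
  (rightInv_νHi : letI : MeasurableSpace (HInf L) := borel _; νHi.IsMulRightInvariant)
  (isHaar_μZ : ∀ v : Places L, letI : MeasurableSpace (Gqs L v ⧸ Subgroup.center (Gqs L v)) := borel _; (μZ v).IsHaarMeasure)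
  (hquad : ∀ v : Places L, (∀ w : PlacesOver L v, IsCMField.complexConj L • w.1 = w.1) →
    IsQuadraticCharExtension (conjLocal L (IsCMField.complexConj L) v) (μω.semilocalComponent L v)) (c : ℚ) (jInf dsInf : ℤ → ℤ → ℤ → Cinf) : Prop :=
    letI : ∀ (v : Places L) (a : HLocal L v), MeasurableSpace (HLocal L v ⧸ Subgroup.centralizer ({a} : Set (HLocal L v))) := fun _ _ => borel _
    letI : ∀ (v : Places L) (γ : (cmDatum L 3 H).Local v),
        MeasurableSpace ((cmDatum L 3 H).Local v ⧸ Subgroup.centralizer ({γ} : Set ((cmDatum L 3 H).Local v))) := fun _ _ => borel _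
    haveI : ∀ (v : Places L) (a : HLocal L v), BorelSpace (HLocal L v ⧸ Subgroup.centralizer ({a} : Set (HLocal L v))) := fun _ _ => ⟨rfl⟩
    haveI : ∀ (v : Places L) (γ : (cmDatum L 3 H).Local v),
        BorelSpace ((cmDatum L 3 H).Local v ⧸ Subgroup.centralizer ({γ} : Set ((cmDatum L 3 H).Local v))) := fun _ _ => ⟨rfl⟩
    ∀ (mH : ∀ v : Places L, OrbitalMeasureFamily (HLocal L v)) (mG : ∀ v : Places L, OrbitalMeasureFamily ((cmDatum L 3 H).Local v)),
      letI : MeasurableSpace (GpAdelic L H) := borel _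
      haveI : BorelSpace (GpAdelic L H) := ⟨rfl⟩
      haveI : ν.IsHaarMeasure := isHaar_ν
      haveI : ν.IsInvInvariant := isInvInv_ν
      letI : ∀ v : Places L, MeasurableSpace (GpLocal L H v) := fun _ => borel _
      haveI : ∀ v : Places L, BorelSpace (GpLocal L H v) := fun _ => ⟨rfl⟩
      letI : ∀ v : Places L, MeasurableSpace (HLocal L v) := fun _ => borel _
      haveI : ∀ v : Places L, BorelSpace (HLocal L v) := fun _ => ⟨rfl⟩
      letI : ∀ (v : Places L) (a : HLocal L v), MeasurableSpace (HLocal L v ⧸ Subgroup.centralizer ({a} : Set (HLocal L v))) := fun _ _ => borel _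
      letI : ∀ (v : Places L) (γ : GpLocal L H v), MeasurableSpace (GpLocal L H v ⧸ Subgroup.centralizer ({γ} : Set (GpLocal L H v))) := fun _ _ => borel _
      letI : MeasurableSpace (GpInf L H) := borel _
      haveI : BorelSpace (GpInf L H) := ⟨rfl⟩
      letI : MeasurableSpace (GInf L) := borel _
      haveI : BorelSpace (GInf L) := ⟨rfl⟩
      letI : MeasurableSpace (HInf L) := borel _
      haveI : BorelSpace (HInf L) := ⟨rfl⟩
      haveI : ∀ v : Places L, (νH v).IsHaarMeasure := isHaar_νH
      haveI : ∀ v : Places L, (νH v).IsMulRightInvariant := isRightInv_νH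
      haveI : ∀ v : Places L, (νG v).IsHaarMeasure := isHaar_νG
      haveI : ∀ v : Places L, (νG v).IsMulRightInvariant := isRightInv_νG
      haveI : IsFiniteMeasureOnCompacts νGi := finCpt_νGi
      haveI : νGi.IsMulRightInvariant := rightInv_νGi
      haveI : IsFiniteMeasureOnCompacts νqi := finCpt_νqi
      haveI : νqi.IsMulRightInvariant := rightInv_νqi
      haveI : IsFiniteMeasureOnCompacts νHi := finCpt_νHi
      haveI : νHi.IsMulRightInvariant := rightInv_νHi
      (∀ v : Places L, (mH v).IsCanonical (IsLocalGRegular L v) (νH v) ∧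
          (mG v).IsCanonical (fun γ => IsRegularElt (γ.val : GL (Fin 3) (UnitaryGroup.LocalRing L v))) (νG v)) →
      ∀ (𝔨 : ComparisonKit L H μ), 𝔨.IsPinned ν (archCanonicalTransferFactor L H μω) νH νG νGi νqi νHi → 𝔨.TransferExistence → 𝔨.SimpleTraceFormula → 𝔨.Δ = (finExplicitCollection L H μω (finExplicitDelta_conj_left_all L H μω) (finExplicitDelta_conj_right_all L H μω)) → 𝔨.mH = mH →
        (∀ (v : Places L) (c' : ConjClasses ((cmDatum L 3 H).Local v)),
          Literature.NumberTheory.Rogawski1990.IsRegularElt ((Quotient.out c').val : GL (Fin 3) (UnitaryGroup.LocalRing L v)) → 𝔨.mG v c' = mG v c') →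
        ∀ (hQ : CMCharIdentityPackageTest L H (transpose_map_cmConjRingHom_eq_of_frame L ι H T hT) (isUnit_det_of_frame L ι H T hT) νH νG μω hμu (finExplicitCollection L H μω (finExplicitDelta_conj_left_all L H μω) (finExplicitDelta_conj_right_all L H μω)) mH mG)
          (hK : KeysCaseTwo L) (hLi : XiPinSphericalCofinite L),
          -- ===================== K9-STF BODY (replaces `Nonempty (OverrideWitness …)`) =====================
          -- n275-1: `hg`∕`hsm` are ∀ over PROOFS of facts the prefix already yields (`hg := htE`, `hsm :=` pin (iv) `smooth_iff` + ★ `tens₀_smooth`); proof-irrelevant — they neither weaken nor strengthen the letter; needed only as the arguments of ★ `ghOfFibres`.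
          ∀ (hg : ∀ f' : F0P3InnerFormClassificationV6.TestGp L H, 𝔨.Smooth f' → ∃ (f : F0P3InnerFormClassificationV6.TestG L) (fH : F0P3InnerFormClassificationV6.TestH L), 𝔨.Matches f' f fH)
            (hsm : ∀ (S : Finset (Places L)) (fS : F0P3SemilocalTestFunctionsOfRecord.TestS₀ L H ι T hT S) (fT : F0P3TestFunctionsOfRecord.Unr₀ L H S),
              𝔨.Smooth (F0P3SemilocalTestFunctionsOfRecord.tens₀ S fS fT)),
          letI : MeasurableSpace (Gp L H).Adelic := borel _
          haveI : BorelSpace (Gp L H).Adelic := ⟨rfl⟩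
          haveI : IsFiniteMeasureOnCompacts (show Measure (Gp L H).Adelic from ν) :=
            (show @Measure.IsHaarMeasure (Gp L H).Adelic _ _ (borel _) ν from isHaar_ν).toIsFiniteMeasureOnCompacts
          letI : ∀ v : Places L, MeasurableSpace (Gqs L v ⧸ Subgroup.center (Gqs L v)) := fun _ => borel _
          haveI : ∀ v : Places L, BorelSpace (Gqs L v ⧸ Subgroup.center (Gqs L v)) := fun _ => ⟨rfl⟩
          haveI : ∀ v : Places L, (μZ v).IsHaarMeasure := isHaar_μZ
          ∃ (PG PH : Type) (nG : PG → ℂ) (nH : PH → ℂ) (trG : PG → F0P3InnerFormClassificationV6.TestG L → ℂ) (trH : PH → F0P3InnerFormClassificationV6.TestH L → ℂ)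
            (evpG : PG → EvpData L H) (evpH : PH → EvpData L H) (ramG : PG → Finset (Places L)) (ramH : PH → Finset (Places L))
            (PiXi : OneDimAutRepH L → PG) (ρXi : OneDimAutRepH L → PH)
            (trGS : ∀ S : Finset (Places L), PG → F0P3SemilocalTestFunctionsOfRecord.TestS₀ L H ι T hT S → ℂ)
            (trHS : ∀ S : Finset (Places L), PH → F0P3SemilocalTestFunctionsOfRecord.TestS₀ L H ι T hT S → ℂ) (S₀ : Finset (Places L)),
            -- (T) the stable trace formula, T1d-shape, absolutely convergent
            (∀ (f' : F0P3InnerFormClassificationV6.TestGp L H) (f : F0P3InnerFormClassificationV6.TestG L) (fH : F0P3InnerFormClassificationV6.TestH L),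
                𝔨.Smooth f' → 𝔨.Matches f' f fH →
                Summable (fun Q : PG => nG Q * trG Q f) ∧ Summable (fun ρ : PH => nH ρ * trH ρ fH) ∧
                𝔨.SJGtot f + (1 / 2 : ℂ) * 𝔨.SJHtot fH = (∑' Q : PG, nG Q * trG Q f) + (1 / 2 : ℂ) * ∑' ρ : PH, nH ρ * trH ρ fH) ∧
            -- (P1) unramified factorisation of packet traces AT THE T1g-CHOSEN PARTNER (an arbitrary global transfer of the record tensor): print-true because the packet
            -- distributions are STABLE, hence constant on the transfer fibre and equal to their value at a pure-tensor transfer, where Flath applies (ref1 r276-1)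
            -- [FlathCorvallis1979 Thm. 3; CartierCorvallis1979 §IV; Rogawski1990 §13.2 (stability of packets), §13.1 13.1.3 (b), §12.3 12.3.3, §13.7; (14.2.1) p. 232]
            F0P3InnerFormClassificationV8.ClassificationKit.FactorisationPk
              (kitOfRecord L H ι T hT μ (⟨𝔨.traceGp, 𝔨.Smooth, PG, PH, nG, nH, trG, trH, 𝔨.Matches⟩ : F0P3InnerFormClassificationV6.Sockets L H μ)
              (F0P3GHSideOfFibres.ghOfFibres ι T hT (⟨𝔨.traceGp, 𝔨.Smooth, PG, PH, nG, nH, trG, trH, 𝔨.Matches⟩ : F0P3InnerFormClassificationV6.Sockets L H μ) hg hsm trGS trHS)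
              (F0P3XiSideOfRecordSCD.xiSideOfRecordSCD L H (transpose_map_cmConjRingHom_eq_of_frame L ι H T hT) (isUnit_det_of_frame L ι H T hT) μω hμu μZ (keysOfKeysCaseTwo L μω hK μZ hquad)
                 (F0P3XiPacketFamilyOfRecordSCD.hSCD_of_cmCharIdentityPackageTest L H (transpose_map_cmConjRingHom_eq_of_frame L ι H T hT) (isUnit_det_of_frame L ι H T hT) μω hμu (finExplicitCollection L H μω (finExplicitDelta_conj_left_all L H μω) (finExplicitDelta_conj_right_all L H μω)) mH mG νG νH μZ hQ)
                 (fun ξ => hexc_of_xiPinSphericalCofinite L μω hμu μZ (keysOfKeysCaseTwo L μω hK μZ hquad) hquad hLi ξ)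
                 νG evpG evpH ramG ramH PiXi ρXi)
              μω c jInf dsInf (archTr₀ L ι H T hT νGi) ν νG F0P3RamClsOfRecord.ramCls₀) S₀ ∧
            -- (P2) A-packet spectral data
            F0P3InnerFormClassificationV8.ClassificationKit.APacketSpectral
              (kitOfRecord L H ι T hT μ (⟨𝔨.traceGp, 𝔨.Smooth, PG, PH, nG, nH, trG, trH, 𝔨.Matches⟩ : F0P3InnerFormClassificationV6.Sockets L H μ)
              (F0P3GHSideOfFibres.ghOfFibres ι T hT (⟨𝔨.traceGp, 𝔨.Smooth, PG, PH, nG, nH, trG, trH, 𝔨.Matches⟩ : F0P3InnerFormClassificationV6.Sockets L H μ) hg hsm trGS trHS)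
              (F0P3XiSideOfRecordSCD.xiSideOfRecordSCD L H (transpose_map_cmConjRingHom_eq_of_frame L ι H T hT) (isUnit_det_of_frame L ι H T hT) μω hμu μZ (keysOfKeysCaseTwo L μω hK μZ hquad)
                 (F0P3XiPacketFamilyOfRecordSCD.hSCD_of_cmCharIdentityPackageTest L H (transpose_map_cmConjRingHom_eq_of_frame L ι H T hT) (isUnit_det_of_frame L ι H T hT) μω hμu (finExplicitCollection L H μω (finExplicitDelta_conj_left_all L H μω) (finExplicitDelta_conj_right_all L H μω)) mH mG νG νH μZ hQ)
                 (fun ξ => hexc_of_xiPinSphericalCofinite L μω hμu μZ (keysOfKeysCaseTwo L μω hK μZ hquad) hquad hLi ξ)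
                 νG evpG evpH ramG ramH PiXi ρXi)
              μω c jInf dsInf (archTr₀ L ι H T hT νGi) ν νG F0P3RamClsOfRecord.ramCls₀) S₀ ∧
            -- (P3′) THE TWO PRODUCT-TRACE CLAUSES, BY ★ NAME: the `S`-level traces of Π(ξ) and of ξ ARE the signed ∕ unsigned products of the local A-packet characters at f′_S
            -- [Rogawski1990 §13.1 13.1.3 (b), Prop. 13.1.4 p. 199; §12.3 12.3.3 p. 178; Props. 14.4.1 (a), 14.4.2 (c); p. 243 l. 9 – p. 244 l. 17]
            F0P3bLocalExpansionAtKitOfRecord.GTraceProductForm ι T hT (F0P3GHSideOfFibres.ghOfFibres ι T hT (⟨𝔨.traceGp, 𝔨.Smooth, PG, PH, nG, nH, trG, trH, 𝔨.Matches⟩ : F0P3InnerFormClassificationV6.Sockets L H μ) hg hsm trGS trHS)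
              (F0P3XiSideOfRecordSCD.xiSideOfRecordSCD L H (transpose_map_cmConjRingHom_eq_of_frame L ι H T hT) (isUnit_det_of_frame L ι H T hT) μω hμu μZ (keysOfKeysCaseTwo L μω hK μZ hquad)
                 (F0P3XiPacketFamilyOfRecordSCD.hSCD_of_cmCharIdentityPackageTest L H (transpose_map_cmConjRingHom_eq_of_frame L ι H T hT) (isUnit_det_of_frame L ι H T hT) μω hμu (finExplicitCollection L H μω (finExplicitDelta_conj_left_all L H μω) (finExplicitDelta_conj_right_all L H μω)) mH mG νG νH μZ hQ)
                 (fun ξ => hexc_of_xiPinSphericalCofinite L μω hμu μZ (keysOfKeysCaseTwo L μω hK μZ hquad) hquad hLi ξ)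
                 νG evpG evpH ramG ramH PiXi ρXi)
              μω jInf dsInf (archTr₀ L ι H T hT νGi) νG ∧
            F0P3bLocalExpansionAtKitOfRecord.HTraceProductForm ι T hT (F0P3GHSideOfFibres.ghOfFibres ι T hT (⟨𝔨.traceGp, 𝔨.Smooth, PG, PH, nG, nH, trG, trH, 𝔨.Matches⟩ : F0P3InnerFormClassificationV6.Sockets L H μ) hg hsm trGS trHS)
              (F0P3XiSideOfRecordSCD.xiSideOfRecordSCD L H (transpose_map_cmConjRingHom_eq_of_frame L ι H T hT) (isUnit_det_of_frame L ι H T hT) μω hμu μZ (keysOfKeysCaseTwo L μω hK μZ hquad)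
                 (F0P3XiPacketFamilyOfRecordSCD.hSCD_of_cmCharIdentityPackageTest L H (transpose_map_cmConjRingHom_eq_of_frame L ι H T hT) (isUnit_det_of_frame L ι H T hT) μω hμu (finExplicitCollection L H μω (finExplicitDelta_conj_left_all L H μω) (finExplicitDelta_conj_right_all L H μω)) mH mG νG νH μZ hQ)
                 (fun ξ => hexc_of_xiPinSphericalCofinite L μω hμu μZ (keysOfKeysCaseTwo L μω hK μZ hquad) hquad hLi ξ)
                 νG evpG evpH ramG ramH PiXi ρXi)
              μω c jInf dsInf (archTr₀ L ι H T hT νGi) νG ∧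
            -- (P4) packet anchors (option (J1): all packets)
            (∀ (Q : PG) (v : Places L), v ∉ S₀ → v ∉ ramG Q →
              letI : MeasurableSpace ((cmDatum L 3 H).Local v) := borel _
              ∃ π : IrrClass ((cmDatum L 3 H).Local v), π.IsAdmissible ∧ π.IsUnitarizable ∧
                π.IsSphericalWith (cmLocalIntegralLevel L 3 H v) (νG v) (evpG Q v)) ∧
            (∀ (ρ : PH) (v : Places L), v ∉ S₀ → v ∉ ramH ρ →
              letI : MeasurableSpace ((cmDatum L 3 H).Local v) := borel _
              ∃ π : IrrClass ((cmDatum L 3 H).Local v), π.IsAdmissible ∧ π.IsUnitarizable ∧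
                π.IsSphericalWith (cmLocalIntegralLevel L 3 H v) (νG v) (evpH ρ v)) ∧
            -- (P5) e.v.p. convention
            (∀ (Q : PG) (v : Places L) (f : (cmDatum L 3 H).Local v → ℂ),
              ¬ (HasCompactSupport f ∧ IsLevel (cmLocalIntegralLevel L 3 H v) f) → evpG Q v f = 0) ∧
            (∀ (ρ : PH) (v : Places L) (f : (cmDatum L 3 H).Local v → ℂ),
              ¬ (HasCompactSupport f ∧ IsLevel (cmLocalIntegralLevel L 3 H v) f) → evpH ρ v f = 0)

set_option synthInstance.maxHeartbeats 400000 in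
set_option maxHeartbeats 4000000 in
/-- **`k9_of_stf` — BLOCK (W) AS A THEOREM**: the K9-∃ letter (`stub_K9`՚s statement, ED. 13 (J1) head) from the K9-STF letter (`stub_K9STF`՚s statement over
`K9SpectralLetter`) — the junction body of ED. 17–19b (M-term absorption `ov`, ★ `F0P3GHSideOfFibres.ghOfFibres`, `SpecPkgT1` from (T), ★
`F0P3OverrideWitnessOfLetters.specPkg_kitOfRecord_ghOfFibres_of_productForm`) re-headed over the hypothesis `hSTF`; in the closer `stub_K9 := k9_of_stf stub_K9STF`.
[cite: Rogawski1990, §14.6 Thm. 14.6.1 p. 241; §13.3 Thm. 13.3.7 p. 201; §13.7 p. 206] -/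
theorem k9_of_stf
    (hSTF :
      ∀ (L : Type) [Field L] [NumberField L] [IsCMField L] (ι : L →+* ℂ) (H : Matrix (Fin 3) (Fin 3) L) (T : GL (Fin 3) ℂ)
      (hT : (T : Matrix (Fin 3) (Fin 3) ℂ)ᴴ * H.map ι * (T : Matrix (Fin 3) (Fin 3) ℂ) = Literature.Geometry.ComplexHyperbolic.BallModel.J)
      (μ : Measure (Gp L H).automorphicQuotient) [(Gp L H).IsAutomorphicMeasure μ] (μω : HeckeCharacter L) (hμu : μω.IsUnitary)
      (ν : @Measure (GpAdelic L H) (borel _))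
      (νH : ∀ v : Places L, @Measure (HLocal L v) (borel _)) (νG : ∀ v : Places L, @Measure (GpLocal L H v) (borel _))
      (νGi : @Measure (GpInf L H) (borel _)) (νqi : @Measure (GInf L) (borel _)) (νHi : @Measure (HInf L) (borel _))
      (μZ : ∀ v : Places L, @Measure (Gqs L v ⧸ Subgroup.center (Gqs L v)) (borel _))
      (isHaar_ν : letI : MeasurableSpace (GpAdelic L H) := borel _; ν.IsHaarMeasure)
      (isInvInv_ν : letI : MeasurableSpace (GpAdelic L H) := borel _; ν.IsInvInvariant)
      (isHaar_νH : ∀ v : Places L, letI : MeasurableSpace (HLocal L v) := borel _; (νH v).IsHaarMeasure)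
      (isRightInv_νH : ∀ v : Places L, letI : MeasurableSpace (HLocal L v) := borel _; (νH v).IsMulRightInvariant)
      (isHaar_νG : ∀ v : Places L, letI : MeasurableSpace (GpLocal L H v) := borel _; (νG v).IsHaarMeasure)
      (isRightInv_νG : ∀ v : Places L, letI : MeasurableSpace (GpLocal L H v) := borel _; (νG v).IsMulRightInvariant)
      (finCpt_νGi : letI : MeasurableSpace (GpInf L H) := borel _; IsFiniteMeasureOnCompacts νGi)
      (rightInv_νGi : letI : MeasurableSpace (GpInf L H) := borel _; νGi.IsMulRightInvariant)
      (finCpt_νqi : letI : MeasurableSpace (GInf L) := borel _; IsFiniteMeasureOnCompacts νqi)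
      (rightInv_νqi : letI : MeasurableSpace (GInf L) := borel _; νqi.IsMulRightInvariant)
      (finCpt_νHi : letI : MeasurableSpace (HInf L) := borel _; IsFiniteMeasureOnCompacts νHi)
      (rightInv_νHi : letI : MeasurableSpace (HInf L) := borel _; νHi.IsMulRightInvariant)
      (isHaar_μZ : ∀ v : Places L, letI : MeasurableSpace (Gqs L v ⧸ Subgroup.center (Gqs L v)) := borel _; (μZ v).IsHaarMeasure)
      (hquad : ∀ v : Places L, (∀ w : PlacesOver L v, IsCMField.complexConj L • w.1 = w.1) →
        IsQuadraticCharExtension (conjLocal L (IsCMField.complexConj L) v) (μω.semilocalComponent L v)),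
        -- (K9-∃) THE LETTER DELIVERS the global sign and the archimedean classes WITH their R3∕R4 clauses (print: `c = ε`, `jInf∕dsInf = [J_φ^{±}]∕[D_φ]`,
        -- [Rogawski1990 §12.3 pp. 178–179; Prop. 15.2.1]; R3∕R4 for them: [BorelWallach2000 I §5.3 (Wigner), II §5.4, VI Thm. 4.11]) — NOT ∀-quantified over them
        ∃ (c : ℚ) (jInf dsInf : ℤ → ℤ → ℤ → Cinf), (c = 1 ∨ c = -1) ∧ JInfNoDegOne jInf ∧ DsInfNoDegOne dsInf ∧
          (∀ p q t : ℤ, IsCohUnitaryClass (jInf p q t)) ∧ (∀ p q t : ℤ, IsCohUnitaryClass (dsInf p q t)) ∧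
        K9SpectralLetter L ι H T hT μ μω hμu ν νH νG νGi νqi νHi μZ isHaar_ν isInvInv_ν isHaar_νH isRightInv_νH isHaar_νG isRightInv_νG finCpt_νGi rightInv_νGi finCpt_νqi rightInv_νqi finCpt_νHi rightInv_νHi isHaar_μZ hquad c jInf dsInf) :
  ∀ (L : Type) [Field L] [NumberField L] [IsCMField L] (ι : L →+* ℂ) (H : Matrix (Fin 3) (Fin 3) L) (T : GL (Fin 3) ℂ)
  (hT : (T : Matrix (Fin 3) (Fin 3) ℂ)ᴴ * H.map ι * (T : Matrix (Fin 3) (Fin 3) ℂ) = Literature.Geometry.ComplexHyperbolic.BallModel.J)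
  (μ : Measure (Gp L H).automorphicQuotient) [(Gp L H).IsAutomorphicMeasure μ] (μω : HeckeCharacter L) (hμu : μω.IsUnitary)
  (ν : @Measure (GpAdelic L H) (borel _))
  (νH : ∀ v : Places L, @Measure (HLocal L v) (borel _)) (νG : ∀ v : Places L, @Measure (GpLocal L H v) (borel _))
  (νGi : @Measure (GpInf L H) (borel _)) (νqi : @Measure (GInf L) (borel _)) (νHi : @Measure (HInf L) (borel _))
  (μZ : ∀ v : Places L, @Measure (Gqs L v ⧸ Subgroup.center (Gqs L v)) (borel _))
  (isHaar_ν : letI : MeasurableSpace (GpAdelic L H) := borel _; ν.IsHaarMeasure)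
  (isInvInv_ν : letI : MeasurableSpace (GpAdelic L H) := borel _; ν.IsInvInvariant)
  (isHaar_νH : ∀ v : Places L, letI : MeasurableSpace (HLocal L v) := borel _; (νH v).IsHaarMeasure)
  (isRightInv_νH : ∀ v : Places L, letI : MeasurableSpace (HLocal L v) := borel _; (νH v).IsMulRightInvariant)
  (isHaar_νG : ∀ v : Places L, letI : MeasurableSpace (GpLocal L H v) := borel _; (νG v).IsHaarMeasure)
  (isRightInv_νG : ∀ v : Places L, letI : MeasurableSpace (GpLocal L H v) := borel _; (νG v).IsMulRightInvariant)
  (finCpt_νGi : letI : MeasurableSpace (GpInf L H) := borel _; IsFiniteMeasureOnCompacts νGi)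
  (rightInv_νGi : letI : MeasurableSpace (GpInf L H) := borel _; νGi.IsMulRightInvariant)
  (finCpt_νqi : letI : MeasurableSpace (GInf L) := borel _; IsFiniteMeasureOnCompacts νqi)
  (rightInv_νqi : letI : MeasurableSpace (GInf L) := borel _; νqi.IsMulRightInvariant)
  (finCpt_νHi : letI : MeasurableSpace (HInf L) := borel _; IsFiniteMeasureOnCompacts νHi)
  (rightInv_νHi : letI : MeasurableSpace (HInf L) := borel _; νHi.IsMulRightInvariant)
  (isHaar_μZ : ∀ v : Places L, letI : MeasurableSpace (Gqs L v ⧸ Subgroup.center (Gqs L v)) := borel _; (μZ v).IsHaarMeasure)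
  (hquad : ∀ v : Places L, (∀ w : PlacesOver L v, IsCMField.complexConj L • w.1 = w.1) →
    IsQuadraticCharExtension (conjLocal L (IsCMField.complexConj L) v) (μω.semilocalComponent L v)),
    -- (K9-∃) THE LETTER DELIVERS the global sign and the archimedean classes WITH their R3∕R4 clauses (print: `c = ε`, `jInf∕dsInf = [J_φ^{±}]∕[D_φ]`,
    -- [Rogawski1990 §12.3 pp. 178–179; Prop. 15.2.1]; R3∕R4 for them: [BorelWallach2000 I §5.3 (Wigner), II §5.4, VI Thm. 4.11]) — NOT ∀-quantified over them
    ∃ (c : ℚ) (jInf dsInf : ℤ → ℤ → ℤ → Cinf), (c = 1 ∨ c = -1) ∧ JInfNoDegOne jInf ∧ DsInfNoDegOne dsInf ∧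
      (∀ p q t : ℤ, IsCohUnitaryClass (jInf p q t)) ∧ (∀ p q t : ℤ, IsCohUnitaryClass (dsInf p q t)) ∧
    letI : ∀ (v : Places L) (a : HLocal L v), MeasurableSpace (HLocal L v ⧸ Subgroup.centralizer ({a} : Set (HLocal L v))) := fun _ _ => borel _
    letI : ∀ (v : Places L) (γ : (cmDatum L 3 H).Local v),
        MeasurableSpace ((cmDatum L 3 H).Local v ⧸ Subgroup.centralizer ({γ} : Set ((cmDatum L 3 H).Local v))) := fun _ _ => borel _
    haveI : ∀ (v : Places L) (a : HLocal L v), BorelSpace (HLocal L v ⧸ Subgroup.centralizer ({a} : Set (HLocal L v))) := fun _ _ => ⟨rfl⟩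
    haveI : ∀ (v : Places L) (γ : (cmDatum L 3 H).Local v),
        BorelSpace ((cmDatum L 3 H).Local v ⧸ Subgroup.centralizer ({γ} : Set ((cmDatum L 3 H).Local v))) := fun _ _ => ⟨rfl⟩
    ∀ (mH : ∀ v : Places L, OrbitalMeasureFamily (HLocal L v)) (mG : ∀ v : Places L, OrbitalMeasureFamily ((cmDatum L 3 H).Local v)),
      letI : MeasurableSpace (GpAdelic L H) := borel _
      haveI : BorelSpace (GpAdelic L H) := ⟨rfl⟩
      haveI : ν.IsHaarMeasure := isHaar_ν
      haveI : ν.IsInvInvariant := isInvInv_ν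
      letI : ∀ v : Places L, MeasurableSpace (GpLocal L H v) := fun _ => borel _
      haveI : ∀ v : Places L, BorelSpace (GpLocal L H v) := fun _ => ⟨rfl⟩
      letI : ∀ v : Places L, MeasurableSpace (HLocal L v) := fun _ => borel _
      haveI : ∀ v : Places L, BorelSpace (HLocal L v) := fun _ => ⟨rfl⟩
      letI : ∀ (v : Places L) (a : HLocal L v), MeasurableSpace (HLocal L v ⧸ Subgroup.centralizer ({a} : Set (HLocal L v))) := fun _ _ => borel _
      letI : ∀ (v : Places L) (γ : GpLocal L H v), MeasurableSpace (GpLocal L H v ⧸ Subgroup.centralizer ({γ} : Set (GpLocal L H v))) := fun _ _ => borel _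
      letI : MeasurableSpace (GpInf L H) := borel _
      haveI : BorelSpace (GpInf L H) := ⟨rfl⟩
      letI : MeasurableSpace (GInf L) := borel _
      haveI : BorelSpace (GInf L) := ⟨rfl⟩
      letI : MeasurableSpace (HInf L) := borel _
      haveI : BorelSpace (HInf L) := ⟨rfl⟩
      haveI : ∀ v : Places L, (νH v).IsHaarMeasure := isHaar_νH
      haveI : ∀ v : Places L, (νH v).IsMulRightInvariant := isRightInv_νH
      haveI : ∀ v : Places L, (νG v).IsHaarMeasure := isHaar_νG
      haveI : ∀ v : Places L, (νG v).IsMulRightInvariant := isRightInv_νG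
      haveI : IsFiniteMeasureOnCompacts νGi := finCpt_νGi
      haveI : νGi.IsMulRightInvariant := rightInv_νGi
      haveI : IsFiniteMeasureOnCompacts νqi := finCpt_νqi
      haveI : νqi.IsMulRightInvariant := rightInv_νqi
      haveI : IsFiniteMeasureOnCompacts νHi := finCpt_νHi
      haveI : νHi.IsMulRightInvariant := rightInv_νHi
      (∀ v : Places L, (mH v).IsCanonical (IsLocalGRegular L v) (νH v) ∧
          (mG v).IsCanonical (fun γ => IsRegularElt (γ.val : GL (Fin 3) (UnitaryGroup.LocalRing L v))) (νG v)) →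
      ∀ (𝔨 : ComparisonKit L H μ), 𝔨.IsPinned ν (archCanonicalTransferFactor L H μω) νH νG νGi νqi νHi → 𝔨.TransferExistence → 𝔨.SimpleTraceFormula → 𝔨.Δ = (finExplicitCollection L H μω (finExplicitDelta_conj_left_all L H μω) (finExplicitDelta_conj_right_all L H μω)) → 𝔨.mH = mH →
        (∀ (v : Places L) (c' : ConjClasses ((cmDatum L 3 H).Local v)),
          Literature.NumberTheory.Rogawski1990.IsRegularElt ((Quotient.out c').val : GL (Fin 3) (UnitaryGroup.LocalRing L v)) → 𝔨.mG v c' = mG v c') →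
        ∀ (hQ : CMCharIdentityPackageTest L H (transpose_map_cmConjRingHom_eq_of_frame L ι H T hT) (isUnit_det_of_frame L ι H T hT) νH νG μω hμu (finExplicitCollection L H μω (finExplicitDelta_conj_left_all L H μω) (finExplicitDelta_conj_right_all L H μω)) mH mG)
          (hK : KeysCaseTwo L) (hLi : XiPinSphericalCofinite L),
          Nonempty (OverrideWitness L ι H T hT μ μω hμu ν νH νG νGi μZ c jInf dsInf isHaar_ν isHaar_μZ hquad (finExplicitCollection L H μω (finExplicitDelta_conj_left_all L H μω) (finExplicitDelta_conj_right_all L H μω)) mH mG hQ hK hLi 𝔨) := by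
  intro L _ _ _ ι H T hT μ _ μω hμu ν νH νG νGi νqi νHi μZ hν hνi hνH hνHr hνG hνGr hGic hGir hqic hqir hHic hHir hμZ hquad
  obtain ⟨c, jInf, dsInf, hc, hJ, hD, hJU, hDU, hrest⟩ :=
    hSTF L ι H T hT μ μω hμu ν νH νG νGi νqi νHi μZ hν hνi hνH hνHr hνG hνGr hGic hGir hqic hqir hHic hHir hμZ hquad
  refine ⟨c, jInf, dsInf, hc, hJ, hD, hJU, hDU, ?_⟩
  intro mH mG hcan 𝔨 hpin htE hSTFa hΔ hmH hmG hQ hK hLi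
  -- instance preamble (the statement's `letI`s are not local instances after `intro`; same block as `Rung0Choice.rows`)
  letI : MeasurableSpace (GpAdelic L H) := borel _
  haveI : BorelSpace (GpAdelic L H) := ⟨rfl⟩
  haveI : ν.IsHaarMeasure := hν
  haveI : ν.IsInvInvariant := hνi
  letI : ∀ v : Places L, MeasurableSpace (GpLocal L H v) := fun _ => borel _
  haveI : ∀ v : Places L, BorelSpace (GpLocal L H v) := fun _ => ⟨rfl⟩
  letI : ∀ v : Places L, MeasurableSpace (HLocal L v) := fun _ => borel _
  haveI : ∀ v : Places L, BorelSpace (HLocal L v) := fun _ => ⟨rfl⟩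
  letI : ∀ (v : Places L) (a : HLocal L v), MeasurableSpace (HLocal L v ⧸ Subgroup.centralizer ({a} : Set (HLocal L v))) := fun _ _ => borel _
  letI : ∀ (v : Places L) (γ : GpLocal L H v), MeasurableSpace (GpLocal L H v ⧸ Subgroup.centralizer ({γ} : Set (GpLocal L H v))) := fun _ _ => borel _
  letI : MeasurableSpace (GpInf L H) := borel _
  haveI : BorelSpace (GpInf L H) := ⟨rfl⟩
  letI : MeasurableSpace (GInf L) := borel _
  haveI : BorelSpace (GInf L) := ⟨rfl⟩
  letI : MeasurableSpace (HInf L) := borel _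
  haveI : BorelSpace (HInf L) := ⟨rfl⟩
  haveI : ∀ v : Places L, (νH v).IsHaarMeasure := hνH
  haveI : ∀ v : Places L, (νH v).IsMulRightInvariant := hνHr
  haveI : ∀ v : Places L, (νG v).IsHaarMeasure := hνG
  haveI : ∀ v : Places L, (νG v).IsMulRightInvariant := hνGr
  haveI : IsFiniteMeasureOnCompacts νGi := hGic
  haveI : νGi.IsMulRightInvariant := hGir
  haveI : IsFiniteMeasureOnCompacts νqi := hqic
  haveI : νqi.IsMulRightInvariant := hqir
  haveI : IsFiniteMeasureOnCompacts νHi := hHic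
  haveI : νHi.IsMulRightInvariant := hHir
  letI : MeasurableSpace (Gp L H).Adelic := borel (GpAdelic L H)
  haveI : BorelSpace (Gp L H).Adelic := ⟨rfl⟩
  haveI : IsFiniteMeasureOnCompacts (show @Measure (Gp L H).Adelic (borel (GpAdelic L H)) from ν) :=
    (show @Measure.IsHaarMeasure (Gp L H).Adelic _ _ (borel _) ν from hν).toIsFiniteMeasureOnCompacts
  letI : ∀ v : Places L, MeasurableSpace (Gqs L v ⧸ Subgroup.center (Gqs L v)) := fun _ => borel _
  haveI : ∀ v : Places L, BorelSpace (Gqs L v ⧸ Subgroup.center (Gqs L v)) := fun _ => ⟨rfl⟩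
  haveI : ∀ v : Places L, (μZ v).IsHaarMeasure := hμZ
  -- the T1-side terms: smoothness of the record tensors (pin (iv)) and T1g
  have hsm : ∀ (S : Finset (Places L)) (fS : F0P3SemilocalTestFunctionsOfRecord.TestS₀ L H ι T hT S) (fT : F0P3TestFunctionsOfRecord.Unr₀ L H S), 𝔨.Smooth (F0P3SemilocalTestFunctionsOfRecord.tens₀ S fS fT) :=
    fun S fS fT => (ComparisonKit.IsPinned.smooth_iff 𝔨 hpin (F0P3SemilocalTestFunctionsOfRecord.tens₀ S fS fT)).2 (F0P3SemilocalTestFunctionsOfRecord.tens₀_smooth S fS fT)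
  obtain ⟨PG, PH, nG, nH, trG, trH, evpG, evpH, ramG, ramH, PiXi, ρXi, trGS, trHS, S₀, hT1, hP1, hP2, hPG, hPH, hAG, hAH, hcG, hcH⟩ :=
    hrest mH mG hcan 𝔨 hpin htE hSTFa hΔ hmH hmG hQ hK hLi htE hsm
  -- the override by M-TERM ABSORPTION
  let ov : SpecOverride L :=
    { SθG := fun f => ∑' Q : PG, nG Q * trG Q f, SθH := fun fH => ∑' ρ : PH, nH ρ * trH ρ fH,
      SθM := fun f => 𝔨.SJGtot f - ∑' Q : PG, nG Q * trG Q f, SJM := fun _ => 0,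
      SθMH := fun fH => 𝔨.SJHtot fH - ∑' ρ : PH, nH ρ * trH ρ fH, SJMH := fun _ => 0,
      PacketG := PG, PacketH := PH, nG := nG, nH := nH, trG := trG, trH := trH }
  -- smoothness of `f′` from `Matches` (pins (ix′-c) + (iv)), for T1d
  have hsmooth : ∀ (f' : F0P3InnerFormClassificationV6.TestGp L H) (f : F0P3InnerFormClassificationV6.TestG L) (fH : F0P3InnerFormClassificationV6.TestH L),
      𝔨.Matches f' f fH → 𝔨.Smooth f' := by
    intro f' f fH hm
    obtain ⟨T₁, -, hT₁, -, hf', -⟩ := ComparisonKit.IsPinned.transfer_tensors 𝔨 hpin hm.1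
    exact (ComparisonKit.IsPinned.smooth_iff 𝔨 hpin f').2 ⟨T₁, hT₁, hf'⟩
  have hspec : (𝔨.override ov).SpecPkgT1 :=
    { t1c := fun f' f fH _ => ⟨by show 𝔨.SJGtot f = (∑' Q : PG, nG Q * trG Q f) + (𝔨.SJGtot f - ∑' Q : PG, nG Q * trG Q f) - 0; ring,
                               by show 𝔨.SJHtot fH = (∑' ρ : PH, nH ρ * trH ρ fH) + (𝔨.SJHtot fH - ∑' ρ : PH, nH ρ * trH ρ fH) - 0; ring⟩
      t1d := fun f' f fH hm => by
        have h := (hT1 f' f fH (hsmooth f' f fH hm) hm).2.2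
        show (𝔨.SJGtot f - ∑' Q : PG, nG Q * trG Q f) + (1 / 2 : ℂ) * (𝔨.SJHtot fH - ∑' ρ : PH, nH ρ * trH ρ fH) - (0 + (1 / 2 : ℂ) * 0) = 0
        linear_combination h
      t1e := fun f' f hs ht => by
        obtain ⟨f₂, fH₂, hm₂⟩ := htE f' hs
        exact ⟨(hT1 f' f fH₂ hs ⟨ht, hm₂.2⟩).1, rfl⟩
      t1f := fun f' fH hs ht => by
        obtain ⟨f₂, fH₂, hm₂⟩ := htE f' hs
        exact ⟨(hT1 f' f₂ fH hs ⟨hm₂.1, ht⟩).2.1, rfl⟩ }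
  exact ⟨⟨ov, F0P3GHSideOfFibres.ghOfFibres ι T hT (socketsOfT1 L H μ (𝔨.override ov)) htE hsm trGS trHS,
      evpG, evpH, ramG, ramH, PiXi, ρXi, S₀, hspec,
      F0P3OverrideWitnessOfLetters.specPkg_kitOfRecord_ghOfFibres_of_productForm ι T hT (socketsOfT1 L H μ (𝔨.override ov)) htE hsm trGS trHS _ μω c jInf dsInf _ νG ν _ S₀ hc hP1 hP2 hPG hPH,
      hAG, hAH, hcG, hcH⟩⟩

end Rung0

/-! ## §K9S ∕ §Rung0S — THE SIGNED TWINS (EDITION 2, closer ED. 26 «QCMT SIGNED», desk F0P3-plan (g9) RULING D29): the seven §K9∕§Rung0 blocks VERBATIM under τ -/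

section K9S

variable (L : Type) [Field L] [NumberField L] [IsCMField L] (ι : L →+* ℂ) (H : Matrix (Fin 3) (Fin 3) L) (T : GL (Fin 3) ℂ)
  (hT : (T : Matrix (Fin 3) (Fin 3) ℂ)ᴴ * H.map ι * (T : Matrix (Fin 3) (Fin 3) ℂ) = Literature.Geometry.ComplexHyperbolic.BallModel.J)
  (μ : Measure (Gp L H).automorphicQuotient) [(Gp L H).IsAutomorphicMeasure μ] (μω : HeckeCharacter L) (hμu : μω.IsUnitary)
  -- the ∃-bound rung-0 data read by `Q_K9` (fields of `Rung0Witness` below; Borel σ-algebras throughout)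
  (ν : @Measure (GpAdelic L H) (borel _))
  (νH : ∀ v : Places L, @Measure (HLocal L v) (borel _)) (νG : ∀ v : Places L, @Measure (GpLocal L H v) (borel _))
  (νGi : @Measure (GpInf L H) (borel _)) (νqi : @Measure (GInf L) (borel _)) (νHi : @Measure (HInf L) (borel _))
  (μZ : ∀ v : Places L, @Measure (Gqs L v ⧸ Subgroup.center (Gqs L v)) (borel _))
  (Tinf : Literature.NumberTheory.Rogawski1990.ArchTransferFactor L H) (c : ℚ) (wXi : OneDimAutRepH L → ℤ) (jInf dsInf : ℤ → ℤ → ℤ → Cinf)   -- ED. 3: the per-ξ global root numbers `wXi ξ = ε(½, φ_ξ) = ±1` [Rogawski1992 Thm. 1.2], right after `c`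
  (isHaar_ν : letI : MeasurableSpace (GpAdelic L H) := borel _; ν.IsHaarMeasure)
  (isInvInv_ν : letI : MeasurableSpace (GpAdelic L H) := borel _; ν.IsInvInvariant)
  (isHaar_νH : ∀ v : Places L, letI : MeasurableSpace (HLocal L v) := borel _; (νH v).IsHaarMeasure)
  (isRightInv_νH : ∀ v : Places L, letI : MeasurableSpace (HLocal L v) := borel _; (νH v).IsMulRightInvariant)
  (isHaar_νG : ∀ v : Places L, letI : MeasurableSpace (GpLocal L H v) := borel _; (νG v).IsHaarMeasure)
  (isRightInv_νG : ∀ v : Places L, letI : MeasurableSpace (GpLocal L H v) := borel _; (νG v).IsMulRightInvariant)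
  (finCpt_νGi : letI : MeasurableSpace (GpInf L H) := borel _; IsFiniteMeasureOnCompacts νGi)
  (rightInv_νGi : letI : MeasurableSpace (GpInf L H) := borel _; νGi.IsMulRightInvariant)
  (finCpt_νqi : letI : MeasurableSpace (GInf L) := borel _; IsFiniteMeasureOnCompacts νqi)
  (rightInv_νqi : letI : MeasurableSpace (GInf L) := borel _; νqi.IsMulRightInvariant)
  (finCpt_νHi : letI : MeasurableSpace (HInf L) := borel _; IsFiniteMeasureOnCompacts νHi)
  (rightInv_νHi : letI : MeasurableSpace (HInf L) := borel _; νHi.IsMulRightInvariant)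
  (isHaar_μZ : ∀ v : Places L, letI : MeasurableSpace (Gqs L v ⧸ Subgroup.center (Gqs L v)) := borel _; (μZ v).IsHaarMeasure)
  (hquad : ∀ v : Places L, (∀ w : PlacesOver L v, IsCMField.complexConj L • w.1 = w.1) →
    IsQuadraticCharExtension (conjLocal L (IsCMField.complexConj L) v) (μω.semilocalComponent L v))

/-- SIGNED twin (Defs ED. 2 for closer ED. 26 «QCMT SIGNED»; desk F0P3-plan (g9) RULING D29; κ-sign `ε_v(H) = ω_w(−det H)`, LEAD RULING «K» K2, REF1 (g9) R-45∕R-46) of `kitK9` above — ED. 3 (closer ED. 38 «PK-ε»): AT THE W KIT ★1 `F0P3KitOfRecordW.kitOfRecordW … μω wXi c …` (`N := N₀ + [wXi ξ = −1]`, `sgnG := wXi ξ · c`; every sign-blind projection definitionally `kitOfRecord`՚s) — otherwise its text VERBATIM under the token map τ {`CMCharIdentityPackageTest` ↦ `…Signed` (★ p842701), `hSCD_of_cmCharIdentityPackageTest` ↦ `…Signed` (★ p843355), `kitK9`∕`OverrideWitness`∕`Q_K9`∕`Rung0Witness`∕`StubRung0`∕`k9_of_stf` ↦ `…S`, `K9SpectralLetter`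 ↦ `K9SpectralLetterSigned`}; the unsigned original stays byte-identical (it serves the tree closer ED. 25 until ED. 26 is written and is thereafter the superseded negative edge «unsigned package in negative position — mis-typed as written»; pruning = a later Defs edition by desk ruling). **`kitK9S … Δ mH mG hQ hK hLi 𝔨 ov gh evpG evpH ramG ramH PiXi ρXi`** — THE KIT OF RECORD AT RUNG 0 (a reducible abbreviation of ★ K0 `kitOfRecord`, no new data): sockets :=
`socketsOfT1 (𝔨.override ov)` (T1's pinned kit `𝔨` with its twelve spectral placeholders overridden by `ov`, §A — law #1 `TraceIdentity` is about `𝔨` ALONE), `gh` the G∕H-side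
`S`-carriers, ξ-side := ★ `xiSideOfRecord` AT THE Q-ARGUMENTS `(Δ, mH, mG)` of the rider (RULING (V48) R2: the T1 export hands `Q` at `(𝔨.Δ, 𝔨.mH, mG₀)` where `mG₀` agrees with
`𝔨.mG` on the REGULAR classes only, so the ξ-side and `hQ` are typed at the package's own `(Δ, mH, mG)`, not at the kit's), with `hCM := hCM_of_cmCharIdentityPackage … hQ`,
`keys := keysOfKeysCaseTwo … hK …`, `hexc := hexc_of_xiPinSphericalCofinite … hLi` (★ (J2)∕(J3) glue), `μv := νG`, `archTr := archTr₀ … νGi`, the sign `c`, the arch classes `jInf dsInf`,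
`ramCls := ★ ramCls₀`. [cite: Rogawski1990, §14.6 Thm. 14.6.1 p. 241; §13.1 p. 199] -/
abbrev kitK9S
    (Δ : ∀ v : Places L, Literature.NumberTheory.Rogawski1990.LocalTransferFactor L H v)
    (mH : letI : ∀ (v : Places L) (a : HLocal L v), MeasurableSpace (HLocal L v ⧸ Subgroup.centralizer ({a} : Set (HLocal L v))) := fun _ _ => borel _
      ∀ v : Places L, OrbitalMeasureFamily (HLocal L v))
    (mG : letI : ∀ (v : Places L) (γ : (cmDatum L 3 H).Local v),
        MeasurableSpace ((cmDatum L 3 H).Local v ⧸ Subgroup.centralizer ({γ} : Set ((cmDatum L 3 H).Local v))) := fun _ _ => borel _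
      ∀ v : Places L, OrbitalMeasureFamily ((cmDatum L 3 H).Local v))
    (hQ : letI : ∀ v : Places L, MeasurableSpace (GpLocal L H v) := fun _ => borel _
      letI : ∀ v : Places L, MeasurableSpace (HLocal L v) := fun _ => borel _
      letI : ∀ (v : Places L) (a : HLocal L v), MeasurableSpace (HLocal L v ⧸ Subgroup.centralizer ({a} : Set (HLocal L v))) := fun _ _ => borel _
      letI : ∀ (v : Places L) (γ : GpLocal L H v), MeasurableSpace (GpLocal L H v ⧸ Subgroup.centralizer ({γ} : Set (GpLocal L H v))) := fun _ _ => borel _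
      CMCharIdentityPackageTestSigned L H (transpose_map_cmConjRingHom_eq_of_frame L ι H T hT) (isUnit_det_of_frame L ι H T hT) νH νG μω hμu Δ mH mG)
    (hK : KeysCaseTwo L) (hLi : XiPinSphericalCofinite L) (𝔨 : ComparisonKit L H μ)
    (ov : SpecOverride L) (gh : GHSide L H ι T hT ov.PacketG ov.PacketH) (evpG : ov.PacketG → EvpData L H) (evpH : ov.PacketH → EvpData L H)
    (ramG : ov.PacketG → Finset (Places L)) (ramH : ov.PacketH → Finset (Places L)) (PiXi : OneDimAutRepH L → ov.PacketG) (ρXi : OneDimAutRepH L → ov.PacketH) :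
    F0P3InnerFormClassificationV8.ClassificationKit L H ι T hT μ :=
  letI : MeasurableSpace (Gp L H).Adelic := borel _
  haveI : BorelSpace (Gp L H).Adelic := ⟨rfl⟩
  haveI : IsFiniteMeasureOnCompacts (show Measure (Gp L H).Adelic from ν) :=
    (show @Measure.IsHaarMeasure (Gp L H).Adelic _ _ (borel _) ν from isHaar_ν).toIsFiniteMeasureOnCompacts
  letI : ∀ v : Places L, MeasurableSpace (GpLocal L H v) := fun _ => borel _
  letI : ∀ v : Places L, MeasurableSpace (HLocal L v) := fun _ => borel _
  letI : ∀ (v : Places L) (a : HLocal L v), MeasurableSpace (HLocal L v ⧸ Subgroup.centralizer ({a} : Set (HLocal L v))) := fun _ _ => borel _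
  letI : ∀ (v : Places L) (γ : GpLocal L H v), MeasurableSpace (GpLocal L H v ⧸ Subgroup.centralizer ({γ} : Set (GpLocal L H v))) := fun _ _ => borel _
  letI : ∀ v : Places L, MeasurableSpace (Gqs L v ⧸ Subgroup.center (Gqs L v)) := fun _ => borel _
  haveI : ∀ v : Places L, BorelSpace (Gqs L v ⧸ Subgroup.center (Gqs L v)) := fun _ => ⟨rfl⟩
  haveI : ∀ v : Places L, (μZ v).IsHaarMeasure := isHaar_μZ
  F0P3KitOfRecordW.kitOfRecordW L H ι T hT μ (socketsOfT1 L H μ (𝔨.override ov)) gh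
    (F0P3XiSideOfRecordSCD.xiSideOfRecordSCD L H (transpose_map_cmConjRingHom_eq_of_frame L ι H T hT) (isUnit_det_of_frame L ι H T hT) μω hμu μZ (keysOfKeysCaseTwo L μω hK μZ hquad)
       (F0P3XiPacketFamilyOfRecordSCD.hSCD_of_cmCharIdentityPackageTestSigned L H (transpose_map_cmConjRingHom_eq_of_frame L ι H T hT) (isUnit_det_of_frame L ι H T hT) μω hμu
        Δ mH mG νG νH μZ hQ)
       (fun ξ => hexc_of_xiPinSphericalCofinite L μω hμu μZ (keysOfKeysCaseTwo L μω hK μZ hquad) hquad hLi ξ)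
       νG evpG evpH ramG ramH PiXi ρXi)
    μω wXi c jInf dsInf (archTr₀ L ι H T hT νGi) ν νG F0P3RamClsOfRecord.ramCls₀

/-- SIGNED twin (Defs ED. 2 for closer ED. 26 «QCMT SIGNED»; desk F0P3-plan (g9) RULING D29; κ-sign `ε_v(H) = ω_w(−det H)`, LEAD RULING «K» K2, REF1 (g9) R-45∕R-46) of `OverrideWitness` above — ED. 3 (closer ED. 38 «PK-ε»): the package field `specPkg` is typed at the W kit `kitK9S … c wXi …` [Rogawski1992 Thm. 1.2]; otherwise its text VERBATIM under the token map τ {`CMCharIdentityPackageTest` ↦ `…Signed` (★ p842701), `hSCD_of_cmCharIdentityPackageTest` ↦ `…Signed` (★ p843355), `kitK9`∕`OverrideWitness`∕`Q_K9`∕`Rung0Witness`∕`StubRung0`∕`k9_of_stf` ↦ `…S`, `K9SpectralLetter` ↦ `K9SpectralLetterSigned`}; the unsigned original stays byte-identical (it serves the tree closer ED. 25 until ED. 26 is written and is thereafter the superseded negative edge «unsigned package in negative position — mis-typed as written»; pruning = a later Defs edition by desk ruling). **`OverrideWitnessS … Δ mH mG hQ hK hLi 𝔨`** — the ∃-bound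 content of `Q_K9S` AT A PINNED KIT `𝔨` WITH PARTNERS (RULINGS (V45)(d)(f), (V48) R2, (V50), (V51)(b); REF1 R-28 (i)(ii),
R-29, R-31): override values `ov` for T1's twelve spectral placeholders, the G∕H-side `S`-carriers `gh`, the (J2) packet-side data `evpG evpH ramG ramH PiXi ρXi`, ONE level `S₀`,
and the facts: T1c–T1f for the overridden kit (`SpecPkgT1`), the witnessed package `SpecPkg S₀` of the kit of record `kitK9S …` [Rogawski1990 Thm. 14.6.1 p. 241 ll. 1–8; §14.6
p. 242; Thm. 13.3.7, (14.6.2), (14.6.3); Flath1979 Thm. 3], the PACKET ANCHORS `anchorG`∕`anchorH` (ED. 6, replacing ED. 4–5's row fields `hatBounded`∕`unrStarAlgebra`, RULING (V51)(b) ∕ R-31 PAID DOWN: at the genuine witness the packet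
e.v.p.s `evpG Q`∕`evpH ρ` off `S₀ ∪ ram` are eigencharacters of UNITARY SPHERICAL members of the global A-packets [Rogawski1990 §13.7 p. 206; §13.1 p. 199] — stated in the pin
currency `∃ π, IsAdmissible ∧ IsUnitarizable ∧ IsSphericalWith K_v (νG v) (evpG Q v)`; rows #6∕#7 at BOTH summands then follow IN-HOUSE by ★ `F0P3HatLawsKitK9` ∕ ★
`F0P3HatLawsOfAnchoredPackets` — Langlands' bound [Langlands1980 p. 209] and the `*`-character property [CartierCorvallis1979 §IV.1 Cor. 4.1–4.2]), and the two e.v.p. conventions `hG hH′` (junk values off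
`C_c(K_v\G′_v/K_v)`, ★ `evpConvention_kitOfRecord`).  THE OVERRIDE `ov`, THE PACKET-SIDE DATA `gh` AND THE LEVEL `S₀` MAY DEPEND ON THE KIT `𝔨` (R-29, RULING (V50)): `gh` is built
from `𝔨`'s own fibres (`TestSG S = TestSH S := TestS₀ S`, `tensG ∕ tensH` := the partners law T1g `TransferExistence` chooses, `MatchesS S fS fSG fSH := fSG = fS ∧ fSH = fS`), so
`matchingS` ∕ `transferS` hold by construction and `factorisationPk` ∕ `aPacketSpectral` ∕ `localExpansion` at those partners are the printed statements [Rogawski1990 Prop. 13.2.2,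
Props. 14.4.1–14.4.2, §12.7, Thm. 14.6.1] because the packet distributions are stable, hence independent of which transfer T1g picked.
[cite: Rogawski1990, §14.6 Thm. 14.6.1 p. 241; Thm. 14.6.4 p. 244; §13.7 p. 206] [cite: CartierCorvallis1979, §IV.1 Cor. 4.1–4.2] -/
structure OverrideWitnessS
    (Δ : ∀ v : Places L, Literature.NumberTheory.Rogawski1990.LocalTransferFactor L H v)
    (mH : letI : ∀ (v : Places L) (a : HLocal L v), MeasurableSpace (HLocal L v ⧸ Subgroup.centralizer ({a} : Set (HLocal L v))) := fun _ _ => borel _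
      ∀ v : Places L, OrbitalMeasureFamily (HLocal L v))
    (mG : letI : ∀ (v : Places L) (γ : (cmDatum L 3 H).Local v),
        MeasurableSpace ((cmDatum L 3 H).Local v ⧸ Subgroup.centralizer ({γ} : Set ((cmDatum L 3 H).Local v))) := fun _ _ => borel _
      ∀ v : Places L, OrbitalMeasureFamily ((cmDatum L 3 H).Local v))
    (hQ : letI : ∀ v : Places L, MeasurableSpace (GpLocal L H v) := fun _ => borel _
      letI : ∀ v : Places L, MeasurableSpace (HLocal L v) := fun _ => borel _
      letI : ∀ (v : Places L) (a : HLocal L v), MeasurableSpace (HLocal L v ⧸ Subgroup.centralizer ({a} : Set (HLocal L v))) := fun _ _ => borel _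
      letI : ∀ (v : Places L) (γ : GpLocal L H v), MeasurableSpace (GpLocal L H v ⧸ Subgroup.centralizer ({γ} : Set (GpLocal L H v))) := fun _ _ => borel _
      CMCharIdentityPackageTestSigned L H (transpose_map_cmConjRingHom_eq_of_frame L ι H T hT) (isUnit_det_of_frame L ι H T hT) νH νG μω hμu Δ mH mG)
    (hK : KeysCaseTwo L) (hLi : XiPinSphericalCofinite L) (𝔨 : ComparisonKit L H μ) : Type 2 where
  /-- values for T1's twelve spectral placeholder sockets (§A); may depend on `𝔨` -/
  ov : SpecOverride L
  /-- the G∕H-side `S`-carriers; built from `𝔨`'s own fibres and T1g's partners -/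
  gh : GHSide L H ι T hT ov.PacketG ov.PacketH
  /-- e.v.p. of the global packets of `G` -/
  evpG : ov.PacketG → EvpData L H
  /-- e.v.p. of the global packets of `H` -/
  evpH : ov.PacketH → EvpData L H
  /-- ramification of the global packets of `G` -/
  ramG : ov.PacketG → Finset (Places L)
  /-- ramification of the global packets of `H` -/
  ramH : ov.PacketH → Finset (Places L)
  /-- `ξ ↦ Π(ξ)` -/
  PiXi : OneDimAutRepH L → ov.PacketG
  /-- `ξ ↦ ρ(ξ)` -/
  ρXi : OneDimAutRepH L → ov.PacketH
  /-- the ONE finite level `S₀` of the frame (RULING (V44), R-28) -/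
  S₀ : Finset (Places L)
  /-- T1c–T1f for the overridden kit [Rogawski1990, Thm. 14.6.1 p. 241; §14.6 p. 242] -/
  specPkgT1 : (𝔨.override ov).SpecPkgT1
  /-- the witnessed package at level `S₀` for the kit of record [Rogawski1990, Thm. 14.6.1, Thm. 14.6.4, (14.6.2)–(14.6.3); Flath1979 Thm. 3] -/
  specPkg : F0P3InnerFormClassificationV8.ClassificationKit.SpecPkg
    (kitK9S L ι H T hT μ μω hμu ν νH νG νGi μZ c wXi jInf dsInf isHaar_ν isHaar_μZ hquad Δ mH mG hQ hK hLi 𝔨 ov gh evpG evpH ramG ramH PiXi ρXi) S₀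
  /-- PACKET ANCHORS, `G`-side (ED. 6, T1-RES ∕ R-31 pay-down, pin currency of ★ `F0P3HatLawsOfAnchoredPackets`): off `S₀ ∪ ram Π`, the packet e.v.p. `t(Π)_v` IS the eigencharacter of
  an admissible UNITARIZABLE `K_v`-SPHERICAL class of `G′_v` — print: the members of a global A-packet are unitary and unramified almost everywhere, with Satake parameter
  `t(Π)_v` [Rogawski1990, §13.7 p. 206; §12.2 (1)(2) pp. 173–174; §13.1 p. 199]; rows #6∕#7 (`HatBounded`∕`UnrStarAlgebra` at BOTH summands) FOLLOW in-house
  (★ `hatLaws_kitOfRecord_of_anchored`, B-p12 p829087∕p829345). -/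
  anchorG : ∀ (Q : ov.PacketG) (v : Places L), v ∉ S₀ → v ∉ ramG Q →
    letI : MeasurableSpace ((cmDatum L 3 H).Local v) := borel _
    ∃ π : IrrClass ((cmDatum L 3 H).Local v), π.IsAdmissible ∧ π.IsUnitarizable ∧
      π.IsSphericalWith (cmLocalIntegralLevel L 3 H v) (νG v) (evpG Q v)
  /-- PACKET ANCHORS, `H`-side (ED. 6): off `S₀ ∪ ram ρ`, the transported packet e.v.p. `t(ρ)_v` is the eigencharacter of an admissible unitarizable `K_v`-spherical class of
  `G′_v` [Rogawski1990, §13.7 p. 206; §13.1 Prop. 13.1.3 p. 199; §4.13 Lemma 4.13.1]. -/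
  anchorH : ∀ (ρ : ov.PacketH) (v : Places L), v ∉ S₀ → v ∉ ramH ρ →
    letI : MeasurableSpace ((cmDatum L 3 H).Local v) := borel _
    ∃ π : IrrClass ((cmDatum L 3 H).Local v), π.IsAdmissible ∧ π.IsUnitarizable ∧
      π.IsSphericalWith (cmLocalIntegralLevel L 3 H v) (νG v) (evpH ρ v)
  /-- e.v.p. convention on `Π(G)`: junk value `0` off `C_c(K_v\G′_v/K_v)` [Rogawski1990, §13.7 p. 206] -/
  hG : ∀ (Q : ov.PacketG) (v : Places L) (f : (cmDatum L 3 H).Local v → ℂ),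
    ¬ (HasCompactSupport f ∧ IsLevel (cmLocalIntegralLevel L 3 H v) f) → evpG Q v f = 0
  /-- e.v.p. convention on `Π(H)` [Rogawski1990, §13.7 p. 206] -/
  hH' : ∀ (ρ : ov.PacketH) (v : Places L) (f : (cmDatum L 3 H).Local v → ℂ),
    ¬ (HasCompactSupport f ∧ IsLevel (cmLocalIntegralLevel L 3 H v) f) → evpH ρ v f = 0

/-- SIGNED twin (Defs ED. 2 for closer ED. 26 «QCMT SIGNED»; desk F0P3-plan (g9) RULING D29; κ-sign `ε_v(H) = ω_w(−det H)`, LEAD RULING «K» K2, REF1 (g9) R-45∕R-46) of `Q_K9` above — its text VERBATIM under the token map τ {`CMCharIdentityPackageTest` ↦ `…Signed` (★ p842701), `hSCD_of_cmCharIdentityPackageTest` ↦ `…Signed` (★ p843355), `kitK9`∕`OverrideWitness`∕`Q_K9`∕`Rung0Witness`∕`StubRung0`∕`k9_of_stf` ↦ `…S`, `K9SpectralLetter` ↦ `K9SpectralLetterSigned`}; the unsigned original stays byte-identical (it serves the tree closer ED. 25 until ED. 26 is written and is thereafter the superseded negative edge «unsigned package in negative position — mis-typed as written»; pruning = a later Defs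 edition by desk ruling). **`Q_K9S … Δ mH mG` — THE RIDER of rung 0** (p04 (g7) plan §1; RULINGS (V29) `Q_CM`, (V42), (V45)(c)(d)(f), (V48) R2, (V50), (V51)(b); REF1 R-21 (iii), R-24, R-28, R-29, R-31):
for the global transfer data `(Δ_v, m_{H,v}, m_{G,v})_v` of the SAME witness as ★ `GlobalTransferWithStabilisationPackage`, (1) the CM character-identity package ★ `CMCharIdentityPackage`
[§13.1 Prop. 13.1.4; Lemma 4.13.1 (b)], AND (2) for every PINNED comparison kit `𝔨` WITH PARTNERS AND THE SIMPLE TRACE FORMULA (laws T1g `TransferExistence`, T1a `SimpleTraceFormula`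
— the antecedents the T1 export ★ `anchoredKit_nonempty_of_stubsQ` hands for its anchor; POLARITY (R-29): without T1g the kit `{𝔨₀ with Transfer := fun _ _ => False}` would be
pinned and empty `OverrideWitnessS` through `matchingS`∕`transferS` at the zero datum) carrying these transfer factors and `H`-side measures ON THE NOSE and `G`-side orbital
measures agreeing with `mG` on the REGULAR classes ((V48) R2: the export's `mG₀`), every proof of (1) and every proof of the letters Keys ∕ #79 (proof-irrelevant parameters of the
ξ-side of record), an `OverrideWitnessS` exists.  THE OVERRIDE `ov`, THE PACKET-SIDE DATA `gh` AND THE LEVEL `S₀` MAY DEPEND ON THE KIT `𝔨`: `gh` is built from `𝔨`'s own fibres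
(`TestSG S = TestSH S := TestS₀ S`, `tensG∕tensH` := the partners T1g chooses, `MatchesS S fS fSG fSH := fSG = fS ∧ fSH = fS`), so `matchingS`∕`transferS` hold by construction and
`factorisationPk`∕`aPacketSpectral`∕`localExpansion` at those partners are the printed statements [Rogawski1990 Prop. 13.2.2, Props. 14.4.1–14.4.2, §12.7, Thm. 14.6.1] because the
packet distributions are stable, hence independent of which transfer T1g picked.  Typed exactly as the T1 API's `{Q : …}` binder (Borel orbit quotients by `letI`).
[cite: Rogawski1990, §14.6 Thm. 14.6.1 p. 241; §13.1 Prop. 13.1.4 p. 199; §4.9 Prop. 4.9.1 p. 55] -/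
def Q_K9S :
    letI : ∀ (v : Places L) (a : HLocal L v), MeasurableSpace (HLocal L v ⧸ Subgroup.centralizer ({a} : Set (HLocal L v))) := fun _ _ => borel _
    letI : ∀ (v : Places L) (γ : (cmDatum L 3 H).Local v),
        MeasurableSpace ((cmDatum L 3 H).Local v ⧸ Subgroup.centralizer ({γ} : Set ((cmDatum L 3 H).Local v))) := fun _ _ => borel _
    (∀ v : Places L, Literature.NumberTheory.Rogawski1990.LocalTransferFactor L H v) →
    (∀ v : Places L, OrbitalMeasureFamily (HLocal L v)) →
    (∀ v : Places L, OrbitalMeasureFamily ((cmDatum L 3 H).Local v)) → Prop :=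
  fun Δ mH mG =>
    letI : MeasurableSpace (GpAdelic L H) := borel _
    haveI : BorelSpace (GpAdelic L H) := ⟨rfl⟩
    haveI : ν.IsHaarMeasure := isHaar_ν
    haveI : ν.IsInvInvariant := isInvInv_ν
    letI : ∀ v : Places L, MeasurableSpace (GpLocal L H v) := fun _ => borel _
    haveI : ∀ v : Places L, BorelSpace (GpLocal L H v) := fun _ => ⟨rfl⟩
    letI : ∀ v : Places L, MeasurableSpace (HLocal L v) := fun _ => borel _
    haveI : ∀ v : Places L, BorelSpace (HLocal L v) := fun _ => ⟨rfl⟩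
    letI : ∀ (v : Places L) (a : HLocal L v), MeasurableSpace (HLocal L v ⧸ Subgroup.centralizer ({a} : Set (HLocal L v))) := fun _ _ => borel _
    letI : ∀ (v : Places L) (γ : GpLocal L H v), MeasurableSpace (GpLocal L H v ⧸ Subgroup.centralizer ({γ} : Set (GpLocal L H v))) := fun _ _ => borel _
    letI : MeasurableSpace (GpInf L H) := borel _
    haveI : BorelSpace (GpInf L H) := ⟨rfl⟩
    letI : MeasurableSpace (GInf L) := borel _
    haveI : BorelSpace (GInf L) := ⟨rfl⟩
    letI : MeasurableSpace (HInf L) := borel _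
    haveI : BorelSpace (HInf L) := ⟨rfl⟩
    haveI : ∀ v : Places L, (νH v).IsHaarMeasure := isHaar_νH
    haveI : ∀ v : Places L, (νH v).IsMulRightInvariant := isRightInv_νH
    haveI : ∀ v : Places L, (νG v).IsHaarMeasure := isHaar_νG
    haveI : ∀ v : Places L, (νG v).IsMulRightInvariant := isRightInv_νG
    haveI : IsFiniteMeasureOnCompacts νGi := finCpt_νGi
    haveI : νGi.IsMulRightInvariant := rightInv_νGi
    haveI : IsFiniteMeasureOnCompacts νqi := finCpt_νqi
    haveI : νqi.IsMulRightInvariant := rightInv_νqi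
    haveI : IsFiniteMeasureOnCompacts νHi := finCpt_νHi
    haveI : νHi.IsMulRightInvariant := rightInv_νHi
    CMCharIdentityPackageTestSigned L H (transpose_map_cmConjRingHom_eq_of_frame L ι H T hT) (isUnit_det_of_frame L ι H T hT) νH νG μω hμu Δ mH mG ∧
    ∀ (𝔨 : ComparisonKit L H μ), 𝔨.IsPinned ν Tinf νH νG νGi νqi νHi → 𝔨.TransferExistence → 𝔨.SimpleTraceFormula → 𝔨.Δ = Δ → 𝔨.mH = mH →
      (∀ (v : Places L) (c' : ConjClasses ((cmDatum L 3 H).Local v)),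
        Literature.NumberTheory.Rogawski1990.IsRegularElt ((Quotient.out c').val : GL (Fin 3) (UnitaryGroup.LocalRing L v)) → 𝔨.mG v c' = mG v c') →
      ∀ (hQ : CMCharIdentityPackageTestSigned L H (transpose_map_cmConjRingHom_eq_of_frame L ι H T hT) (isUnit_det_of_frame L ι H T hT) νH νG μω hμu Δ mH mG)
        (hK : KeysCaseTwo L) (hLi : XiPinSphericalCofinite L),
        Nonempty (OverrideWitnessS L ι H T hT μ μω hμu ν νH νG νGi μZ c wXi jInf dsInf isHaar_ν isHaar_μZ hquad Δ mH mG hQ hK hLi 𝔨)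

end K9S

section Rung0S

variable (L : Type) [Field L] [NumberField L] [IsCMField L] (ι : L →+* ℂ) (H : Matrix (Fin 3) (Fin 3) L) (T : GL (Fin 3) ℂ)
  (hT : (T : Matrix (Fin 3) (Fin 3) ℂ)ᴴ * H.map ι * (T : Matrix (Fin 3) (Fin 3) ℂ) = Literature.Geometry.ComplexHyperbolic.BallModel.J)
  (μ : Measure (Gp L H).automorphicQuotient) [(Gp L H).IsAutomorphicMeasure μ] (μω : HeckeCharacter L) (hμu : μω.IsUnitary)
  (hμω : ∀ x : Literature.NumberTheory.GaloisRepresentations.ideleGroup ↥(maximalRealSubfield L), μω (AdeleRing.ideleBaseChange (↥(maximalRealSubfield L)) L x) = quadraticHeckeCharCM L x)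

/-- SIGNED twin (Defs ED. 2 for closer ED. 26 «QCMT SIGNED»; desk F0P3-plan (g9) RULING D29; κ-sign `ε_v(H) = ω_w(−det H)`, LEAD RULING «K» K2, REF1 (g9) R-45∕R-46) of `Rung0Witness` above — ED. 3 (closer ED. 38 «PK-ε»): + the field `wXi` (the per-ξ global root numbers, after `c`) and the fact `hw : ∀ ξ, wXi ξ = 1 ∨ wXi ξ = -1` (before `hc`) [Rogawski1992 Thm. 1.2; §6 p. 417], `hGTQ` reads `Q_K9S … c wXi …`; otherwise its text VERBATIM under the token map τ {`CMCharIdentityPackageTest` ↦ `…Signed` (★ p842701), `hSCD_of_cmCharIdentityPackageTest` ↦ `…Signed` (★ p843355), `kitK9`∕`OverrideWitness`∕`Q_K9`∕`Rung0Witness`∕`StubRung0`∕`k9_of_stf` ↦ `…S`, `K9SpectralLetter` ↦ `K9SpectralLetterSigned`}; the unsigned original stays byte-identical (it serves the tree closer ED. 25 until ED. 26 is written and is thereafter the superseded negative edge «unsigned package in negative position — mis-typed as written»; pruning = a later Defs edition by desk ruling). **`Rung0WitnessS L ι H T hT μ μω hμu` — THE ∃-BOUND CONTENT OF `stub_rung0`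 AT ONE FRAME** (RULING (V45)(c)(g); REF1 R-21 (iii), riders (r1)–(r4) 14:15:30Z).
DATA (each print-inhabited): the Haar measures `ν` (on `G′(𝔸)`), `νH_v`, `νG_v` (level-normalised), `νGi = νinf`, `νqi`, `νHi` (archimedean), `μZ_v` (on `U(Φ₃)_v` mod centre), the
archimedean transfer factor `Tinf`, the ONE global sign `c` (R-21), the posited archimedean classes `jInf dsInf` (R-22′).  FACTS (the booked clauses of K8 §13 row `stub_rung0`, nothing
else): the measure normalisations (Haar ∕ invariance ∕ finiteness ∕ `vol K_v = 1`) (ED. 6: the former field `hquad` — «`μω_v` extends `ω_{L_v/L⁺_v}`» [§12.2 p. 174] — is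
now the ★ lemma `isQuadraticCharExtension_semilocalComponent_of_baseChange_eq μω hμω` of the frame's `hμω`, p826316, no longer posited), T1's two antecedents ★ `ArchTransfersExistCanonical` [§14.2–14.3; Shelstad] and ★ `GlobalTransferWithStabilisationPackageAnd … (Q_K9S …)` [Prop. 4.9.1;
(4.3.1)–(4.3.3); §13.1] with the rider `Q_K9S`, the sign clause `c = 1 ∨ c = -1` [LanglandsShelstad1987 §1.3–1.4], the arch-packet clauses `JInfNoDegOne`∕`DsInfNoDegOne`
[§12.3 pp. 178–179] and their coh-unitarity [BorelWallach2000 VI 4.11], and PH `IsProductHaar ν νGi νG` [§4.3 p. 44; Tate XV §3.3] (R-26, `νGi := νinf`).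
NO kit law, NO `ClassificationKit` predicate, NO `SpecPkg`∕`SpecPkgT1` outside `Q_K9S`, NO Theses decl (r1). [cite: Rogawski1990, §4.9 Prop. 4.9.1 p. 55; §14.2 (14.2.1) pp. 232–233;
§14.6 Thm. 14.6.1 p. 241; §12.3 pp. 178–179; §13.1 p. 199] [cite: LanglandsShelstad1987, §1.3–1.4] [cite: BorelWallach2000, VI Thm. 4.11] -/
structure Rung0WitnessS : Type 2 where
  /-- Haar measure on `G′(𝔸_{L⁺})` (two-sided, inversion invariant) -/
  ν : @Measure (GpAdelic L H) (borel _)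
  /-- Haar measures on `H(L⁺_v)`, `vol K_{H,v} = 1` -/
  νH : ∀ v : Places L, @Measure (HLocal L v) (borel _)
  /-- Haar measures on `G′(L⁺_v)`, `vol K_v = 1` (= the kit's `μv`) -/
  νG : ∀ v : Places L, @Measure (GpLocal L H v) (borel _)
  /-- Haar measure on `G′_∞` (= PH's `νinf`) -/
  νGi : @Measure (GpInf L H) (borel _)
  /-- Haar measure on `G_∞` -/
  νqi : @Measure (GInf L) (borel _)
  /-- Haar measure on `H_∞` -/
  νHi : @Measure (HInf L) (borel _)
  /-- Haar measures on `U(Φ₃)(L⁺_v)` modulo the centre (square-integrability currency of the Keys labels) -/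
  μZ : ∀ v : Places L, @Measure (Gqs L v ⧸ Subgroup.center (Gqs L v)) (borel _)
  /-- the archimedean transfer factor `Δ_∞` -/
  Tinf : Literature.NumberTheory.Rogawski1990.ArchTransferFactor L H
  /-- the ONE global transfer-factor sign (R-21) -/
  c : ℚ
  /-- the per-ξ global ROOT NUMBERS `wXi ξ = W(φ_ξ) = ε(½, φ_ξ) ∈ {±1}`, φ_ξ := μω·(χ₁ξ)_L (ED. 3, closer ED. 38 «PK-ε») [Rogawski1992, Thm. 1.2 p. 397; §6 p. 417] -/
  wXi : OneDimAutRepH L → ℤ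
  /-- the posited archimedean classes `J^±_φ` (R-22′) -/
  jInf : ℤ → ℤ → ℤ → Cinf
  /-- the posited archimedean classes `D^∓_φ ∕ π²_φ` (R-22′) -/
  dsInf : ℤ → ℤ → ℤ → Cinf
  /-- `ν` is a Haar measure -/
  isHaar_ν : letI : MeasurableSpace (GpAdelic L H) := borel _; ν.IsHaarMeasure
  /-- `ν` is inversion invariant -/
  isInvInv_ν : letI : MeasurableSpace (GpAdelic L H) := borel _; ν.IsInvInvariant
  /-- `νH_v` Haar -/
  isHaar_νH : ∀ v : Places L, letI : MeasurableSpace (HLocal L v) := borel _; (νH v).IsHaarMeasure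
  /-- `νH_v` right invariant -/
  isRightInv_νH : ∀ v : Places L, letI : MeasurableSpace (HLocal L v) := borel _; (νH v).IsMulRightInvariant
  /-- `νG_v` Haar -/
  isHaar_νG : ∀ v : Places L, letI : MeasurableSpace (GpLocal L H v) := borel _; (νG v).IsHaarMeasure
  /-- `νG_v` right invariant -/
  isRightInv_νG : ∀ v : Places L, letI : MeasurableSpace (GpLocal L H v) := borel _; (νG v).IsMulRightInvariant
  /-- `vol_{νG_v} K_v = 1` [Rogawski1990, §4.3 p. 44] -/
  hK : ∀ v : Places L, νG v (cmLocalIntegralLevel L 3 H v : Set (GpLocal L H v)) = 1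
  /-- `vol_{νH_v} K_{H,v} = 1` -/
  hKH : ∀ v : Places L,
    νH v (((cmLocalIntegralLevel L 2 (Matrix.of fun i j : Fin 2 => if i.val + j.val + 1 = 2 then (1 : L) else 0) v).prod
        (cmLocalIntegralLevel L 1 (Matrix.of fun i j : Fin 1 => if i.val + j.val + 1 = 1 then (1 : L) else 0) v) :
          Subgroup (HLocal L v)) : Set (HLocal L v)) = 1
  /-- `νGi` finite on compacta -/
  finCpt_νGi : letI : MeasurableSpace (GpInf L H) := borel _; IsFiniteMeasureOnCompacts νGi
  /-- `νGi` right invariant -/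
  rightInv_νGi : letI : MeasurableSpace (GpInf L H) := borel _; νGi.IsMulRightInvariant
  /-- `νqi` finite on compacta -/
  finCpt_νqi : letI : MeasurableSpace (GInf L) := borel _; IsFiniteMeasureOnCompacts νqi
  /-- `νqi` right invariant -/
  rightInv_νqi : letI : MeasurableSpace (GInf L) := borel _; νqi.IsMulRightInvariant
  /-- `νHi` finite on compacta -/
  finCpt_νHi : letI : MeasurableSpace (HInf L) := borel _; IsFiniteMeasureOnCompacts νHi
  /-- `νHi` right invariant -/
  rightInv_νHi : letI : MeasurableSpace (HInf L) := borel _; νHi.IsMulRightInvariant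
  /-- `μZ_v` Haar -/
  isHaar_μZ : ∀ v : Places L, letI : MeasurableSpace (Gqs L v ⧸ Subgroup.center (Gqs L v)) := borel _; (μZ v).IsHaarMeasure
  /-- T1 antecedent #77 (ED. 2 name, RULING (V48) R1): BOTH archimedean transfers exist for Weil-form, transport-compatible families, canonical measures, AND the singular-class
  behaviour of §14.5 [Rogawski1990, §14.2–14.3 pp. 232–234; Lemma 14.5.2 (c) p. 238; §8.4] (★ `ArchTransfersExistCanonicalSingular`; `.canonical` projects to the ED. 3 fact) -/
  hAT₄ : letI : MeasurableSpace (GpInf L H) := borel _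
    haveI : BorelSpace (GpInf L H) := ⟨rfl⟩
    letI : MeasurableSpace (GInf L) := borel _
    haveI : BorelSpace (GInf L) := ⟨rfl⟩
    letI : MeasurableSpace (HInf L) := borel _
    haveI : BorelSpace (HInf L) := ⟨rfl⟩
    haveI : IsFiniteMeasureOnCompacts νGi := finCpt_νGi
    haveI : νGi.IsMulRightInvariant := rightInv_νGi
    haveI : IsFiniteMeasureOnCompacts νqi := finCpt_νqi
    haveI : νqi.IsMulRightInvariant := rightInv_νqi
    haveI : IsFiniteMeasureOnCompacts νHi := finCpt_νHi
    haveI : νHi.IsMulRightInvariant := rightInv_νHi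
    ArchTransfersExistCanonicalSingular L H Tinf νGi νqi νHi
  /-- T1 antecedent K7-s (RULING (V48) R1): the SINGULAR ELLIPTIC TRANSFER PACKAGE of §14.5 for the frame's measures [Rogawski1990, §14.5 Lemma 14.5.2 (b) pp. 238–239; §8.2
  Prop. 8.2.1; §8.3 Prop. 8.3.1; Kottwitz1986 §9] (★ `SingularEllipticTransferCanonical`; typed under EXACTLY the instance preamble of the T1 API's `hSET` binder) — ED. 4 «#175 PINNED»:
  AT PRINT՚S finite factors `Δ := Δ‴(μω) = finExplicitCollection L H μω …` [Rogawski1990, §4.9 p. 55] and the record՚s own `Tinf` (★ `SingularEllipticTransferCanonicalAtDelta`: #88՚s text with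
  its `Δ`-binder hoisted; `Δ` is NO LONGER universally bound — K2E4-r01 O7 verdict 9d20d85d782e07ce on letter #175) -/
  hSET : letI : MeasurableSpace (GpAdelic L H) := borel _
    haveI : BorelSpace (GpAdelic L H) := ⟨rfl⟩
    haveI : ν.IsHaarMeasure := isHaar_ν
    haveI : ν.IsInvInvariant := isInvInv_ν
    letI : ∀ v : Places L, MeasurableSpace (HLocal L v) := fun _ => borel _
    haveI : ∀ v : Places L, BorelSpace (HLocal L v) := fun _ => ⟨rfl⟩
    letI : ∀ v : Places L, MeasurableSpace (GpLocal L H v) := fun _ => borel _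
    haveI : ∀ v : Places L, BorelSpace (GpLocal L H v) := fun _ => ⟨rfl⟩
    letI : MeasurableSpace (GpInf L H) := borel _
    haveI : BorelSpace (GpInf L H) := ⟨rfl⟩
    letI : MeasurableSpace (GInf L) := borel _
    haveI : BorelSpace (GInf L) := ⟨rfl⟩
    letI : MeasurableSpace (HInf L) := borel _
    haveI : BorelSpace (HInf L) := ⟨rfl⟩
    haveI : ∀ v : Places L, IsFiniteMeasureOnCompacts (νH v) := fun v => (isHaar_νH v).toIsFiniteMeasureOnCompacts
    haveI : ∀ v : Places L, (νH v).IsMulRightInvariant := isRightInv_νH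
    haveI : ∀ v : Places L, (νG v).IsHaarMeasure := isHaar_νG
    haveI : ∀ v : Places L, (νG v).IsMulRightInvariant := isRightInv_νG
    haveI : IsFiniteMeasureOnCompacts νGi := finCpt_νGi
    haveI : νGi.IsMulRightInvariant := rightInv_νGi
    haveI : IsFiniteMeasureOnCompacts νqi := finCpt_νqi
    haveI : νqi.IsMulRightInvariant := rightInv_νqi
    haveI : IsFiniteMeasureOnCompacts νHi := finCpt_νHi
    haveI : νHi.IsMulRightInvariant := rightInv_νHi
    letI : ∀ (v : Places L) (γ : (UnitaryGroup.cmDatum L 3 H).Local v),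
      MeasurableSpace ((UnitaryGroup.cmDatum L 3 H).Local v ⧸
        Subgroup.centralizer ({γ} : Set ((UnitaryGroup.cmDatum L 3 H).Local v))) := fun _ _ => borel _
    haveI : ∀ (v : Places L) (γ : (UnitaryGroup.cmDatum L 3 H).Local v),
      BorelSpace ((UnitaryGroup.cmDatum L 3 H).Local v ⧸
        Subgroup.centralizer ({γ} : Set ((UnitaryGroup.cmDatum L 3 H).Local v))) := fun _ _ => ⟨rfl⟩
    letI : ∀ g : GpAdelic L H, MeasurableSpace (GpAdelic L H ⧸ Subgroup.centralizer ({g} : Set (GpAdelic L H))) := fun _ => borel _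
    haveI : ∀ g : GpAdelic L H, BorelSpace (GpAdelic L H ⧸ Subgroup.centralizer ({g} : Set (GpAdelic L H))) := fun _ => ⟨rfl⟩
    letI : ∀ γ : GpInf L H, MeasurableSpace (GpInf L H ⧸ Subgroup.centralizer ({γ} : Set (GpInf L H))) := fun _ => borel _
    haveI : ∀ γ : GpInf L H, BorelSpace (GpInf L H ⧸ Subgroup.centralizer ({γ} : Set (GpInf L H))) := fun _ => ⟨rfl⟩
    letI : ∀ γ : GInf L, MeasurableSpace (GInf L ⧸ Subgroup.centralizer ({γ} : Set (GInf L))) := fun _ => borel _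
    haveI : ∀ γ : GInf L, BorelSpace (GInf L ⧸ Subgroup.centralizer ({γ} : Set (GInf L))) := fun _ => ⟨rfl⟩
    letI : ∀ (v : Places L) (a : HLocal L v),
      MeasurableSpace (HLocal L v ⧸ Subgroup.centralizer ({a} : Set (HLocal L v))) := fun _ _ => borel _
    haveI : ∀ (v : Places L) (a : HLocal L v),
      BorelSpace (HLocal L v ⧸ Subgroup.centralizer ({a} : Set (HLocal L v))) := fun _ _ => ⟨rfl⟩
    letI : ∀ a : HInf L, MeasurableSpace (HInf L ⧸ Subgroup.centralizer ({a} : Set (HInf L))) := fun _ => borel _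
    haveI : ∀ a : HInf L, BorelSpace (HInf L ⧸ Subgroup.centralizer ({a} : Set (HInf L))) := fun _ => ⟨rfl⟩
    letI : ∀ γ : GpAdelic L H, MeasurableSpace (↥(Subgroup.centralizer ({γ} : Set (GpAdelic L H))) ⧸
      ((UnitaryGroup.cmDatum L 3 H).quotientSubgroup ⊓ Subgroup.centralizer ({γ} : Set (GpAdelic L H))).subgroupOf
        (Subgroup.centralizer ({γ} : Set (GpAdelic L H)))) := fun _ => borel _
    haveI : ∀ γ : GpAdelic L H, BorelSpace (↥(Subgroup.centralizer ({γ} : Set (GpAdelic L H))) ⧸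
      ((UnitaryGroup.cmDatum L 3 H).quotientSubgroup ⊓ Subgroup.centralizer ({γ} : Set (GpAdelic L H))).subgroupOf
        (Subgroup.centralizer ({γ} : Set (GpAdelic L H)))) := fun _ => ⟨rfl⟩
    haveI hCcl : ∀ γ : GpAdelic L H, IsClosed ((Subgroup.centralizer ({γ} : Set (GpAdelic L H)) : Subgroup (GpAdelic L H)) : Set (GpAdelic L H)) :=
      fun γ => UnitaryGroup.isClosed_centralizer_cmDatum L 3 H γ
    haveI : ∀ γ : GpAdelic L H, (Measure.count : Measure ↥(((UnitaryGroup.cmDatum L 3 H).quotientSubgroup ⊓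
      Subgroup.centralizer ({γ} : Set (GpAdelic L H))).subgroupOf (Subgroup.centralizer ({γ} : Set (GpAdelic L H))))).IsHaarMeasure :=
      fun γ => UnitaryGroup.isHaarMeasure_count_quotientSubgroup_inf_centralizer_subgroupOf L 3 H γ
    haveI : ν.IsMulRightInvariant := by
      have h : ν.inv.IsMulRightInvariant := inferInstance
      rwa [Measure.inv_eq_self] at h
    Literature.NumberTheory.Rogawski1990.SingularEllipticTransferCanonicalAtDelta L H Tinf
      (Literature.NumberTheory.Rogawski1990.finExplicitCollection L H μω (Literature.NumberTheory.Rogawski1990.finExplicitDelta_conj_left_all L H μω)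
        (Literature.NumberTheory.Rogawski1990.finExplicitDelta_conj_right_all L H μω)) νH νG νGi νqi νHi ν
  /-- T1 antecedent with the rung-0 rider: the global transfer ∕ stabilisation package AND `Q_K9S` on the same witness [Rogawski1990, Prop. 4.9.1 p. 55; §13.1 p. 199] -/
  hGTQ : letI : ∀ v : Places L, MeasurableSpace (GpLocal L H v) := fun _ => borel _
    haveI : ∀ v : Places L, BorelSpace (GpLocal L H v) := fun _ => ⟨rfl⟩
    letI : ∀ v : Places L, MeasurableSpace (HLocal L v) := fun _ => borel _
    haveI : ∀ v : Places L, BorelSpace (HLocal L v) := fun _ => ⟨rfl⟩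
    haveI : ∀ v : Places L, (νH v).IsHaarMeasure := isHaar_νH
    haveI : ∀ v : Places L, (νH v).IsMulRightInvariant := isRightInv_νH
    haveI : ∀ v : Places L, (νG v).IsHaarMeasure := isHaar_νG
    haveI : ∀ v : Places L, (νG v).IsMulRightInvariant := isRightInv_νG
    GlobalTransferWithStabilisationPackageAnd L H Tinf.Δ νH νG
      (Q_K9S L ι H T hT μ μω hμu ν νH νG νGi νqi νHi μZ Tinf c wXi jInf dsInf isHaar_ν isInvInv_ν isHaar_νH isRightInv_νH isHaar_νG isRightInv_νG
        finCpt_νGi rightInv_νGi finCpt_νqi rightInv_νqi finCpt_νHi rightInv_νHi isHaar_μZ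
        (fun v _ => isQuadraticCharExtension_semilocalComponent_of_baseChange_eq μω hμω v))
  /-- the root numbers are signs (weak multiplicity formula: «there exists a sign η» — ED. 3) [Rogawski1992, §6 p. 417; Thm. 1.2 p. 397] -/
  hw : ∀ ξ, wXi ξ = 1 ∨ wXi ξ = -1
  /-- the global transfer-factor sign is `±1` (R-21) [LanglandsShelstad1987, §1.3–1.4] -/
  hc : c = 1 ∨ c = -1
  /-- no degree-one class among the `J^±_φ` [Rogawski1990, §12.3 pp. 178–179] -/
  hJ : JInfNoDegOne jInf
  /-- no degree-one class among the `D^∓_φ ∕ π²_φ` -/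
  hD : DsInfNoDegOne dsInf
  /-- the `J^±_φ` are coh-unitary classes [BorelWallach2000, VI Thm. 4.11] -/
  hJU : ∀ p q t, IsCohUnitaryClass (jInf p q t)
  /-- the `D^∓_φ ∕ π²_φ` are coh-unitary classes -/
  hDU : ∀ p q t, IsCohUnitaryClass (dsInf p q t)
  /-- PH: `ν = νGi ⊗ ⊗′_v νG_v` [Rogawski1990, §4.3 p. 44; §5.4 p. 72] (R-26) -/
  hPH : letI : MeasurableSpace (Gp L H).Adelic := borel _; IsProductHaar L H ν νGi νG

/-- SIGNED twin (Defs ED. 2 for closer ED. 26 «QCMT SIGNED»; desk F0P3-plan (g9) RULING D29; κ-sign `ε_v(H) = ω_w(−det H)`, LEAD RULING «K» K2, REF1 (g9) R-45∕R-46) of `StubRung0` above — its text VERBATIM under the token map τ {`CMCharIdentityPackageTest` ↦ `…Signed` (★ p842701), `hSCD_of_cmCharIdentityPackageTest` ↦ `…Signed` (★ p843355), `kitK9`∕`OverrideWitness`∕`Q_K9`∕`Rung0Witness`∕`StubRung0`∕`k9_of_stf` ↦ `…S`, `K9SpectralLetter` ↦ `K9SpectralLetterSigned`}; the unsigned original stays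 byte-identical (it serves the tree closer ED. 25 until ED. 26 is written and is thereafter the superseded negative edge «unsigned package in negative position — mis-typed as written»; pruning = a later Defs edition by desk ruling). **Stub statement `stub_rung0`**: at every letters' frame (`H` definite off `ι`, `[L⁺:ℚ] ≥ 2`, `μω` unitary extending `ω_{L/L⁺}`), a `Rung0WitnessS` exists. -/
def StubRung0S : Prop :=
  ∀ (L : Type) [Field L] [NumberField L] [IsCMField L] (ι : L →+* ℂ) (H : Matrix (Fin 3) (Fin 3) L) (T : GL (Fin 3) ℂ)
    (hT : (T : Matrix (Fin 3) (Fin 3) ℂ)ᴴ * H.map ι * (T : Matrix (Fin 3) (Fin 3) ℂ) = Literature.Geometry.ComplexHyperbolic.BallModel.J),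
    (∀ τ' : L →+* ℂ, InfinitePlace.mk τ' ≠ InfinitePlace.mk ι → (H.map τ').PosDef) →
    2 ≤ Module.finrank ℚ ↥(maximalRealSubfield L) →
    ∀ (μ : Measure (Gp L H).automorphicQuotient) [(Gp L H).IsAutomorphicMeasure μ] (μω : HeckeCharacter L) (hμu : μω.IsUnitary)
      (hμω : ∀ x : Literature.NumberTheory.GaloisRepresentations.ideleGroup ↥(maximalRealSubfield L),
        μω (AdeleRing.ideleBaseChange (↥(maximalRealSubfield L)) L x) = quadraticHeckeCharCM L x),
      Nonempty (Rung0WitnessS L ι H T hT μ μω hμu hμω)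

/-- SIGNED twin (Defs ED. 2 for closer ED. 26 «QCMT SIGNED»; desk F0P3-plan (g9) RULING D29; κ-sign `ε_v(H) = ω_w(−det H)`, LEAD RULING «K» K2, REF1 (g9) R-45∕R-46) of `K9SpectralLetter` above — ED. 3 (closer ED. 38 «PK-ε», desk D53-pre; objection of record ref1-OBJ-3): + the parameter `(wXi : OneDimAutRepH L → ℤ)` right after `(c : ℚ)` (the per-ξ global root numbers `ε(½, φ_ξ)`, ∃-delivered by the letter with the law `wXi ξ = ±1`), (P3′)-G at ★2 `GTraceProductFormW … μω wXi …` («`Tr Π(ξ)_S(f) = ε(½, φ_ξ)·[cpt]·(−1)^N·…`» [Rogawski1992 Thm. 1.2]), (P1)(P2)(P3′)-H(T)(P4)(P5) byte-identical; otherwise its text VERBATIM under the token map τ {`CMCharIdentityPackageTest` ↦ `…Signed` (★ p842701), `hSCD_of_cmCharIdentityPackageTest` ↦ `…Signed` (★ p843355), `kitK9`∕`OverrideWitness`∕`Q_K9`∕`Rung0Witness`∕`StubRung0`∕`k9_of_stf` ↦ `…S`, `K9SpectralLetter` ↦ `K9SpectralLetterSigned`}; the unsigned original stays byte-identical (it serves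 the tree closer ED. 25 until ED. 26 is written and is thereafter the superseded negative edge «unsigned package in negative position — mis-typed as written»; pruning = a later Defs edition by desk ruling). **`K9SpectralLetterSigned` — THE BODY OF LETTER K9-STF AS A NAMED `Prop`** (char-cap packaging, LEAD F0P3a-plan (g9) T8-19 (B): the registered one-line signature of
`stub_K9STFS` must stay under the 12 000-char statement cap; `stub_K9STFS` δ-unfolds to ED. 17՚s letter ∘ the ED. 19b (w-b) token map (`hQ : CMCharIdentityPackageTestSigned`; ξ-side of record `xiSideOfRecordSCD … (hSCD_of_cmCharIdentityPackageTestSigned … hQ) …`, whose supercuspidal member IS the package՚s `πs` — ★ `hSCD_of_cmCharIdentityPackageTestSigned_fst`)): for the frame, the pinned measures and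
the ∃-delivered `(c, jInf, dsInf)`, the text «∀ canonical `(mH, mG)`, ∀ pinned kit `𝔨` with transfer + STF at print՚s `Δ‴`, ∀ `(hQ, hK, hLi)`, ∀ proof-irrelevant `(hg, hsm)`,
∃ Rogawski spectral tuple `(PG, PH, nG, nH, trG, trH, evpG, evpH, ramG, ramH, PiXi, ρXi, trGS, trHS, S₀)` with (T) (P1) (P2) (P3′) (P4) (P5)» — clauses and citations as in
the docstring of `stub_K9STFS` below. -/
def K9SpectralLetterSigned
  (L : Type) [Field L] [NumberField L] [IsCMField L] (ι : L →+* ℂ) (H : Matrix (Fin 3) (Fin 3) L) (T : GL (Fin 3) ℂ)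
  (hT : (T : Matrix (Fin 3) (Fin 3) ℂ)ᴴ * H.map ι * (T : Matrix (Fin 3) (Fin 3) ℂ) = Literature.Geometry.ComplexHyperbolic.BallModel.J)
  (μ : Measure (Gp L H).automorphicQuotient) [(Gp L H).IsAutomorphicMeasure μ] (μω : HeckeCharacter L) (hμu : μω.IsUnitary)
  (ν : @Measure (GpAdelic L H) (borel _))
  (νH : ∀ v : Places L, @Measure (HLocal L v) (borel _)) (νG : ∀ v : Places L, @Measure (GpLocal L H v) (borel _))
  (νGi : @Measure (GpInf L H) (borel _)) (νqi : @Measure (GInf L) (borel _)) (νHi : @Measure (HInf L) (borel _))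
  (μZ : ∀ v : Places L, @Measure (Gqs L v ⧸ Subgroup.center (Gqs L v)) (borel _))
  (isHaar_ν : letI : MeasurableSpace (GpAdelic L H) := borel _; ν.IsHaarMeasure)
  (isInvInv_ν : letI : MeasurableSpace (GpAdelic L H) := borel _; ν.IsInvInvariant)
  (isHaar_νH : ∀ v : Places L, letI : MeasurableSpace (HLocal L v) := borel _; (νH v).IsHaarMeasure)
  (isRightInv_νH : ∀ v : Places L, letI : MeasurableSpace (HLocal L v) := borel _; (νH v).IsMulRightInvariant)
  (isHaar_νG : ∀ v : Places L, letI : MeasurableSpace (GpLocal L H v) := borel _; (νG v).IsHaarMeasure)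
  (isRightInv_νG : ∀ v : Places L, letI : MeasurableSpace (GpLocal L H v) := borel _; (νG v).IsMulRightInvariant)
  (finCpt_νGi : letI : MeasurableSpace (GpInf L H) := borel _; IsFiniteMeasureOnCompacts νGi)
  (rightInv_νGi : letI : MeasurableSpace (GpInf L H) := borel _; νGi.IsMulRightInvariant)
  (finCpt_νqi : letI : MeasurableSpace (GInf L) := borel _; IsFiniteMeasureOnCompacts νqi)
  (rightInv_νqi : letI : MeasurableSpace (GInf L) := borel _; νqi.IsMulRightInvariant)
  (finCpt_νHi : letI : MeasurableSpace (HInf L) := borel _; IsFiniteMeasureOnCompacts νHi)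
  (rightInv_νHi : letI : MeasurableSpace (HInf L) := borel _; νHi.IsMulRightInvariant)
  (isHaar_μZ : ∀ v : Places L, letI : MeasurableSpace (Gqs L v ⧸ Subgroup.center (Gqs L v)) := borel _; (μZ v).IsHaarMeasure)
  (hquad : ∀ v : Places L, (∀ w : PlacesOver L v, IsCMField.complexConj L • w.1 = w.1) →
    IsQuadraticCharExtension (conjLocal L (IsCMField.complexConj L) v) (μω.semilocalComponent L v)) (c : ℚ) (wXi : OneDimAutRepH L → ℤ) (jInf dsInf : ℤ → ℤ → ℤ → Cinf) : Prop :=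
    letI : ∀ (v : Places L) (a : HLocal L v), MeasurableSpace (HLocal L v ⧸ Subgroup.centralizer ({a} : Set (HLocal L v))) := fun _ _ => borel _
    letI : ∀ (v : Places L) (γ : (cmDatum L 3 H).Local v),
        MeasurableSpace ((cmDatum L 3 H).Local v ⧸ Subgroup.centralizer ({γ} : Set ((cmDatum L 3 H).Local v))) := fun _ _ => borel _
    haveI : ∀ (v : Places L) (a : HLocal L v), BorelSpace (HLocal L v ⧸ Subgroup.centralizer ({a} : Set (HLocal L v))) := fun _ _ => ⟨rfl⟩
    haveI : ∀ (v : Places L) (γ : (cmDatum L 3 H).Local v),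
        BorelSpace ((cmDatum L 3 H).Local v ⧸ Subgroup.centralizer ({γ} : Set ((cmDatum L 3 H).Local v))) := fun _ _ => ⟨rfl⟩
    ∀ (mH : ∀ v : Places L, OrbitalMeasureFamily (HLocal L v)) (mG : ∀ v : Places L, OrbitalMeasureFamily ((cmDatum L 3 H).Local v)),
      letI : MeasurableSpace (GpAdelic L H) := borel _
      haveI : BorelSpace (GpAdelic L H) := ⟨rfl⟩
      haveI : ν.IsHaarMeasure := isHaar_ν
      haveI : ν.IsInvInvariant := isInvInv_ν
      letI : ∀ v : Places L, MeasurableSpace (GpLocal L H v) := fun _ => borel _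
      haveI : ∀ v : Places L, BorelSpace (GpLocal L H v) := fun _ => ⟨rfl⟩
      letI : ∀ v : Places L, MeasurableSpace (HLocal L v) := fun _ => borel _
      haveI : ∀ v : Places L, BorelSpace (HLocal L v) := fun _ => ⟨rfl⟩
      letI : ∀ (v : Places L) (a : HLocal L v), MeasurableSpace (HLocal L v ⧸ Subgroup.centralizer ({a} : Set (HLocal L v))) := fun _ _ => borel _
      letI : ∀ (v : Places L) (γ : GpLocal L H v), MeasurableSpace (GpLocal L H v ⧸ Subgroup.centralizer ({γ} : Set (GpLocal L H v))) := fun _ _ => borel _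
      letI : MeasurableSpace (GpInf L H) := borel _
      haveI : BorelSpace (GpInf L H) := ⟨rfl⟩
      letI : MeasurableSpace (GInf L) := borel _
      haveI : BorelSpace (GInf L) := ⟨rfl⟩
      letI : MeasurableSpace (HInf L) := borel _
      haveI : BorelSpace (HInf L) := ⟨rfl⟩
      haveI : ∀ v : Places L, (νH v).IsHaarMeasure := isHaar_νH
      haveI : ∀ v : Places L, (νH v).IsMulRightInvariant := isRightInv_νH
      haveI : ∀ v : Places L, (νG v).IsHaarMeasure := isHaar_νG
      haveI : ∀ v : Places L, (νG v).IsMulRightInvariant := isRightInv_νG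
      haveI : IsFiniteMeasureOnCompacts νGi := finCpt_νGi
      haveI : νGi.IsMulRightInvariant := rightInv_νGi
      haveI : IsFiniteMeasureOnCompacts νqi := finCpt_νqi
      haveI : νqi.IsMulRightInvariant := rightInv_νqi
      haveI : IsFiniteMeasureOnCompacts νHi := finCpt_νHi
      haveI : νHi.IsMulRightInvariant := rightInv_νHi
      (∀ v : Places L, (mH v).IsCanonical (IsLocalGRegular L v) (νH v) ∧
          (mG v).IsCanonical (fun γ => IsRegularElt (γ.val : GL (Fin 3) (UnitaryGroup.LocalRing L v))) (νG v)) →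
      ∀ (𝔨 : ComparisonKit L H μ), 𝔨.IsPinned ν (archCanonicalTransferFactor L H μω) νH νG νGi νqi νHi → 𝔨.TransferExistence → 𝔨.SimpleTraceFormula → 𝔨.Δ = (finExplicitCollection L H μω (finExplicitDelta_conj_left_all L H μω) (finExplicitDelta_conj_right_all L H μω)) → 𝔨.mH = mH →
        (∀ (v : Places L) (c' : ConjClasses ((cmDatum L 3 H).Local v)),
          Literature.NumberTheory.Rogawski1990.IsRegularElt ((Quotient.out c').val : GL (Fin 3) (UnitaryGroup.LocalRing L v)) → 𝔨.mG v c' = mG v c') →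
        ∀ (hQ : CMCharIdentityPackageTestSigned L H (transpose_map_cmConjRingHom_eq_of_frame L ι H T hT) (isUnit_det_of_frame L ι H T hT) νH νG μω hμu (finExplicitCollection L H μω (finExplicitDelta_conj_left_all L H μω) (finExplicitDelta_conj_right_all L H μω)) mH mG)
          (hK : KeysCaseTwo L) (hLi : XiPinSphericalCofinite L),
          -- ===================== K9-STF BODY (replaces `Nonempty (OverrideWitnessS …)`) =====================
          -- n275-1: `hg`∕`hsm` are ∀ over PROOFS of facts the prefix already yields (`hg := htE`, `hsm :=` pin (iv) `smooth_iff` + ★ `tens₀_smooth`); proof-irrelevant — they neither weaken nor strengthen the letter; needed only as the arguments of ★ `ghOfFibres`.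
          ∀ (hg : ∀ f' : F0P3InnerFormClassificationV6.TestGp L H, 𝔨.Smooth f' → ∃ (f : F0P3InnerFormClassificationV6.TestG L) (fH : F0P3InnerFormClassificationV6.TestH L), 𝔨.Matches f' f fH)
            (hsm : ∀ (S : Finset (Places L)) (fS : F0P3SemilocalTestFunctionsOfRecord.TestS₀ L H ι T hT S) (fT : F0P3TestFunctionsOfRecord.Unr₀ L H S),
              𝔨.Smooth (F0P3SemilocalTestFunctionsOfRecord.tens₀ S fS fT)),
          letI : MeasurableSpace (Gp L H).Adelic := borel _
          haveI : BorelSpace (Gp L H).Adelic := ⟨rfl⟩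
          haveI : IsFiniteMeasureOnCompacts (show Measure (Gp L H).Adelic from ν) :=
            (show @Measure.IsHaarMeasure (Gp L H).Adelic _ _ (borel _) ν from isHaar_ν).toIsFiniteMeasureOnCompacts
          letI : ∀ v : Places L, MeasurableSpace (Gqs L v ⧸ Subgroup.center (Gqs L v)) := fun _ => borel _
          haveI : ∀ v : Places L, BorelSpace (Gqs L v ⧸ Subgroup.center (Gqs L v)) := fun _ => ⟨rfl⟩
          haveI : ∀ v : Places L, (μZ v).IsHaarMeasure := isHaar_μZ
          ∃ (PG PH : Type) (nG : PG → ℂ) (nH : PH → ℂ) (trG : PG → F0P3InnerFormClassificationV6.TestG L → ℂ) (trH : PH → F0P3InnerFormClassificationV6.TestH L → ℂ)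
            (evpG : PG → EvpData L H) (evpH : PH → EvpData L H) (ramG : PG → Finset (Places L)) (ramH : PH → Finset (Places L))
            (PiXi : OneDimAutRepH L → PG) (ρXi : OneDimAutRepH L → PH)
            (trGS : ∀ S : Finset (Places L), PG → F0P3SemilocalTestFunctionsOfRecord.TestS₀ L H ι T hT S → ℂ)
            (trHS : ∀ S : Finset (Places L), PH → F0P3SemilocalTestFunctionsOfRecord.TestS₀ L H ι T hT S → ℂ) (S₀ : Finset (Places L)),
            -- (T) the stable trace formula, T1d-shape, absolutely convergent
            (∀ (f' : F0P3InnerFormClassificationV6.TestGp L H) (f : F0P3InnerFormClassificationV6.TestG L) (fH : F0P3InnerFormClassificationV6.TestH L),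
                𝔨.Smooth f' → 𝔨.Matches f' f fH →
                Summable (fun Q : PG => nG Q * trG Q f) ∧ Summable (fun ρ : PH => nH ρ * trH ρ fH) ∧
                𝔨.SJGtot f + (1 / 2 : ℂ) * 𝔨.SJHtot fH = (∑' Q : PG, nG Q * trG Q f) + (1 / 2 : ℂ) * ∑' ρ : PH, nH ρ * trH ρ fH) ∧
            -- (P1) unramified factorisation of packet traces AT THE T1g-CHOSEN PARTNER (an arbitrary global transfer of the record tensor): print-true because the packet
            -- distributions are STABLE, hence constant on the transfer fibre and equal to their value at a pure-tensor transfer, where Flath applies (ref1 r276-1)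
            -- [FlathCorvallis1979 Thm. 3; CartierCorvallis1979 §IV; Rogawski1990 §13.2 (stability of packets), §13.1 13.1.3 (b), §12.3 12.3.3, §13.7; (14.2.1) p. 232]
            F0P3InnerFormClassificationV8.ClassificationKit.FactorisationPk
              (kitOfRecord L H ι T hT μ (⟨𝔨.traceGp, 𝔨.Smooth, PG, PH, nG, nH, trG, trH, 𝔨.Matches⟩ : F0P3InnerFormClassificationV6.Sockets L H μ)
              (F0P3GHSideOfFibres.ghOfFibres ι T hT (⟨𝔨.traceGp, 𝔨.Smooth, PG, PH, nG, nH, trG, trH, 𝔨.Matches⟩ : F0P3InnerFormClassificationV6.Sockets L H μ) hg hsm trGS trHS)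
              (F0P3XiSideOfRecordSCD.xiSideOfRecordSCD L H (transpose_map_cmConjRingHom_eq_of_frame L ι H T hT) (isUnit_det_of_frame L ι H T hT) μω hμu μZ (keysOfKeysCaseTwo L μω hK μZ hquad)
                 (F0P3XiPacketFamilyOfRecordSCD.hSCD_of_cmCharIdentityPackageTestSigned L H (transpose_map_cmConjRingHom_eq_of_frame L ι H T hT) (isUnit_det_of_frame L ι H T hT) μω hμu (finExplicitCollection L H μω (finExplicitDelta_conj_left_all L H μω) (finExplicitDelta_conj_right_all L H μω)) mH mG νG νH μZ hQ)
                 (fun ξ => hexc_of_xiPinSphericalCofinite L μω hμu μZ (keysOfKeysCaseTwo L μω hK μZ hquad) hquad hLi ξ)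
                 νG evpG evpH ramG ramH PiXi ρXi)
              μω c jInf dsInf (archTr₀ L ι H T hT νGi) ν νG F0P3RamClsOfRecord.ramCls₀) S₀ ∧
            -- (P2) A-packet spectral data
            F0P3InnerFormClassificationV8.ClassificationKit.APacketSpectral
              (kitOfRecord L H ι T hT μ (⟨𝔨.traceGp, 𝔨.Smooth, PG, PH, nG, nH, trG, trH, 𝔨.Matches⟩ : F0P3InnerFormClassificationV6.Sockets L H μ)
              (F0P3GHSideOfFibres.ghOfFibres ι T hT (⟨𝔨.traceGp, 𝔨.Smooth, PG, PH, nG, nH, trG, trH, 𝔨.Matches⟩ : F0P3InnerFormClassificationV6.Sockets L H μ) hg hsm trGS trHS)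
              (F0P3XiSideOfRecordSCD.xiSideOfRecordSCD L H (transpose_map_cmConjRingHom_eq_of_frame L ι H T hT) (isUnit_det_of_frame L ι H T hT) μω hμu μZ (keysOfKeysCaseTwo L μω hK μZ hquad)
                 (F0P3XiPacketFamilyOfRecordSCD.hSCD_of_cmCharIdentityPackageTestSigned L H (transpose_map_cmConjRingHom_eq_of_frame L ι H T hT) (isUnit_det_of_frame L ι H T hT) μω hμu (finExplicitCollection L H μω (finExplicitDelta_conj_left_all L H μω) (finExplicitDelta_conj_right_all L H μω)) mH mG νG νH μZ hQ)
                 (fun ξ => hexc_of_xiPinSphericalCofinite L μω hμu μZ (keysOfKeysCaseTwo L μω hK μZ hquad) hquad hLi ξ)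
                 νG evpG evpH ramG ramH PiXi ρXi)
              μω c jInf dsInf (archTr₀ L ι H T hT νGi) ν νG F0P3RamClsOfRecord.ramCls₀) S₀ ∧
            -- (P3′) THE TWO PRODUCT-TRACE CLAUSES, BY ★ NAME: the `S`-level traces of Π(ξ) and of ξ ARE the signed ∕ unsigned products of the local A-packet characters at f′_S — ED. 3: the `G′`-clause carries the per-ξ global ROOT NUMBER `wXi ξ = ε(½, φ_ξ)` (★2 `GTraceProductFormW`) [Rogawski1992 Thm. 1.2: `ε(½, φ) Tr Π(ξ)(f)` in (14.6.3)]
            -- [Rogawski1990 §13.1 13.1.3 (b), Prop. 13.1.4 p. 199; §12.3 12.3.3 p. 178; Props. 14.4.1 (a), 14.4.2 (c); p. 243 l. 9 – p. 244 l. 17]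
            F0P3bLocalExpansionAtKitOfRecordW.GTraceProductFormW ι T hT (F0P3GHSideOfFibres.ghOfFibres ι T hT (⟨𝔨.traceGp, 𝔨.Smooth, PG, PH, nG, nH, trG, trH, 𝔨.Matches⟩ : F0P3InnerFormClassificationV6.Sockets L H μ) hg hsm trGS trHS)
              (F0P3XiSideOfRecordSCD.xiSideOfRecordSCD L H (transpose_map_cmConjRingHom_eq_of_frame L ι H T hT) (isUnit_det_of_frame L ι H T hT) μω hμu μZ (keysOfKeysCaseTwo L μω hK μZ hquad)
                 (F0P3XiPacketFamilyOfRecordSCD.hSCD_of_cmCharIdentityPackageTestSigned L H (transpose_map_cmConjRingHom_eq_of_frame L ι H T hT) (isUnit_det_of_frame L ι H T hT) μω hμu (finExplicitCollection L H μω (finExplicitDelta_conj_left_all L H μω) (finExplicitDelta_conj_right_all L H μω)) mH mG νG νH μZ hQ)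
                 (fun ξ => hexc_of_xiPinSphericalCofinite L μω hμu μZ (keysOfKeysCaseTwo L μω hK μZ hquad) hquad hLi ξ)
                 νG evpG evpH ramG ramH PiXi ρXi)
              μω wXi jInf dsInf (archTr₀ L ι H T hT νGi) νG ∧
            F0P3bLocalExpansionAtKitOfRecord.HTraceProductForm ι T hT (F0P3GHSideOfFibres.ghOfFibres ι T hT (⟨𝔨.traceGp, 𝔨.Smooth, PG, PH, nG, nH, trG, trH, 𝔨.Matches⟩ : F0P3InnerFormClassificationV6.Sockets L H μ) hg hsm trGS trHS)
              (F0P3XiSideOfRecordSCD.xiSideOfRecordSCD L H (transpose_map_cmConjRingHom_eq_of_frame L ι H T hT) (isUnit_det_of_frame L ι H T hT) μω hμu μZ (keysOfKeysCaseTwo L μω hK μZ hquad)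
                 (F0P3XiPacketFamilyOfRecordSCD.hSCD_of_cmCharIdentityPackageTestSigned L H (transpose_map_cmConjRingHom_eq_of_frame L ι H T hT) (isUnit_det_of_frame L ι H T hT) μω hμu (finExplicitCollection L H μω (finExplicitDelta_conj_left_all L H μω) (finExplicitDelta_conj_right_all L H μω)) mH mG νG νH μZ hQ)
                 (fun ξ => hexc_of_xiPinSphericalCofinite L μω hμu μZ (keysOfKeysCaseTwo L μω hK μZ hquad) hquad hLi ξ)
                 νG evpG evpH ramG ramH PiXi ρXi)
              μω c jInf dsInf (archTr₀ L ι H T hT νGi) νG ∧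
            -- (P4) packet anchors (option (J1): all packets)
            (∀ (Q : PG) (v : Places L), v ∉ S₀ → v ∉ ramG Q →
              letI : MeasurableSpace ((cmDatum L 3 H).Local v) := borel _
              ∃ π : IrrClass ((cmDatum L 3 H).Local v), π.IsAdmissible ∧ π.IsUnitarizable ∧
                π.IsSphericalWith (cmLocalIntegralLevel L 3 H v) (νG v) (evpG Q v)) ∧
            (∀ (ρ : PH) (v : Places L), v ∉ S₀ → v ∉ ramH ρ →
              letI : MeasurableSpace ((cmDatum L 3 H).Local v) := borel _
              ∃ π : IrrClass ((cmDatum L 3 H).Local v), π.IsAdmissible ∧ π.IsUnitarizable ∧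
                π.IsSphericalWith (cmLocalIntegralLevel L 3 H v) (νG v) (evpH ρ v)) ∧
            -- (P5) e.v.p. convention
            (∀ (Q : PG) (v : Places L) (f : (cmDatum L 3 H).Local v → ℂ),
              ¬ (HasCompactSupport f ∧ IsLevel (cmLocalIntegralLevel L 3 H v) f) → evpG Q v f = 0) ∧
            (∀ (ρ : PH) (v : Places L) (f : (cmDatum L 3 H).Local v → ℂ),
              ¬ (HasCompactSupport f ∧ IsLevel (cmLocalIntegralLevel L 3 H v) f) → evpH ρ v f = 0)

set_option synthInstance.maxHeartbeats 400000 in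
set_option maxHeartbeats 4000000 in
/-- SIGNED twin (Defs ED. 2 for closer ED. 26 «QCMT SIGNED»; desk F0P3-plan (g9) RULING D29; κ-sign `ε_v(H) = ω_w(−det H)`, LEAD RULING «K» K2, REF1 (g9) R-45∕R-46) of `k9_of_stf` above — its text VERBATIM under the token map τ {`CMCharIdentityPackageTest` ↦ `…Signed` (★ p842701), `hSCD_of_cmCharIdentityPackageTest` ↦ `…Signed` (★ p843355), `kitK9`∕`OverrideWitness`∕`Q_K9`∕`Rung0Witness`∕`StubRung0`∕`k9_of_stf` ↦ `…S`, `K9SpectralLetter` ↦ `K9SpectralLetterSigned`}; the unsigned original stays byte-identical (it serves the tree closer ED. 25 until ED. 26 is written and is thereafter the superseded negative edge «unsigned package in negative position — mis-typed as written»; pruning = a later Defs edition by desk ruling). **`k9_of_stfS` — BLOCK (W) AS A THEOREM**: the K9-∃ letter (`stub_K9`՚s statement, ED. 13 (J1) head) from the K9-STF letter (`stub_K9STFS`՚s statement over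
`K9SpectralLetterSigned`) — the junction body of ED. 17–19b (M-term absorption `ov`, ★ `F0P3GHSideOfFibres.ghOfFibres`, `SpecPkgT1` from (T), ★
`F0P3OverrideWitnessOfLetters.specPkg_kitOfRecord_ghOfFibres_of_productForm`) re-headed over the hypothesis `hSTF`; in the closer `stub_K9 := k9_of_stfS stub_K9STFS`.  ED. 3 (closer ED. 38 «PK-ε»): the ∃ of hypothesis and conclusion carries the root-number signs `wXi` with the law `hw` [Rogawski1992 Thm. 1.2], and the witness closes on ★5-W `specPkg_kitOfRecordW_ghOfFibres_of_productFormW` at ★1 `kitOfRecordW`.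
[cite: Rogawski1990, §14.6 Thm. 14.6.1 p. 241; §13.3 Thm. 13.3.7 p. 201; §13.7 p. 206] -/
theorem k9_of_stfS
    (hSTF :
      ∀ (L : Type) [Field L] [NumberField L] [IsCMField L] (ι : L →+* ℂ) (H : Matrix (Fin 3) (Fin 3) L) (T : GL (Fin 3) ℂ)
      (hT : (T : Matrix (Fin 3) (Fin 3) ℂ)ᴴ * H.map ι * (T : Matrix (Fin 3) (Fin 3) ℂ) = Literature.Geometry.ComplexHyperbolic.BallModel.J)
      (μ : Measure (Gp L H).automorphicQuotient) [(Gp L H).IsAutomorphicMeasure μ] (μω : HeckeCharacter L) (hμu : μω.IsUnitary)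
      (ν : @Measure (GpAdelic L H) (borel _))
      (νH : ∀ v : Places L, @Measure (HLocal L v) (borel _)) (νG : ∀ v : Places L, @Measure (GpLocal L H v) (borel _))
      (νGi : @Measure (GpInf L H) (borel _)) (νqi : @Measure (GInf L) (borel _)) (νHi : @Measure (HInf L) (borel _))
      (μZ : ∀ v : Places L, @Measure (Gqs L v ⧸ Subgroup.center (Gqs L v)) (borel _))
      (isHaar_ν : letI : MeasurableSpace (GpAdelic L H) := borel _; ν.IsHaarMeasure)
      (isInvInv_ν : letI : MeasurableSpace (GpAdelic L H) := borel _; ν.IsInvInvariant)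
      (isHaar_νH : ∀ v : Places L, letI : MeasurableSpace (HLocal L v) := borel _; (νH v).IsHaarMeasure)
      (isRightInv_νH : ∀ v : Places L, letI : MeasurableSpace (HLocal L v) := borel _; (νH v).IsMulRightInvariant)
      (isHaar_νG : ∀ v : Places L, letI : MeasurableSpace (GpLocal L H v) := borel _; (νG v).IsHaarMeasure)
      (isRightInv_νG : ∀ v : Places L, letI : MeasurableSpace (GpLocal L H v) := borel _; (νG v).IsMulRightInvariant)
      (finCpt_νGi : letI : MeasurableSpace (GpInf L H) := borel _; IsFiniteMeasureOnCompacts νGi)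
      (rightInv_νGi : letI : MeasurableSpace (GpInf L H) := borel _; νGi.IsMulRightInvariant)
      (finCpt_νqi : letI : MeasurableSpace (GInf L) := borel _; IsFiniteMeasureOnCompacts νqi)
      (rightInv_νqi : letI : MeasurableSpace (GInf L) := borel _; νqi.IsMulRightInvariant)
      (finCpt_νHi : letI : MeasurableSpace (HInf L) := borel _; IsFiniteMeasureOnCompacts νHi)
      (rightInv_νHi : letI : MeasurableSpace (HInf L) := borel _; νHi.IsMulRightInvariant)
      (isHaar_μZ : ∀ v : Places L, letI : MeasurableSpace (Gqs L v ⧸ Subgroup.center (Gqs L v)) := borel _; (μZ v).IsHaarMeasure)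
      (hquad : ∀ v : Places L, (∀ w : PlacesOver L v, IsCMField.complexConj L • w.1 = w.1) →
        IsQuadraticCharExtension (conjLocal L (IsCMField.complexConj L) v) (μω.semilocalComponent L v)),
        -- (K9-∃) THE LETTER DELIVERS the global sign, the per-ξ ROOT NUMBERS `wXi ξ = ε(½, φ_ξ) = ±1` (ED. 3 [Rogawski1992 Thm. 1.2]) and the archimedean classes WITH their R3∕R4 clauses (print: `c = ε`, `jInf∕dsInf = [J_φ^{±}]∕[D_φ]`,
        -- [Rogawski1990 §12.3 pp. 178–179; Prop. 15.2.1]; R3∕R4 for them: [BorelWallach2000 I §5.3 (Wigner), II §5.4, VI Thm. 4.11]) — NOT ∀-quantified over them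
        ∃ (c : ℚ) (wXi : OneDimAutRepH L → ℤ) (jInf dsInf : ℤ → ℤ → ℤ → Cinf), (c = 1 ∨ c = -1) ∧ (∀ ξ, wXi ξ = 1 ∨ wXi ξ = -1) ∧ JInfNoDegOne jInf ∧ DsInfNoDegOne dsInf ∧
          (∀ p q t : ℤ, IsCohUnitaryClass (jInf p q t)) ∧ (∀ p q t : ℤ, IsCohUnitaryClass (dsInf p q t)) ∧
        K9SpectralLetterSigned L ι H T hT μ μω hμu ν νH νG νGi νqi νHi μZ isHaar_ν isInvInv_ν isHaar_νH isRightInv_νH isHaar_νG isRightInv_νG finCpt_νGi rightInv_νGi finCpt_νqi rightInv_νqi finCpt_νHi rightInv_νHi isHaar_μZ hquad c wXi jInf dsInf) :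
  ∀ (L : Type) [Field L] [NumberField L] [IsCMField L] (ι : L →+* ℂ) (H : Matrix (Fin 3) (Fin 3) L) (T : GL (Fin 3) ℂ)
  (hT : (T : Matrix (Fin 3) (Fin 3) ℂ)ᴴ * H.map ι * (T : Matrix (Fin 3) (Fin 3) ℂ) = Literature.Geometry.ComplexHyperbolic.BallModel.J)
  (μ : Measure (Gp L H).automorphicQuotient) [(Gp L H).IsAutomorphicMeasure μ] (μω : HeckeCharacter L) (hμu : μω.IsUnitary)
  (ν : @Measure (GpAdelic L H) (borel _))
  (νH : ∀ v : Places L, @Measure (HLocal L v) (borel _)) (νG : ∀ v : Places L, @Measure (GpLocal L H v) (borel _))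
  (νGi : @Measure (GpInf L H) (borel _)) (νqi : @Measure (GInf L) (borel _)) (νHi : @Measure (HInf L) (borel _))
  (μZ : ∀ v : Places L, @Measure (Gqs L v ⧸ Subgroup.center (Gqs L v)) (borel _))
  (isHaar_ν : letI : MeasurableSpace (GpAdelic L H) := borel _; ν.IsHaarMeasure)
  (isInvInv_ν : letI : MeasurableSpace (GpAdelic L H) := borel _; ν.IsInvInvariant)
  (isHaar_νH : ∀ v : Places L, letI : MeasurableSpace (HLocal L v) := borel _; (νH v).IsHaarMeasure)
  (isRightInv_νH : ∀ v : Places L, letI : MeasurableSpace (HLocal L v) := borel _; (νH v).IsMulRightInvariant)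
  (isHaar_νG : ∀ v : Places L, letI : MeasurableSpace (GpLocal L H v) := borel _; (νG v).IsHaarMeasure)
  (isRightInv_νG : ∀ v : Places L, letI : MeasurableSpace (GpLocal L H v) := borel _; (νG v).IsMulRightInvariant)
  (finCpt_νGi : letI : MeasurableSpace (GpInf L H) := borel _; IsFiniteMeasureOnCompacts νGi)
  (rightInv_νGi : letI : MeasurableSpace (GpInf L H) := borel _; νGi.IsMulRightInvariant)
  (finCpt_νqi : letI : MeasurableSpace (GInf L) := borel _; IsFiniteMeasureOnCompacts νqi)
  (rightInv_νqi : letI : MeasurableSpace (GInf L) := borel _; νqi.IsMulRightInvariant)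
  (finCpt_νHi : letI : MeasurableSpace (HInf L) := borel _; IsFiniteMeasureOnCompacts νHi)
  (rightInv_νHi : letI : MeasurableSpace (HInf L) := borel _; νHi.IsMulRightInvariant)
  (isHaar_μZ : ∀ v : Places L, letI : MeasurableSpace (Gqs L v ⧸ Subgroup.center (Gqs L v)) := borel _; (μZ v).IsHaarMeasure)
  (hquad : ∀ v : Places L, (∀ w : PlacesOver L v, IsCMField.complexConj L • w.1 = w.1) →
    IsQuadraticCharExtension (conjLocal L (IsCMField.complexConj L) v) (μω.semilocalComponent L v)),
    -- (K9-∃) THE LETTER DELIVERS the global sign, the per-ξ ROOT NUMBERS `wXi ξ = ε(½, φ_ξ) = ±1` (ED. 3 [Rogawski1992 Thm. 1.2]) and the archimedean classes WITH their R3∕R4 clauses (print: `c = ε`, `jInf∕dsInf = [J_φ^{±}]∕[D_φ]`,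
    -- [Rogawski1990 §12.3 pp. 178–179; Prop. 15.2.1]; R3∕R4 for them: [BorelWallach2000 I §5.3 (Wigner), II §5.4, VI Thm. 4.11]) — NOT ∀-quantified over them
    ∃ (c : ℚ) (wXi : OneDimAutRepH L → ℤ) (jInf dsInf : ℤ → ℤ → ℤ → Cinf), (c = 1 ∨ c = -1) ∧ (∀ ξ, wXi ξ = 1 ∨ wXi ξ = -1) ∧ JInfNoDegOne jInf ∧ DsInfNoDegOne dsInf ∧
      (∀ p q t : ℤ, IsCohUnitaryClass (jInf p q t)) ∧ (∀ p q t : ℤ, IsCohUnitaryClass (dsInf p q t)) ∧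
    letI : ∀ (v : Places L) (a : HLocal L v), MeasurableSpace (HLocal L v ⧸ Subgroup.centralizer ({a} : Set (HLocal L v))) := fun _ _ => borel _
    letI : ∀ (v : Places L) (γ : (cmDatum L 3 H).Local v),
        MeasurableSpace ((cmDatum L 3 H).Local v ⧸ Subgroup.centralizer ({γ} : Set ((cmDatum L 3 H).Local v))) := fun _ _ => borel _
    haveI : ∀ (v : Places L) (a : HLocal L v), BorelSpace (HLocal L v ⧸ Subgroup.centralizer ({a} : Set (HLocal L v))) := fun _ _ => ⟨rfl⟩
    haveI : ∀ (v : Places L) (γ : (cmDatum L 3 H).Local v),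
        BorelSpace ((cmDatum L 3 H).Local v ⧸ Subgroup.centralizer ({γ} : Set ((cmDatum L 3 H).Local v))) := fun _ _ => ⟨rfl⟩
    ∀ (mH : ∀ v : Places L, OrbitalMeasureFamily (HLocal L v)) (mG : ∀ v : Places L, OrbitalMeasureFamily ((cmDatum L 3 H).Local v)),
      letI : MeasurableSpace (GpAdelic L H) := borel _
      haveI : BorelSpace (GpAdelic L H) := ⟨rfl⟩
      haveI : ν.IsHaarMeasure := isHaar_ν
      haveI : ν.IsInvInvariant := isInvInv_ν
      letI : ∀ v : Places L, MeasurableSpace (GpLocal L H v) := fun _ => borel _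
      haveI : ∀ v : Places L, BorelSpace (GpLocal L H v) := fun _ => ⟨rfl⟩
      letI : ∀ v : Places L, MeasurableSpace (HLocal L v) := fun _ => borel _
      haveI : ∀ v : Places L, BorelSpace (HLocal L v) := fun _ => ⟨rfl⟩
      letI : ∀ (v : Places L) (a : HLocal L v), MeasurableSpace (HLocal L v ⧸ Subgroup.centralizer ({a} : Set (HLocal L v))) := fun _ _ => borel _
      letI : ∀ (v : Places L) (γ : GpLocal L H v), MeasurableSpace (GpLocal L H v ⧸ Subgroup.centralizer ({γ} : Set (GpLocal L H v))) := fun _ _ => borel _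
      letI : MeasurableSpace (GpInf L H) := borel _
      haveI : BorelSpace (GpInf L H) := ⟨rfl⟩
      letI : MeasurableSpace (GInf L) := borel _
      haveI : BorelSpace (GInf L) := ⟨rfl⟩
      letI : MeasurableSpace (HInf L) := borel _
      haveI : BorelSpace (HInf L) := ⟨rfl⟩
      haveI : ∀ v : Places L, (νH v).IsHaarMeasure := isHaar_νH
      haveI : ∀ v : Places L, (νH v).IsMulRightInvariant := isRightInv_νH
      haveI : ∀ v : Places L, (νG v).IsHaarMeasure := isHaar_νG
      haveI : ∀ v : Places L, (νG v).IsMulRightInvariant := isRightInv_νG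
      haveI : IsFiniteMeasureOnCompacts νGi := finCpt_νGi
      haveI : νGi.IsMulRightInvariant := rightInv_νGi
      haveI : IsFiniteMeasureOnCompacts νqi := finCpt_νqi
      haveI : νqi.IsMulRightInvariant := rightInv_νqi
      haveI : IsFiniteMeasureOnCompacts νHi := finCpt_νHi
      haveI : νHi.IsMulRightInvariant := rightInv_νHi
      (∀ v : Places L, (mH v).IsCanonical (IsLocalGRegular L v) (νH v) ∧
          (mG v).IsCanonical (fun γ => IsRegularElt (γ.val : GL (Fin 3) (UnitaryGroup.LocalRing L v))) (νG v)) →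
      ∀ (𝔨 : ComparisonKit L H μ), 𝔨.IsPinned ν (archCanonicalTransferFactor L H μω) νH νG νGi νqi νHi → 𝔨.TransferExistence → 𝔨.SimpleTraceFormula → 𝔨.Δ = (finExplicitCollection L H μω (finExplicitDelta_conj_left_all L H μω) (finExplicitDelta_conj_right_all L H μω)) → 𝔨.mH = mH →
        (∀ (v : Places L) (c' : ConjClasses ((cmDatum L 3 H).Local v)),
          Literature.NumberTheory.Rogawski1990.IsRegularElt ((Quotient.out c').val : GL (Fin 3) (UnitaryGroup.LocalRing L v)) → 𝔨.mG v c' = mG v c') →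
        ∀ (hQ : CMCharIdentityPackageTestSigned L H (transpose_map_cmConjRingHom_eq_of_frame L ι H T hT) (isUnit_det_of_frame L ι H T hT) νH νG μω hμu (finExplicitCollection L H μω (finExplicitDelta_conj_left_all L H μω) (finExplicitDelta_conj_right_all L H μω)) mH mG)
          (hK : KeysCaseTwo L) (hLi : XiPinSphericalCofinite L),
          Nonempty (OverrideWitnessS L ι H T hT μ μω hμu ν νH νG νGi μZ c wXi jInf dsInf isHaar_ν isHaar_μZ hquad (finExplicitCollection L H μω (finExplicitDelta_conj_left_all L H μω) (finExplicitDelta_conj_right_all L H μω)) mH mG hQ hK hLi 𝔨) := by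
  intro L _ _ _ ι H T hT μ _ μω hμu ν νH νG νGi νqi νHi μZ hν hνi hνH hνHr hνG hνGr hGic hGir hqic hqir hHic hHir hμZ hquad
  obtain ⟨c, wXi, jInf, dsInf, hc, hw, hJ, hD, hJU, hDU, hrest⟩ :=
    hSTF L ι H T hT μ μω hμu ν νH νG νGi νqi νHi μZ hν hνi hνH hνHr hνG hνGr hGic hGir hqic hqir hHic hHir hμZ hquad
  refine ⟨c, wXi, jInf, dsInf, hc, hw, hJ, hD, hJU, hDU, ?_⟩
  intro mH mG hcan 𝔨 hpin htE hSTFa hΔ hmH hmG hQ hK hLi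
  -- instance preamble (the statement's `letI`s are not local instances after `intro`; same block as `Rung0Choice.rows`)
  letI : MeasurableSpace (GpAdelic L H) := borel _
  haveI : BorelSpace (GpAdelic L H) := ⟨rfl⟩
  haveI : ν.IsHaarMeasure := hν
  haveI : ν.IsInvInvariant := hνi
  letI : ∀ v : Places L, MeasurableSpace (GpLocal L H v) := fun _ => borel _
  haveI : ∀ v : Places L, BorelSpace (GpLocal L H v) := fun _ => ⟨rfl⟩
  letI : ∀ v : Places L, MeasurableSpace (HLocal L v) := fun _ => borel _
  haveI : ∀ v : Places L, BorelSpace (HLocal L v) := fun _ => ⟨rfl⟩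
  letI : ∀ (v : Places L) (a : HLocal L v), MeasurableSpace (HLocal L v ⧸ Subgroup.centralizer ({a} : Set (HLocal L v))) := fun _ _ => borel _
  letI : ∀ (v : Places L) (γ : GpLocal L H v), MeasurableSpace (GpLocal L H v ⧸ Subgroup.centralizer ({γ} : Set (GpLocal L H v))) := fun _ _ => borel _
  letI : MeasurableSpace (GpInf L H) := borel _
  haveI : BorelSpace (GpInf L H) := ⟨rfl⟩
  letI : MeasurableSpace (GInf L) := borel _
  haveI : BorelSpace (GInf L) := ⟨rfl⟩
  letI : MeasurableSpace (HInf L) := borel _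
  haveI : BorelSpace (HInf L) := ⟨rfl⟩
  haveI : ∀ v : Places L, (νH v).IsHaarMeasure := hνH
  haveI : ∀ v : Places L, (νH v).IsMulRightInvariant := hνHr
  haveI : ∀ v : Places L, (νG v).IsHaarMeasure := hνG
  haveI : ∀ v : Places L, (νG v).IsMulRightInvariant := hνGr
  haveI : IsFiniteMeasureOnCompacts νGi := hGic
  haveI : νGi.IsMulRightInvariant := hGir
  haveI : IsFiniteMeasureOnCompacts νqi := hqic
  haveI : νqi.IsMulRightInvariant := hqir
  haveI : IsFiniteMeasureOnCompacts νHi := hHic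
  haveI : νHi.IsMulRightInvariant := hHir
  letI : MeasurableSpace (Gp L H).Adelic := borel (GpAdelic L H)
  haveI : BorelSpace (Gp L H).Adelic := ⟨rfl⟩
  haveI : IsFiniteMeasureOnCompacts (show @Measure (Gp L H).Adelic (borel (GpAdelic L H)) from ν) :=
    (show @Measure.IsHaarMeasure (Gp L H).Adelic _ _ (borel _) ν from hν).toIsFiniteMeasureOnCompacts
  letI : ∀ v : Places L, MeasurableSpace (Gqs L v ⧸ Subgroup.center (Gqs L v)) := fun _ => borel _
  haveI : ∀ v : Places L, BorelSpace (Gqs L v ⧸ Subgroup.center (Gqs L v)) := fun _ => ⟨rfl⟩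
  haveI : ∀ v : Places L, (μZ v).IsHaarMeasure := hμZ
  -- the T1-side terms: smoothness of the record tensors (pin (iv)) and T1g
  have hsm : ∀ (S : Finset (Places L)) (fS : F0P3SemilocalTestFunctionsOfRecord.TestS₀ L H ι T hT S) (fT : F0P3TestFunctionsOfRecord.Unr₀ L H S), 𝔨.Smooth (F0P3SemilocalTestFunctionsOfRecord.tens₀ S fS fT) :=
    fun S fS fT => (ComparisonKit.IsPinned.smooth_iff 𝔨 hpin (F0P3SemilocalTestFunctionsOfRecord.tens₀ S fS fT)).2 (F0P3SemilocalTestFunctionsOfRecord.tens₀_smooth S fS fT)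
  obtain ⟨PG, PH, nG, nH, trG, trH, evpG, evpH, ramG, ramH, PiXi, ρXi, trGS, trHS, S₀, hT1, hP1, hP2, hPG, hPH, hAG, hAH, hcG, hcH⟩ :=
    hrest mH mG hcan 𝔨 hpin htE hSTFa hΔ hmH hmG hQ hK hLi htE hsm
  -- the override by M-TERM ABSORPTION
  let ov : SpecOverride L :=
    { SθG := fun f => ∑' Q : PG, nG Q * trG Q f, SθH := fun fH => ∑' ρ : PH, nH ρ * trH ρ fH,
      SθM := fun f => 𝔨.SJGtot f - ∑' Q : PG, nG Q * trG Q f, SJM := fun _ => 0,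
      SθMH := fun fH => 𝔨.SJHtot fH - ∑' ρ : PH, nH ρ * trH ρ fH, SJMH := fun _ => 0,
      PacketG := PG, PacketH := PH, nG := nG, nH := nH, trG := trG, trH := trH }
  -- smoothness of `f′` from `Matches` (pins (ix′-c) + (iv)), for T1d
  have hsmooth : ∀ (f' : F0P3InnerFormClassificationV6.TestGp L H) (f : F0P3InnerFormClassificationV6.TestG L) (fH : F0P3InnerFormClassificationV6.TestH L),
      𝔨.Matches f' f fH → 𝔨.Smooth f' := by
    intro f' f fH hm
    obtain ⟨T₁, -, hT₁, -, hf', -⟩ := ComparisonKit.IsPinned.transfer_tensors 𝔨 hpin hm.1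
    exact (ComparisonKit.IsPinned.smooth_iff 𝔨 hpin f').2 ⟨T₁, hT₁, hf'⟩
  have hspec : (𝔨.override ov).SpecPkgT1 :=
    { t1c := fun f' f fH _ => ⟨by show 𝔨.SJGtot f = (∑' Q : PG, nG Q * trG Q f) + (𝔨.SJGtot f - ∑' Q : PG, nG Q * trG Q f) - 0; ring,
                               by show 𝔨.SJHtot fH = (∑' ρ : PH, nH ρ * trH ρ fH) + (𝔨.SJHtot fH - ∑' ρ : PH, nH ρ * trH ρ fH) - 0; ring⟩
      t1d := fun f' f fH hm => by
        have h := (hT1 f' f fH (hsmooth f' f fH hm) hm).2.2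
        show (𝔨.SJGtot f - ∑' Q : PG, nG Q * trG Q f) + (1 / 2 : ℂ) * (𝔨.SJHtot fH - ∑' ρ : PH, nH ρ * trH ρ fH) - (0 + (1 / 2 : ℂ) * 0) = 0
        linear_combination h
      t1e := fun f' f hs ht => by
        obtain ⟨f₂, fH₂, hm₂⟩ := htE f' hs
        exact ⟨(hT1 f' f fH₂ hs ⟨ht, hm₂.2⟩).1, rfl⟩
      t1f := fun f' fH hs ht => by
        obtain ⟨f₂, fH₂, hm₂⟩ := htE f' hs
        exact ⟨(hT1 f' f₂ fH hs ⟨hm₂.1, ht⟩).2.1, rfl⟩ }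
  exact ⟨⟨ov, F0P3GHSideOfFibres.ghOfFibres ι T hT (socketsOfT1 L H μ (𝔨.override ov)) htE hsm trGS trHS,
      evpG, evpH, ramG, ramH, PiXi, ρXi, S₀, hspec,
      F0P3OverrideWitnessOfLettersW.specPkg_kitOfRecordW_ghOfFibres_of_productFormW ι T hT (socketsOfT1 L H μ (𝔨.override ov)) htE hsm trGS trHS _ μω wXi c jInf dsInf _ νG ν _ S₀ hw hc hP1 hP2 hPG hPH,
      hAG, hAH, hcG, hcH⟩⟩

end Rung0S

end Summit.HodgeConjecture.HodgeConjecture.Cruxes.H413.F0U3LettersRung1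

end
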